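import Literature.MathematicalPhysics.QuantumFieldTheory.Balaban1983to89.B4ThmTorusPairEta
import Literature.MathematicalPhysics.QuantumFieldTheory.Balaban1983to89.B4Cor23RegionPairFam

/-!
# `Balaban1983to89.B4Cor23TorusPairFam` — [Balaban1983RegularityDecay] COROLLARY 2.3 (2.30) AND ITS `δG` CLAUSE,
# pp. 580–581, ON THE FAMILY OF TORUS REGION PAIRS `Ω ⊂ Ω₀ ⊂ T_η` AT A (1.7)-REGULAR TORUS FIELD —
# `cor23Printed_torusPairFam : B4.Cor23Printed (torusPairFam F d ℓ a₋ a₊ m²₊ c β K)`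

statement-level skeleton of published theorems with citation tags; proofs where landed; nothing here is a claim about the Yang–Mills mass gap

CITATION HEADER.  T. Bałaban, *Regularity and decay of lattice Green's functions*, Commun. Math. Phys. **89** (1983)
571–597, doi:10.1007/bf01214744 [Balaban1983RegularityDecay] (cell paper B4; held text
`paper:balaban1983-cmp89-regularity-decay`, journal page = PDF page + 570; pp. 580–581 [PDF 10–11], p. 572 [PDF 2]).
Unit `lit-balaban-r01` gen 10 (B4 fold owner; HOME `run/shared/lean/pub/lit-balaban/`), SKELETON row **B4.Cor2.3** —
file 2 of the r01 g10 programme (file 1 = `B4Cor23RegionPairFam`, the lattice general-region-pair family).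

WHAT IS PRINTED.  pp. 580–581: «Corollary 2.3. If Ω and A are as in Proposition I.2.1, then there exist positive constants
c₀, δ₀ such that for arbitrary scalar field configurations f, f′ defined on Ω, we have |⟨f, G_k(Ω,A)f′⟩|,
|⟨f, D^η_{A,μ}G_k(Ω,A)f′⟩|, |⟨f, G_k(Ω,A)D^{η*}_{A,ν}f′⟩|, |⟨f, D^η_{A,μ}G_k(Ω,A)D^{η*}_{A,ν}f′⟩|
≤ c₀e^{−δ₀dist(supp f, supp f′)}‖f‖₂‖f′‖₂. (2.30)  The same inequalities hold for δG_k(Ω,Ω₀,A) with the additional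
factor e^{−δ₀(dist(supp f,Ω^c) + dist(supp f′,Ω^c))}. … Let us notice also that now there are no restrictions on supports
of f, f′».  p. 572: «Another common case is to consider operators on subsets of a torus T_η, e.g., T_η can be identified
with a rectangular parallelepiped in ηZ^d with periodic conditions.»

WHAT THIS MODULE PROVES.  The typed Corollary `B4.Cor23Printed` INHABITED on r01 g9's family
`B4TorusPairFam.torusPairFam F d ℓ a₋ a₊ m²₊ c β K` of torus region pairs (the carrier of `thmPrintedNN_torusPairFam`:
a torus `T_η = Π_ν ℤ/(nP_ν)` on representatives, a nested pair `Ω ⊆ Ω₀` of unions of unit blocks of the period box,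
running coefficient `a_k`, every torus component field `A` with (1.7) on `Ω₀`, every coupling; distances in the torus
sup-metric): `cor23Printed_torusPairFam` (§10), for EVERY block size `K`, with the lattice family's threshold `e₁`,
decay rate `δ₀/2` and constant `c₀e^{δ₀/2}(2 + 2(d+1)/(δ₀/2))^{d+1}` in terms of the lattice family's `(c₀, δ₀)` of
`B4Cor23RegionPairFam.cor23Printed_regionPairFam`.

THE ROUTE (periodic lifting in `L²`, our device, labelled so; the print treats the torus case as «another common case»
without a separate proof).  For torus sources `f, f′` and a near radius `S`, lift to r01 g9's lattice instance
`Ω̃_R ⊂ Ω̃₀,R ⊂ ηℤ^{d+1}` (`R = 2S + 2` copies of the period box in every direction, periodic field; `liftInst`).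
(i) §5 `pair_lift`: `⟨f, MG_Tψ⟩_Ω = ⟨f̃₀, M̃G̃N⟩ + ⟨f̃₀, M̃G̃ρ⟩` with `f̃₀ = (f∘π)·1_{copy 0}`, `N` the near source and
`ρ = H̃((G_Tψ)∘π) − N` (g9's `u∘π = G̃H̃(u∘π)` plus the intertwining identities; for the pairings with `D^{η*}_ν` the NEW
transposed intertwining identity `fld_regionDeriv_transpose_pull`, §2).  (ii) §3: the near source is the sum over the
`(2S+1)^{d+1}` copies `t` of the copy pieces `P_t` of `f′∘π`; each `⟨f̃₀, X̃_m P_t⟩` is a LATTICE pairing of Corollary 2.3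
(`B4Cor23RegionPairFam`) with `‖f̃₀‖₂ ≤ ‖f‖₂`, `‖P_t‖₂ ≤ ‖f′‖₂` (the projection is injective on a copy,
`sum_sq_piece_pull_le`) and `dist(supp f̃₀, supp P_t) ≥ max(dist_T(supp f, supp f′), |t|_∞ − 1)` (§6 `dist_piece`);
summing `e^{−(δ₀/2)(|t|_∞ − 1)}` over `t ∈ ℤ^{d+1}` costs `e^{δ₀/2}(2 + 4(d+1)/δ₀)^{d+1}` (§1 `sum_box_exp_neg_supNorm_le`).
(iii) §4: the residual `ρ` vanishes on the copies of index `≤ S − 1` (`fld_residual_eq_zero`, `fld_residualT_eq_zero`),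
so `⟨f̃₀, X̃ρ⟩` is a lattice pairing at distance `≥ S − 1` with `‖ρ‖₂ ≤ #Ω̃_R·‖ρ‖_∞ = O((S+1)^{d+1})` (§6 `tail_bound`,
§7 `card_lift_le`), a polynomially weighted exponential tail; `S → ∞` by §1 `le_of_forall_poly_exp_tail`.  (iv) the `δG`
clause (§7 `dstep`): the same with the `Ω₀` objects lifted to `Ω̃₀,R` (`pair_lift₀`, `extR_piece_pull`), the lattice `δG`
clause on the copy pieces (`dist_T(supp ·, Ω^c) ≤ dist(supp ·, Ω̃^c)` by g9's `le_cdist_lift`, §6) and two residual tails.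

HONEST SCOPE.  Exactly the scope of `B4TorusPairFam.torusPairFam` (abelian one-parameter flow (1.2), component fields,
torus on representatives with `P_ν` unit blocks per direction and fine period `≥ 3`, `K ∣ P_ν`, `Ω₀ ⊆` the period box of
labels, torus sup-metric in unit-lattice units, windows as the lattice family); the decay rate is HALF the lattice
family's and the constant carries the copy sum `e^{δ₀/2}(2 + 4(d+1)/δ₀)^{d+1}` — both our bookkeeping, not printed
numbers (the print asserts `c₀, δ₀` «independent of A, k, Ω» without values).  0 definitions, 0 new facts, 0 sorry.
-/

namespace Literature.MathematicalPhysics.QuantumFieldTheory.Balaban1983to89.B4Cor23TorusPairFam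

open Literature.MathematicalPhysics.QuantumFieldTheory.Balaban1983to89
open Literature.MathematicalPhysics.QuantumFieldTheory.Balaban1983to89.B4TorusPositivity (wrap box mem_box wrap_mem_box
  wrap_eq_self_of_mem wrap_wrap_add)
open Literature.MathematicalPhysics.QuantumFieldTheory.Balaban1983to89.B4Reflection242 (boxDom mem_boxDom nbrs mem_nbrs
  blk blk_mem_boxDom blk_mul supNorm_add_le supNorm_le_of_forall)
open Literature.MathematicalPhysics.QuantumFieldTheory.Balaban1983to89.B4GaugeCovariance
open Literature.MathematicalPhysics.QuantumFieldTheory.Balaban1983to89.B4ContourShift (supNorm supNorm_nonneg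
  exists_supNorm_eq abs_le_supNorm)
open Literature.MathematicalPhysics.QuantumFieldTheory.Balaban1983to89.B4Lower18 (fineDom mem_fineDom)
open Literature.MathematicalPhysics.QuantumFieldTheory.Balaban1983to89.B4Lower18Regular (e1 dotProduct_eq_sum_fld dotProduct_self_nonneg')
open Literature.MathematicalPhysics.QuantumFieldTheory.Balaban1983to89.B4Lower18RegularRegion (compField)
open Literature.MathematicalPhysics.QuantumFieldTheory.Balaban1983to89.B4Lemma21Region (regionOp regionDeriv siteNorm
  covDeriv dirKer fld_covDeriv_mulVec_of_mem fld_covDeriv_mulVec_of_not_mem)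
open Literature.MathematicalPhysics.QuantumFieldTheory.Balaban1983to89.B4Lemma22Reduce231 (supN le_supN supN_nonneg
  supN_le siteNorm_nonneg siteNorm_zero siteNorm_add_le siteNorm_smul fld_zero)
open Literature.MathematicalPhysics.QuantumFieldTheory.Balaban1983to89.B4Lemma22ReduceDeriv (siteNorm_flow)
open Literature.MathematicalPhysics.QuantumFieldTheory.Balaban1983to89.B4Lemma22HolderBox (siteNorm_sub_le)
open Literature.MathematicalPhysics.QuantumFieldTheory.Balaban1983to89.B4RegionCubeCarrier (incl fineDom_mono)
open Literature.MathematicalPhysics.QuantumFieldTheory.Balaban1983to89.B4ThmRegionPairEta (RegionPairInst regionPairFam)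
open Literature.MathematicalPhysics.QuantumFieldTheory.Balaban1983to89.B4TorusRegionOp
open Literature.MathematicalPhysics.QuantumFieldTheory.Balaban1983to89.B4TorusRegionLift
open Literature.MathematicalPhysics.QuantumFieldTheory.Balaban1983to89.B4TorusPairFam
open Literature.MathematicalPhysics.QuantumFieldTheory.Balaban1983to89.B4ThmTorusPairEta
open scoped Matrix

open Filter Topology

noncomputable section

variable {d : ℕ} {ι : Type} [Fintype ι] [DecidableEq ι]

/-! ## §1. Analysis tools: polynomially weighted exponential tails; the lattice sum over copies -/

/-- `(R+1)^q e^{−δR} → 0` along the naturals (`δ > 0`). [folklore] -/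
private theorem tendsto_pow_mul_exp_neg (q : ℕ) {δ : ℝ} (hδ : 0 < δ) :
    Tendsto (fun R : ℕ => ((R : ℝ) + 1) ^ q * Real.exp (-(δ * R))) atTop (𝓝 0) := by
  -- `(R+1)^q e^{−δR} = δ^{−q} e^{δ} · ((δ(R+1))^q e^{−δ(R+1)})`
  have h1 : Tendsto (fun R : ℕ => δ * ((R : ℝ) + 1)) atTop atTop := by
    refine Tendsto.const_mul_atTop hδ ?_
    exact tendsto_natCast_atTop_atTop.atTop_add tendsto_const_nhds
  have h2 := (Real.tendsto_pow_mul_exp_neg_atTop_nhds_zero q).comp h1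
  have h3 : Tendsto (fun R : ℕ => (δ ^ q)⁻¹ * Real.exp δ * ((δ * ((R : ℝ) + 1)) ^ q * Real.exp (-(δ * ((R : ℝ) + 1)))))
      atTop (𝓝 ((δ ^ q)⁻¹ * Real.exp δ * 0)) := h2.const_mul _
  rw [mul_zero] at h3
  refine h3.congr fun R => ?_
  have hδq : δ ^ q ≠ 0 := pow_ne_zero _ hδ.ne'
  have hee : Real.exp δ * Real.exp (-δ) = 1 := by rw [← Real.exp_add, add_neg_cancel, Real.exp_zero]
  rw [mul_pow, show -(δ * ((R : ℝ) + 1)) = -(δ * R) + -δ by ring, Real.exp_add,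
    show (δ ^ q)⁻¹ * Real.exp δ * (δ ^ q * ((R : ℝ) + 1) ^ q * (Real.exp (-(δ * R)) * Real.exp (-δ)))
      = ((δ ^ q)⁻¹ * δ ^ q) * (Real.exp δ * Real.exp (-δ)) * (((R : ℝ) + 1) ^ q * Real.exp (-(δ * R))) by ring,
    inv_mul_cancel₀ hδq, hee, one_mul, one_mul]

/-- **VANISHING POLYNOMIALLY WEIGHTED TAILS**: `a ≤ b + c(R+1)^q e^{−δR}` for all large `R ∈ ℕ` forces `a ≤ b`.
[cite: Balaban1983RegularityDecay, (2.30) p.580 «e^{−δ₀dist}», dictionary] -/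
theorem le_of_forall_poly_exp_tail {a b c δ : ℝ} (q : ℕ) (hδ : 0 < δ) (R₀ : ℕ)
    (h : ∀ R : ℕ, R₀ ≤ R → a ≤ b + c * ((R : ℝ) + 1) ^ q * Real.exp (-(δ * R))) : a ≤ b := by
  have ht : Tendsto (fun R : ℕ => b + c * (((R : ℝ) + 1) ^ q * Real.exp (-(δ * R)))) atTop (𝓝 (b + c * 0)) :=
    ((tendsto_pow_mul_exp_neg q hδ).const_mul c).const_add b
  rw [mul_zero, add_zero] at ht
  refine le_of_tendsto_of_tendsto tendsto_const_nhds ht ?_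
  rw [EventuallyLE, eventually_atTop]
  exact ⟨R₀, fun R hR => by rw [← mul_assoc]; exact h R hR⟩

/-- the one-dimensional geometric bound: `Σ_{m < N} r^m ≤ 1/(1 − r)` for `0 ≤ r < 1`. [folklore] -/
private theorem geom_sum_le_inv {r : ℝ} (hr0 : 0 ≤ r) (hr1 : r < 1) (N : ℕ) :
    ∑ m ∈ Finset.range N, r ^ m ≤ 1 / (1 - r) := by
  have h := geom_sum_mul_neg r N
  have h1 : 0 < 1 - r := by linarith
  rw [le_div_iff₀ h1, h]
  have : 0 ≤ r ^ N := pow_nonneg hr0 N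
  linarith

/-- `1/(1 − e^{−κ}) ≤ 1 + 1/κ` for `κ > 0`. [folklore] -/
private theorem inv_one_sub_exp_le {κ : ℝ} (hκ : 0 < κ) : 1 / (1 - Real.exp (-κ)) ≤ 1 + 1 / κ := by
  have h1 : κ + 1 ≤ Real.exp κ := Real.add_one_le_exp κ
  have h2 : Real.exp (-κ) * Real.exp κ = 1 := by rw [← Real.exp_add, neg_add_cancel, Real.exp_zero]
  have h3 : 0 < Real.exp (-κ) := Real.exp_pos _
  have h4 : Real.exp (-κ) ≤ 1 / (κ + 1) := by
    rw [le_div_iff₀ (by linarith)]; nlinarith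
  have h5 : 0 < 1 - Real.exp (-κ) := by
    have : 1 / (κ + 1) < 1 := by rw [div_lt_one (by linarith)]; linarith
    linarith
  rw [div_le_iff₀ h5]
  have h6 : 1 - Real.exp (-κ) ≥ κ / (κ + 1) := by
    have : 1 - 1 / (κ + 1) = κ / (κ + 1) := by field_simp; ring
    linarith
  have h7 : (1 + 1 / κ) * (κ / (κ + 1)) = 1 := by field_simp
  nlinarith [h6, show 0 ≤ 1 + 1 / κ by positivity]

/-- a union bound for sums of non-negative terms. [folklore] -/
private theorem sum_union_le' {α : Type*} [DecidableEq α] (A B : Finset α) {g : α → ℝ} (hg : ∀ x, 0 ≤ g x) :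
    ∑ x ∈ A ∪ B, g x ≤ ∑ x ∈ A, g x + ∑ x ∈ B, g x := by
  rw [← Finset.union_sdiff_self_eq_union, Finset.sum_union Finset.disjoint_sdiff]
  exact add_le_add le_rfl (Finset.sum_le_sum_of_subset_of_nonneg Finset.sdiff_subset fun x _ _ => hg x)

/-- the one-dimensional lattice sum: `Σ_{s ∈ [−S,S]} e^{−κ|s|} ≤ 2 + 2/κ`. [folklore] -/
private theorem sum_Icc_exp_neg_abs_le {κ : ℝ} (hκ : 0 < κ) (S : ℕ) :
    ∑ s ∈ Finset.Icc (-(S : ℤ)) S, Real.exp (-(κ * |(s : ℝ)|)) ≤ 2 + 2 / κ := by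
  have hr0 : 0 ≤ Real.exp (-κ) := (Real.exp_pos _).le
  have hr1 : Real.exp (-κ) < 1 := Real.exp_lt_one_iff.2 (by linarith)
  -- `[−S, S] ⊆ {m : m ≤ S} ∪ {−m : m ≤ S}`
  have hcover : Finset.Icc (-(S : ℤ)) S
      ⊆ (Finset.range (S + 1)).image (fun m : ℕ => (m : ℤ)) ∪ (Finset.range (S + 1)).image (fun m : ℕ => -(m : ℤ)) := by
    intro s hs
    obtain ⟨h1, h2⟩ := Finset.mem_Icc.1 hs
    rcases le_or_gt 0 s with h0 | h0
    · exact Finset.mem_union_left _ (Finset.mem_image.2 ⟨s.toNat, Finset.mem_range.2 (by omega), by omega⟩)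
    · exact Finset.mem_union_right _ (Finset.mem_image.2 ⟨(-s).toNat, Finset.mem_range.2 (by omega), by omega⟩)
  have hnn : ∀ s ∈ (Finset.range (S + 1)).image (fun m : ℕ => (m : ℤ)) ∪ (Finset.range (S + 1)).image (fun m : ℕ => -(m : ℤ)),
      0 ≤ Real.exp (-(κ * |(s : ℝ)|)) := fun _ _ => (Real.exp_pos _).le
  have hone : ∀ (g : ℕ → ℤ), (∀ m, |((g m : ℤ) : ℝ)| = m) → Function.Injective g →
      ∑ s ∈ (Finset.range (S + 1)).image g, Real.exp (-(κ * |(s : ℝ)|)) ≤ 1 + 1 / κ := by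
    intro g hg hinj
    rw [Finset.sum_image fun a _ b _ h => hinj h]
    have : ∑ m ∈ Finset.range (S + 1), Real.exp (-(κ * |((g m : ℤ) : ℝ)|))
        = ∑ m ∈ Finset.range (S + 1), Real.exp (-κ) ^ m := by
      refine Finset.sum_congr rfl fun m _ => ?_
      rw [hg, ← Real.exp_nat_mul]; congr 1; ring
    rw [this]
    exact (geom_sum_le_inv hr0 hr1 _).trans (inv_one_sub_exp_le hκ)
  calc ∑ s ∈ Finset.Icc (-(S : ℤ)) S, Real.exp (-(κ * |(s : ℝ)|))
      ≤ ∑ s ∈ (Finset.range (S + 1)).image (fun m : ℕ => (m : ℤ)) ∪ (Finset.range (S + 1)).image (fun m : ℕ => -(m : ℤ)),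
          Real.exp (-(κ * |(s : ℝ)|)) := Finset.sum_le_sum_of_subset_of_nonneg hcover fun s hs _ => hnn s hs
    _ ≤ ∑ s ∈ (Finset.range (S + 1)).image (fun m : ℕ => (m : ℤ)), Real.exp (-(κ * |(s : ℝ)|))
        + ∑ s ∈ (Finset.range (S + 1)).image (fun m : ℕ => -(m : ℤ)), Real.exp (-(κ * |(s : ℝ)|)) :=
          sum_union_le' _ _ fun _ => (Real.exp_pos _).le
    _ ≤ (1 + 1 / κ) + (1 + 1 / κ) := add_le_add (hone _ (fun m => by simp) Nat.cast_injective)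
          (hone _ (fun m => by simp) (fun a b h => by exact_mod_cast neg_inj.1 h))
    _ = 2 + 2 / κ := by ring

/-- **THE LATTICE SUM OVER COPIES**: `Σ_{t ∈ [−S,S]^{d+1}} e^{−κ|t|_∞} ≤ (2 + 2(d+1)/κ)^{d+1}` (split `|t|_∞ ≥ Σ_ν|t_ν|/(d+1)`
and sum the product of one-dimensional geometric series). [cite: Balaban1983RegularityDecay, p.572 «periodic conditions», (2.30) p.580, dictionary] -/
theorem sum_box_exp_neg_supNorm_le {κ : ℝ} (hκ : 0 < κ) (S : ℕ) :
    ∑ t ∈ Fintype.piFinset (fun _ : Fin (d + 1) => Finset.Icc (-(S : ℤ)) S), Real.exp (-(κ * supNorm t))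
      ≤ (2 + 2 * ((d : ℝ) + 1) / κ) ^ (d + 1) := by
  have hd : (0 : ℝ) < (d : ℝ) + 1 := by positivity
  set κ' : ℝ := κ / ((d : ℝ) + 1) with hκ'
  have hκ'0 : 0 < κ' := div_pos hκ hd
  -- termwise: `e^{−κ|t|_∞} ≤ Π_ν e^{−κ′|t_ν|}`
  have hterm : ∀ t : Fin (d + 1) → ℤ,
      Real.exp (-(κ * supNorm t)) ≤ ∏ ν, Real.exp (-(κ' * |((t ν : ℤ) : ℝ)|)) := by
    intro t
    rw [← Real.exp_sum]
    refine Real.exp_le_exp.2 ?_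
    have h1 : ∀ ν ∈ (Finset.univ : Finset (Fin (d + 1))), -(κ' * supNorm t) ≤ -(κ' * |((t ν : ℤ) : ℝ)|) := by
      intro ν _
      have := abs_le_supNorm t ν
      rw [Int.cast_abs] at this
      nlinarith
    refine le_trans (le_of_eq ?_) (Finset.sum_le_sum h1)
    rw [Finset.sum_const, Finset.card_univ, Fintype.card_fin, nsmul_eq_mul, hκ']
    field_simp
    push_cast
    ring
  calc ∑ t ∈ Fintype.piFinset (fun _ : Fin (d + 1) => Finset.Icc (-(S : ℤ)) S), Real.exp (-(κ * supNorm t))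
      ≤ ∑ t ∈ Fintype.piFinset (fun _ : Fin (d + 1) => Finset.Icc (-(S : ℤ)) S),
          ∏ ν, Real.exp (-(κ' * |((t ν : ℤ) : ℝ)|)) := Finset.sum_le_sum fun t _ => hterm t
    _ = ∏ _ν : Fin (d + 1), ∑ s ∈ Finset.Icc (-(S : ℤ)) S, Real.exp (-(κ' * |((s : ℤ) : ℝ)|)) :=
        Finset.sum_prod_piFinset _ fun _ s => Real.exp (-(κ' * |((s : ℤ) : ℝ)|))
    _ ≤ ∏ _ν : Fin (d + 1), (2 + 2 / κ') := by
        refine Finset.prod_le_prod (fun _ _ => Finset.sum_nonneg fun _ _ => (Real.exp_pos _).le) fun _ _ => ?_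
        exact sum_Icc_exp_neg_abs_le hκ'0 S
    _ = (2 + 2 * ((d : ℝ) + 1) / κ) ^ (d + 1) := by
        rw [Finset.prod_const, Finset.card_univ, Fintype.card_fin, hκ']
        congr 1
        field_simp


/-! ## §2. The transposed covariant derivatives `D^{η*}_{A,μ}`, at a site; the intertwining identity for `D^{η*}` -/

/-- **`D^{η*}_{W,μ}` AT A SITE** (lattice region `R`, Neumann conditions): `(D^{η*}Φ)(z) = n·W(z−e_μ,z)^*Φ(z−e_μ)·[z−e_μ ∈ R]
− n·Φ(z)·[z+e_μ ∈ R]`. [cite: Balaban1983RegularityDecay, (1.3) p.572, (2.30) p.580 «D^{η*}_{A,ν}», dictionary] -/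
theorem fld_covDeriv_transpose_mulVec (n : ℕ) {R : Finset (Fin (d + 1) → ℤ)} (W : ↥R → ↥R → Matrix ι ι ℝ)
    (μ : Fin (d + 1)) (Φ : ↥R × ι → ℝ) (z : ↥R) :
    fld ((covDeriv n R W μ)ᵀ *ᵥ Φ) z
      = (if h : z.1 - e1 μ ∈ R then (n : ℝ) • ((W ⟨z.1 - e1 μ, h⟩ z)ᵀ *ᵥ fld Φ ⟨z.1 - e1 μ, h⟩) else 0)
        - (if z.1 + e1 μ ∈ R then (n : ℝ) • fld Φ z else 0) := by
  rw [covDeriv, blockOp_transpose, fld_blockOp_mulVec]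
  have hK : ∀ y : ↥R, (dirKer n R W μ y z)ᵀ *ᵥ fld Φ y
      = (if y.1 + e1 μ ∈ R then (if z.1 = y.1 + e1 μ then (n : ℝ) • ((W y z)ᵀ *ᵥ fld Φ y) else 0) else 0)
        - (if y.1 + e1 μ ∈ R then (if z = y then (n : ℝ) • fld Φ y else 0) else 0) := by
    intro y
    unfold dirKer
    by_cases h1 : y.1 + e1 μ ∈ R
    · simp only [if_pos h1]
      rw [Matrix.transpose_smul, Matrix.transpose_sub, Matrix.smul_mulVec, Matrix.sub_mulVec, smul_sub]
      congr 1
      · split_ifs <;> simp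
      · split_ifs <;> simp
    · simp only [if_neg h1, Matrix.transpose_zero, Matrix.zero_mulVec, sub_zero]
  simp_rw [hK]
  rw [Finset.sum_sub_distrib]
  congr 1
  · by_cases h : z.1 - e1 μ ∈ R
    · rw [dif_pos h, Finset.sum_eq_single ⟨z.1 - e1 μ, h⟩]
      · have e : (⟨z.1 - e1 μ, h⟩ : ↥R).1 + e1 μ = z.1 := by simp
        rw [if_pos (by rw [e]; exact z.2), if_pos e.symm]
      · intro y _ hy
        by_cases h1 : y.1 + e1 μ ∈ R
        · rw [if_pos h1, if_neg]
          intro h2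
          apply hy
          apply Subtype.ext
          show y.1 = z.1 - e1 μ
          rw [h2]; simp
        · rw [if_neg h1]
      · intro hh; exact absurd (Finset.mem_univ _) hh
    · rw [dif_neg h]
      refine Finset.sum_eq_zero fun y _ => ?_
      by_cases h1 : y.1 + e1 μ ∈ R
      · rw [if_pos h1, if_neg]
        intro h2
        apply h
        rw [h2, add_sub_cancel_right]
        exact y.2
      · rw [if_neg h1]
  · rw [Finset.sum_eq_single z]
    · by_cases h1 : z.1 + e1 μ ∈ R
      · rw [if_pos h1, if_pos rfl, if_pos h1]
      · rw [if_neg h1, if_neg h1]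
    · intro y _ hy
      by_cases h1 : y.1 + e1 μ ∈ R
      · rw [if_pos h1, if_neg (Ne.symm hy)]
      · rw [if_neg h1]
    · intro hh; exact absurd (Finset.mem_univ _) hh

omit [Fintype ι] [DecidableEq ι] in
/-- on representatives of the period box, `z = π(y + e_μ) ⟺ y = π(z − e_μ)`. [cite: Balaban1983RegularityDecay, p.572 «periodic conditions», dictionary] -/
theorem eq_twrap_add_iff_eq_twrap_sub {n : ℕ} {P : Fin (d + 1) → ℕ} {y z : Fin (d + 1) → ℤ}
    (hy : y ∈ boxDom (per n P)) (hz : z ∈ boxDom (per n P)) (μ : Fin (d + 1)) :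
    z = twrap n P (y + e1 μ) ↔ y = twrap n P (z - e1 μ) := by
  constructor
  · intro h
    rw [h, sub_eq_add_neg, twrap_twrap_add, add_neg_cancel_right, twrap_eq_self hy]
  · intro h
    rw [h, twrap_twrap_add, sub_add_cancel, twrap_eq_self hz]

/-- **`D^{η*}_{W,μ}` AT A SITE OF A TORUS REGION** (representatives in the period box): `(D^{η*}Φ)(z) =
n·W(π(z−e_μ),z)^*Φ(π(z−e_μ))·[π(z−e_μ) ∈ R] − n·Φ(z)·[π(z+e_μ) ∈ R]`. [cite: Balaban1983RegularityDecay, (1.3) p.572 «operators on subsets of a torus T_η», (2.30) p.580, dictionary] -/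
theorem fld_tcovDeriv_transpose_mulVec (n : ℕ) (P : Fin (d + 1) → ℕ) {R : Finset (Fin (d + 1) → ℤ)}
    (hR : ∀ y : ↥R, y.1 ∈ boxDom (per n P)) (W : ↥R → ↥R → Matrix ι ι ℝ) (μ : Fin (d + 1)) (Φ : ↥R × ι → ℝ)
    (z : ↥R) :
    fld ((tcovDeriv n P R W μ)ᵀ *ᵥ Φ) z
      = (if h : twrap n P (z.1 - e1 μ) ∈ R then
          (n : ℝ) • ((W ⟨twrap n P (z.1 - e1 μ), h⟩ z)ᵀ *ᵥ fld Φ ⟨twrap n P (z.1 - e1 μ), h⟩) else 0)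
        - (if twrap n P (z.1 + e1 μ) ∈ R then (n : ℝ) • fld Φ z else 0) := by
  rw [tcovDeriv, blockOp_transpose, fld_blockOp_mulVec]
  have hK : ∀ y : ↥R, (tdirKer n P R W μ y z)ᵀ *ᵥ fld Φ y
      = (if twrap n P (y.1 + e1 μ) ∈ R then
          (if z.1 = twrap n P (y.1 + e1 μ) then (n : ℝ) • ((W y z)ᵀ *ᵥ fld Φ y) else 0) else 0)
        - (if twrap n P (y.1 + e1 μ) ∈ R then (if z = y then (n : ℝ) • fld Φ y else 0) else 0) := by
    intro y
    unfold tdirKer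
    by_cases h1 : twrap n P (y.1 + e1 μ) ∈ R
    · simp only [if_pos h1]
      rw [Matrix.transpose_smul, Matrix.transpose_sub, Matrix.smul_mulVec, Matrix.sub_mulVec, smul_sub]
      congr 1
      · split_ifs <;> simp
      · split_ifs <;> simp
    · simp only [if_neg h1, Matrix.transpose_zero, Matrix.zero_mulVec, sub_zero]
  simp_rw [hK]
  rw [Finset.sum_sub_distrib]
  congr 1
  · by_cases h : twrap n P (z.1 - e1 μ) ∈ R
    · rw [dif_pos h, Finset.sum_eq_single ⟨twrap n P (z.1 - e1 μ), h⟩]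
      · have e : z.1 = twrap n P ((⟨twrap n P (z.1 - e1 μ), h⟩ : ↥R).1 + e1 μ) :=
          (eq_twrap_add_iff_eq_twrap_sub (hR ⟨_, h⟩) (hR z) μ).2 rfl
        rw [if_pos (by rw [← e]; exact z.2), if_pos e]
      · intro y _ hy
        by_cases h1 : twrap n P (y.1 + e1 μ) ∈ R
        · rw [if_pos h1, if_neg]
          intro h2
          apply hy
          apply Subtype.ext
          exact (eq_twrap_add_iff_eq_twrap_sub (hR y) (hR z) μ).1 h2
        · rw [if_neg h1]
      · intro hh; exact absurd (Finset.mem_univ _) hh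
    · rw [dif_neg h]
      refine Finset.sum_eq_zero fun y _ => ?_
      by_cases h1 : twrap n P (y.1 + e1 μ) ∈ R
      · rw [if_pos h1, if_neg]
        intro h2
        apply h
        rw [← (eq_twrap_add_iff_eq_twrap_sub (hR y) (hR z) μ).1 h2]
        exact y.2
      · rw [if_neg h1]
  · rw [Finset.sum_eq_single z]
    · by_cases h1 : twrap n P (z.1 + e1 μ) ∈ R
      · rw [if_pos h1, if_pos rfl, if_pos h1]
      · rw [if_neg h1, if_neg h1]
    · intro y _ hy
      by_cases h1 : twrap n P (y.1 + e1 μ) ∈ R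
      · rw [if_pos h1, if_neg (Ne.symm hy)]
      · rw [if_neg h1]
    · intro hh; exact absurd (Finset.mem_univ _) hh

/-- **`‖D^{η*}_{A,μ}Φ‖_∞ ≤ 2n‖Φ‖_∞`** on a lattice region (orthogonal link variables). [cite: Balaban1983RegularityDecay, (1.3) p.572, (2.30) p.580, dictionary] -/
theorem siteNorm_fld_covDeriv_transpose_le (F : OrthFlow ι) (κ : ℝ) (n : ℕ) {R : Finset (Fin (d + 1) → ℤ)}
    (B : ↥R → ↥R → ℝ) (μ : Fin (d + 1)) (Φ : ↥R × ι → ℝ) (z : ↥R) :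
    siteNorm (fld ((covDeriv n R (fieldLink F κ B) μ)ᵀ *ᵥ Φ) z) ≤ 2 * n * supN Φ := by
  rw [fld_covDeriv_transpose_mulVec]
  have hn : (0 : ℝ) ≤ n := by positivity
  have hS := supN_nonneg Φ
  have hA : siteNorm (if h : z.1 - e1 μ ∈ R then
      (n : ℝ) • ((fieldLink F κ B ⟨z.1 - e1 μ, h⟩ z)ᵀ *ᵥ fld Φ ⟨z.1 - e1 μ, h⟩) else 0) ≤ n * supN Φ := by
    split_ifs with h
    · rw [siteNorm_smul, abs_of_nonneg hn]
      refine mul_le_mul_of_nonneg_left ?_ hn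
      have ht : (fieldLink F κ B ⟨z.1 - e1 μ, h⟩ z)ᵀ = F.U (-(κ * B ⟨z.1 - e1 μ, h⟩ z)) := F.transpose_eq _
      rw [ht, siteNorm_flow]
      exact le_supN Φ _
    · rw [siteNorm_zero]; exact mul_nonneg hn hS
  have hB : siteNorm (if z.1 + e1 μ ∈ R then (n : ℝ) • fld Φ z else 0) ≤ n * supN Φ := by
    split_ifs
    · rw [siteNorm_smul, abs_of_nonneg hn]
      exact mul_le_mul_of_nonneg_left (le_supN Φ z) hn
    · rw [siteNorm_zero]; exact mul_nonneg hn hS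
  calc _ ≤ _ := siteNorm_sub_le _ _
    _ ≤ n * supN Φ + n * supN Φ := add_le_add hA hB
    _ = 2 * n * supN Φ := by ring

/-- `‖D^{η*}_{A,μ}Φ‖_∞ ≤ 2n‖Φ‖_∞` for [B4]'s derivative (1.3) on the fine region over `Ωc`.
[cite: Balaban1983RegularityDecay, (1.3) p.572, (2.30) p.580, dictionary] -/
theorem supN_regionDeriv_transpose_le (F : OrthFlow ι) (e : ℝ) (n : ℕ) (Ωc : Finset (Fin (d + 1) → ℤ))
    (Ac : (Fin (d + 1) → ℤ) → Fin (d + 1) → ℝ) (μ : Fin (d + 1)) (Φ : ↥(fineDom n Ωc) × ι → ℝ) :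
    supN ((regionDeriv F e n Ωc Ac μ)ᵀ *ᵥ Φ) ≤ 2 * n * supN Φ :=
  supN_le (by have := supN_nonneg Φ; positivity) fun z =>
    siteNorm_fld_covDeriv_transpose_le F (e / n) n (fun u v => compField Ac u.1 v.1) μ Φ z

section Intertwine

variable (F : OrthFlow ι) {n : ℕ} (hn : 1 ≤ n) {P : Fin (d + 1) → ℕ} (hP : ∀ ν, 1 ≤ P ν) (h3 : ∀ ν, 3 ≤ per n P ν)
  {ΩT : Finset (Fin (d + 1) → ℤ)} (hΩ : ΩT ⊆ boxDom P) (R : ℕ)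

include h3 in
/-- **THE INTERTWINING IDENTITY FOR `D^{η*}` (1.3)/(2.30)**: at an interior site of the lift,
`(D^{ℤ*}_{A^per,μ}(u∘π))(x̃) = (D^{T*}_{A,μ}u)(πx̃)`. [cite: Balaban1983RegularityDecay, (1.3) p.572 «periodic conditions», (2.30) p.580 «D^{η*}_{A,ν}»] -/
theorem fld_regionDeriv_transpose_pull (e : ℝ) (Ac : (Fin (d + 1) → ℤ) → Fin (d + 1) → ℝ) (μ : Fin (d + 1))
    (u : ↥(fineDom n ΩT) × ι → ℝ) (x : ↥(fineDom n (liftLabels P R ΩT))) (hint : IsInt n P R x.1) :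
    fld ((regionDeriv F e n (liftLabels P R ΩT) (perField n P Ac) μ)ᵀ *ᵥ pull hn hP hΩ R u) x
      = fld ((torusDeriv F e n P ΩT Ac μ)ᵀ *ᵥ u) (proj hn hP hΩ R x) := by
  have hR : ∀ y : ↥(fineDom n ΩT), y.1 ∈ boxDom (per n P) := fun y => val_mem_perBox hn hΩ y
  rw [regionDeriv, torusDeriv, fld_covDeriv_transpose_mulVec, fld_tcovDeriv_transpose_mulVec n P hR]
  have hpm : twrap n P ((proj hn hP hΩ R x).1 - e1 μ) = twrap n P (x.1 - e1 μ) := by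
    rw [proj_val, sub_eq_add_neg, twrap_twrap_add, ← sub_eq_add_neg]
  have hpp : twrap n P ((proj hn hP hΩ R x).1 + e1 μ) = twrap n P (x.1 + e1 μ) := by
    rw [proj_val, twrap_twrap_add]
  have hnbm : x.1 - e1 μ ∈ nbrs x.1 := mem_nbrs.2 ⟨μ, Or.inr rfl⟩
  have hnbp : x.1 + e1 μ ∈ nbrs x.1 := mem_nbrs.2 ⟨μ, Or.inl rfl⟩
  congr 1
  · by_cases hm : twrap n P (x.1 - e1 μ) ∈ fineDom n ΩT
    · have hmL : x.1 - e1 μ ∈ fineDom n (liftLabels P R ΩT) := nbr_mem_lift hn hP hΩ R hint hnbm hm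
      have hmT : twrap n P ((proj hn hP hΩ R x).1 - e1 μ) ∈ fineDom n ΩT := by rw [hpm]; exact hm
      rw [dif_pos hmL, dif_pos hmT, fld_pull]
      have hproj : proj hn hP hΩ R ⟨x.1 - e1 μ, hmL⟩ = ⟨twrap n P ((proj hn hP hΩ R x).1 - e1 μ), hmT⟩ :=
        Subtype.ext (by rw [proj_val]; exact hpm.symm)
      rw [hproj]
      have hlink : fieldLink F (e / n) (fun u v : ↥(fineDom n (liftLabels P R ΩT)) => compField (perField n P Ac) u.1 v.1)
            ⟨x.1 - e1 μ, hmL⟩ x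
          = fieldLink F (e / n) (fun u v : ↥(fineDom n ΩT) => torBond n P Ac u.1 v.1)
            ⟨twrap n P ((proj hn hP hΩ R x).1 - e1 μ), hmT⟩ (proj hn hP hΩ R x) := by
        show F.U (e / n * compField (perField n P Ac) (x.1 - e1 μ) x.1)
          = F.U (e / n * torBond n P Ac (twrap n P ((proj hn hP hΩ R x).1 - e1 μ)) (proj hn hP hΩ R x).1)
        rw [fieldLink_twrap_of_nbrs F (e / n) h3 Ac (p := x.1 - e1 μ) (q := x.1)
          (mem_nbrs.2 ⟨μ, Or.inl (by simp [e1])⟩), hpm, proj_val]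
      rw [hlink]
    · have hmL : x.1 - e1 μ ∉ fineDom n (liftLabels P R ΩT) := fun h =>
        hm ((mem_fineDom_lift_iff hn hP hΩ).1 h).1
      have hmT : twrap n P ((proj hn hP hΩ R x).1 - e1 μ) ∉ fineDom n ΩT := by rw [hpm]; exact hm
      rw [dif_neg hmL, dif_neg hmT]
  · by_cases hm : twrap n P (x.1 + e1 μ) ∈ fineDom n ΩT
    · have hmL : x.1 + e1 μ ∈ fineDom n (liftLabels P R ΩT) := nbr_mem_lift hn hP hΩ R hint hnbp hm
      have hmT : twrap n P ((proj hn hP hΩ R x).1 + e1 μ) ∈ fineDom n ΩT := by rw [hpp]; exact hm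
      rw [if_pos hmL, if_pos hmT, fld_pull]
    · have hmL : x.1 + e1 μ ∉ fineDom n (liftLabels P R ΩT) := fun h =>
        hm ((mem_fineDom_lift_iff hn hP hΩ).1 h).1
      have hmT : twrap n P ((proj hn hP hΩ R x).1 + e1 μ) ∉ fineDom n ΩT := by rw [hpp]; exact hm
      rw [if_neg hmL, if_neg hmT]

end Intertwine


omit [Fintype ι] [DecidableEq ι] in
/-- `fld` of a difference. [folklore] -/
private theorem fld_sub {X : Type*} (Φ Ψ : X × ι → ℝ) (x : X) : fld (Φ - Ψ) x = fld Φ x - fld Ψ x := rfl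

/-! ## §3. Copies: the near part as a sum over copies; injectivity of the projection on a copy; norms; card of the lift -/

section Copies

variable {n : ℕ} (hn : 1 ≤ n) {P : Fin (d + 1) → ℕ} (hP : ∀ ν, 1 ≤ P ν) {ΩT : Finset (Fin (d + 1) → ℤ)}
  (hΩ : ΩT ⊆ boxDom P) (R : ℕ)

omit [Fintype ι] [DecidableEq ι] in
/-- near sites are those whose block copy index lies in the box `[−S,S]^{d+1}`. [cite: Balaban1983RegularityDecay, p.572 «periodic conditions», dictionary] -/
theorem near_iff_cidx_mem {S : ℕ} {x : Fin (d + 1) → ℤ} :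
    Near n P S x ↔ cidx P (blk n x) ∈ Fintype.piFinset (fun _ : Fin (d + 1) => Finset.Icc (-(S : ℤ)) S) := by
  simp only [Near, Fintype.mem_piFinset, Finset.mem_Icc, abs_le]

omit [Fintype ι] [DecidableEq ι] in
/-- **THE NEAR PART IS THE SUM OF ITS COPY PIECES**: `g·1_{Near S} = Σ_{|t|_∞ ≤ S} g·1_{copy t}`.
[cite: Balaban1983RegularityDecay, p.572 «periodic conditions», dictionary] -/
theorem cutNear_eq_sum_piece (S : ℕ) {Ω' : Finset (Fin (d + 1) → ℤ)} (g : ↥(fineDom n Ω') × ι → ℝ) :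
    cutNear n P S g = ∑ t ∈ Fintype.piFinset (fun _ : Fin (d + 1) => Finset.Icc (-(S : ℤ)) S),
      (fun p => if cidx P (blk n p.1.1) = t then g p else 0) := by
  funext p
  rw [Finset.sum_apply]
  by_cases hp : Near n P S p.1.1
  · rw [cutNear_of_near g hp, Finset.sum_eq_single (cidx P (blk n p.1.1))]
    · rw [if_pos rfl]
    · intro t _ ht; rw [if_neg (Ne.symm ht)]
    · intro h; exact absurd (near_iff_cidx_mem.1 hp) h
  · rw [cutNear_of_not_near g hp]
    refine (Finset.sum_eq_zero fun t ht => ?_).symm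
    rw [if_neg]
    intro h; exact hp (near_iff_cidx_mem.2 (h ▸ ht))

omit [Fintype ι] [DecidableEq ι] in
/-- copy `0` is the near part of radius `0`: `g·1_{copy 0} = g·1_{Near 0}`. [cite: Balaban1983RegularityDecay, p.572 «periodic conditions», dictionary] -/
theorem piece_zero_eq_cutNear {Ω' : Finset (Fin (d + 1) → ℤ)} (g : ↥(fineDom n Ω') × ι → ℝ) :
    (fun p => if cidx P (blk n p.1.1) = 0 then g p else 0) = cutNear n P 0 g := by
  funext p
  have hiff : cidx P (blk n p.1.1) = 0 ↔ Near n P 0 p.1.1 := by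
    constructor
    · intro h ν; rw [h]; simp
    · intro h; funext ν; have := h ν; simpa using this
  by_cases hp : Near n P 0 p.1.1
  · rw [cutNear_of_near g hp, if_pos (hiff.2 hp)]
  · rw [cutNear_of_not_near g hp, if_neg (fun h => hp (hiff.1 h))]

omit [Fintype ι] [DecidableEq ι] in
include hn in
/-- **A FINE POINT IS ITS REDUCTION PLUS THE FINE PERIOD TIMES ITS BLOCK'S COPY INDEX**. [cite: Balaban1983RegularityDecay, p.572 «periodic conditions», dictionary] -/
theorem eq_twrap_add_per_mul_cidx (x : Fin (d + 1) → ℤ) :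
    x = twrap n P x + fun ν => ((per n P ν : ℕ) : ℤ) * cidx P (blk n x) ν := by
  have h := eq_wrap_add_cidx (per n P) x
  have hc : (fun ν => ((per n P ν : ℕ) : ℤ) * cidx P (blk n x) ν) = fun ν => ((per n P ν : ℕ) : ℤ) * cidx (per n P) x ν := by
    funext ν; rw [cidx_blk hn]; rfl
  rw [hc]; exact h

omit [Fintype ι] [DecidableEq ι] in
include hn in
/-- two fine points with the same reduction and the same copy index coincide. [cite: Balaban1983RegularityDecay, p.572 «periodic conditions», dictionary] -/
theorem eq_of_twrap_eq_of_cidx_eq {x y : Fin (d + 1) → ℤ} (h1 : twrap n P x = twrap n P y)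
    (h2 : cidx P (blk n x) = cidx P (blk n y)) : x = y := by
  calc x = twrap n P x + fun ν => ((per n P ν : ℕ) : ℤ) * cidx P (blk n x) ν := eq_twrap_add_per_mul_cidx hn x
    _ = twrap n P y + fun ν => ((per n P ν : ℕ) : ℤ) * cidx P (blk n y) ν := by rw [h1, h2]
    _ = y := (eq_twrap_add_per_mul_cidx hn y).symm

omit [Fintype ι] [DecidableEq ι] in
include hn hP in
/-- a site in copy `0` is its own reduction. [cite: Balaban1983RegularityDecay, p.572 «periodic conditions», dictionary] -/
theorem twrap_eq_self_of_near_zero {x : Fin (d + 1) → ℤ} (hx : Near n P 0 x) : twrap n P x = x := by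
  have h0 : cidx P (blk n x) = 0 := by funext ν; have := hx ν; simpa using this
  have h := eq_twrap_add_per_mul_cidx (P := P) hn x
  rw [h0] at h
  have hz : (fun ν => ((per n P ν : ℕ) : ℤ) * (0 : Fin (d + 1) → ℤ) ν) = 0 := by funext ν; simp
  rw [hz, add_zero] at h
  have := hP
  exact h.symm

omit [Fintype ι] [DecidableEq ι] in
include hn hP hΩ in
/-- a site of the lift in copy `0` is a site of the torus region. [cite: Balaban1983RegularityDecay, p.572 «periodic conditions», dictionary] -/
theorem mem_of_near_zero {x : ↥(fineDom n (liftLabels P R ΩT))} (hx : Near n P 0 x.1) : x.1 ∈ fineDom n ΩT := by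
  have h := ((mem_fineDom_lift_iff hn hP hΩ (R := R)).1 x.2).1
  rwa [twrap_eq_self_of_near_zero hn hP hx] at h

omit [DecidableEq ι] in
/-- **A COPY PIECE OF `f′∘π` HAS `ℓ²` NORM AT MOST `‖f′‖₂`** (the projection is injective on a copy).
[cite: Balaban1983RegularityDecay, (2.30) p.580 «‖f′‖₂», p.572 «periodic conditions», dictionary] -/
theorem sum_sq_piece_pull_le (t : Fin (d + 1) → ℤ) (f' : ↥(fineDom n ΩT) × ι → ℝ) :
    ∑ p : ↥(fineDom n (liftLabels P R ΩT)) × ι, (if cidx P (blk n p.1.1) = t then pull hn hP hΩ R f' p else 0) ^ 2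
      ≤ ∑ q : ↥(fineDom n ΩT) × ι, f' q ^ 2 := by
  classical
  have hinj : Set.InjOn (fun p : ↥(fineDom n (liftLabels P R ΩT)) × ι => (proj hn hP hΩ R p.1, p.2))
      ↑((Finset.univ : Finset (↥(fineDom n (liftLabels P R ΩT)) × ι)).filter
        (fun p => cidx P (blk n p.1.1) = t)) := by
    intro p hp q hq hpq
    simp only [Finset.coe_filter, Finset.mem_univ, true_and, Set.mem_setOf_eq] at hp hq
    have h1 : (proj hn hP hΩ R p.1).1 = (proj hn hP hΩ R q.1).1 := by
      have h' : proj hn hP hΩ R p.1 = proj hn hP hΩ R q.1 := by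
        have := congrArg Prod.fst hpq; simpa using this
      rw [h']
    rw [proj_val, proj_val] at h1
    have h2 : p.1.1 = q.1.1 := eq_of_twrap_eq_of_cidx_eq hn h1 (by rw [hp, hq])
    have h3 : p.2 = q.2 := by have := congrArg Prod.snd hpq; simpa using this
    exact Prod.ext (Subtype.ext h2) h3
  have hsum : ∑ p : ↥(fineDom n (liftLabels P R ΩT)) × ι,
      (if cidx P (blk n p.1.1) = t then pull hn hP hΩ R f' p else 0) ^ 2
      = ∑ p ∈ (Finset.univ : Finset (↥(fineDom n (liftLabels P R ΩT)) × ι)).filter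
          (fun p => cidx P (blk n p.1.1) = t), f' (proj hn hP hΩ R p.1, p.2) ^ 2 := by
    rw [Finset.sum_filter]
    refine Finset.sum_congr rfl fun p _ => ?_
    by_cases h : cidx P (blk n p.1.1) = t
    · rw [if_pos h, if_pos h]; rfl
    · rw [if_neg h, if_neg h]; simp
  rw [hsum]
  calc ∑ p ∈ (Finset.univ : Finset (↥(fineDom n (liftLabels P R ΩT)) × ι)).filter
          (fun p => cidx P (blk n p.1.1) = t), f' (proj hn hP hΩ R p.1, p.2) ^ 2
      = ∑ q ∈ ((Finset.univ : Finset (↥(fineDom n (liftLabels P R ΩT)) × ι)).filter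
          (fun p => cidx P (blk n p.1.1) = t)).image
            (fun p : ↥(fineDom n (liftLabels P R ΩT)) × ι => (proj hn hP hΩ R p.1, p.2)), f' q ^ 2 :=
        (Finset.sum_image (f := fun q : ↥(fineDom n ΩT) × ι => f' q ^ 2) hinj).symm
    _ ≤ ∑ q, f' q ^ 2 :=
        Finset.sum_le_sum_of_subset_of_nonneg (Finset.subset_univ _) fun q _ _ => sq_nonneg _

omit [DecidableEq ι] in
/-- **THE PAIRING ON THE TORUS IS THE PAIRING OF THE COPY-`0` LIFT ON THE LIFT**: if `Ψ̃` agrees with `Ψ∘π` on copy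
`0`, then `⟨(f∘π)·1_{copy 0}, Ψ̃⟩_{Ω̃} = ⟨f, Ψ⟩_Ω`. [cite: Balaban1983RegularityDecay, (2.30) p.580 «⟨f, ·⟩», p.572 «periodic conditions», dictionary] -/
theorem cutNear_pull_dot (f Ψ : ↥(fineDom n ΩT) × ι → ℝ) (ΨL : ↥(fineDom n (liftLabels P R ΩT)) × ι → ℝ)
    (hΨ : ∀ x : ↥(fineDom n (liftLabels P R ΩT)), Near n P 0 x.1 → fld ΨL x = fld Ψ (proj hn hP hΩ R x)) :
    cutNear n P 0 (pull hn hP hΩ R f) ⬝ᵥ ΨL = f ⬝ᵥ Ψ := by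
  classical
  rw [dotProduct_eq_sum_fld, dotProduct_eq_sum_fld]
  have hmem : ∀ x : ↥(fineDom n ΩT), x.1 ∈ fineDom n (liftLabels P R ΩT) := fun x =>
    mem_lift_of_mem hn hP hΩ R x.2
  have hproj : ∀ x : ↥(fineDom n ΩT), proj hn hP hΩ R ⟨x.1, hmem x⟩ = x := fun x =>
    Subtype.ext (twrap_eq_self (val_mem_perBox hn hΩ x))
  have hnear : ∀ x : ↥(fineDom n ΩT), Near n P 0 (⟨x.1, hmem x⟩ : ↥(fineDom n (liftLabels P R ΩT))).1 :=
    fun x => near_zero_of_blk_mem (hΩ ((mem_fineDom hn).1 x.2))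
  have h1 : ∑ x, fld f x ⬝ᵥ fld Ψ x
      = ∑ x' ∈ (Finset.univ : Finset ↥(fineDom n ΩT)).image
          (fun x => (⟨x.1, hmem x⟩ : ↥(fineDom n (liftLabels P R ΩT)))),
          fld (cutNear n P 0 (pull hn hP hΩ R f)) x' ⬝ᵥ fld ΨL x' := by
    rw [Finset.sum_image]
    · refine Finset.sum_congr rfl fun x _ => ?_
      rw [fld_cutNear, if_pos (hnear x), fld_pull, hΨ _ (hnear x), hproj]
    · intro x _ y _ h
      exact Subtype.ext (congrArg Subtype.val h :)
  rw [h1]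
  symm
  refine Finset.sum_subset (Finset.subset_univ _) fun x' _ hx' => ?_
  have hn0 : ¬ Near n P 0 x'.1 := by
    intro h
    apply hx'
    exact Finset.mem_image.2 ⟨⟨x'.1, mem_of_near_zero hn hP hΩ R h⟩, Finset.mem_univ _, Subtype.ext rfl⟩
  rw [fld_cutNear, if_neg hn0, zero_dotProduct]

omit [Fintype ι] [DecidableEq ι] in
/-- **THE LIFT HAS POLYNOMIALLY MANY LABELS**: `#Ω̃_R ≤ #Ω·(2R+1)^{d+1}`. [cite: Balaban1983RegularityDecay, p.572 «periodic conditions», dictionary] -/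
theorem card_liftLabels_le (Ω' : Finset (Fin (d + 1) → ℤ)) :
    (liftLabels P R Ω').card ≤ Ω'.card * (2 * R + 1) ^ (d + 1) := by
  unfold liftLabels
  refine Finset.card_image_le.trans ?_
  rw [Finset.card_product, Fintype.card_piFinset, Finset.prod_const, Finset.card_univ, Fintype.card_fin, Int.card_Icc]
  have : ((R : ℤ) + 1 - -(R : ℤ)).toNat = 2 * R + 1 := by omega
  rw [this]

omit [Fintype ι] [DecidableEq ι] in
/-- `#(fine region over Ω′) ≤ #Ω′ · n^{d+1}`. [cite: Balaban1983RegularityDecay, (1.1) p.572, dictionary] -/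
theorem card_fineDom_le (Ω' : Finset (Fin (d + 1) → ℤ)) : (fineDom n Ω').card ≤ Ω'.card * n ^ (d + 1) := by
  unfold fineDom
  refine Finset.card_biUnion_le.trans ?_
  have h : ∀ y ∈ Ω', (Finset.univ.image (B4Green244.finePt n y)).card ≤ n ^ (d + 1) := fun y _ =>
    Finset.card_image_le.trans (by rw [Finset.card_univ, Fintype.card_fun, Fintype.card_fin, Fintype.card_fin])
  exact (Finset.sum_le_card_nsmul _ _ _ h).trans (by rw [smul_eq_mul])

omit [DecidableEq ι] in
/-- **`‖g‖₂ ≤ #sites · ‖g‖_∞`** on a finite site set. [cite: Balaban1983RegularityDecay, (2.30) p.580 «‖f‖₂», (1.9) p.573 «‖f‖_∞», dictionary] -/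
theorem bl2n_le_card_mul_supN {X : Type} [Fintype X] (g : X × ι → ℝ) :
    B4Cor23Region.bl2n g ≤ (Fintype.card X : ℝ) * supN g := by
  have hS := supN_nonneg g
  have h1 : g ⬝ᵥ g ≤ (Fintype.card X : ℝ) * supN g ^ 2 := by
    rw [dotProduct_eq_sum_fld]
    calc ∑ x, fld g x ⬝ᵥ fld g x ≤ ∑ _x : X, supN g ^ 2 := Finset.sum_le_sum fun x _ => by
            rw [← B4Lemma22Reduce231.siteNorm_sq]
            exact pow_le_pow_left₀ (siteNorm_nonneg _) (le_supN g x) 2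
      _ = (Fintype.card X : ℝ) * supN g ^ 2 := by rw [Finset.sum_const, Finset.card_univ, nsmul_eq_mul]
  have hc : Real.sqrt (Fintype.card X : ℝ) ≤ (Fintype.card X : ℝ) := by
    rw [Real.sqrt_le_left (Nat.cast_nonneg _)]
    exact_mod_cast Nat.le_self_pow two_ne_zero (Fintype.card X)
  unfold B4Cor23Region.bl2n
  calc Real.sqrt (g ⬝ᵥ g) ≤ Real.sqrt ((Fintype.card X : ℝ) * supN g ^ 2) := Real.sqrt_le_sqrt h1
    _ = Real.sqrt (Fintype.card X : ℝ) * supN g := by rw [Real.sqrt_mul (Nat.cast_nonneg _), Real.sqrt_sq hS]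
    _ ≤ (Fintype.card X : ℝ) * supN g := mul_le_mul_of_nonneg_right hc hS

end Copies

/-! ## §4. The residual source: `H̃(u∘π) = N + ρ` with `ρ` vanishing on the near copies -/

section Residual

variable (F : OrthFlow ι) {n : ℕ} (hn : 1 ≤ n) {P : Fin (d + 1) → ℕ} (hP : ∀ ν, 1 ≤ P ν) (h3 : ∀ ν, 3 ≤ per n P ν)
  {ΩT : Finset (Fin (d + 1) → ℤ)} (hΩ : ΩT ⊆ boxDom P) (R : ℕ) (e : ℝ) {a m2 : ℝ} (ha : 0 < a) (hm : 0 ≤ m2)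
  (Ac : (Fin (d + 1) → ℤ) → Fin (d + 1) → ℝ)

include h3 ha hm in
/-- **THE RESIDUAL FOR THE PAIRINGS WITHOUT `D^{η*}`**: `ρ = H̃((G_Tf′)∘π) − (f′∘π)·1_{Near S}` vanishes on the near
copies (`S + 1 ≤ R`). [cite: Balaban1983RegularityDecay, (1.6) p.572 «periodic conditions», (2.30) p.580] -/
theorem fld_residual_eq_zero {S : ℕ} (hSR : S + 1 ≤ R) (f' : ↥(fineDom n ΩT) × ι → ℝ)
    (x : ↥(fineDom n (liftLabels P R ΩT))) (hx : Near n P S x.1) :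
    fld (regionOp F e hn a m2 (liftLabels P R ΩT) (perField n P Ac)
        *ᵥ pull hn hP hΩ R ((torusOp F e hn a m2 P ΩT Ac)⁻¹ *ᵥ f')
      - cutNear n P S (pull hn hP hΩ R f')) x = 0 := by
  rw [fld_sub, fld_regionOp_pull F hn hP h3 hΩ R e a m2 Ac _ x (hx.isInt hSR),
    torusOp_mulVec_inv_mulVec F hn hΩ e ha hm Ac f', fld_cutNear, if_pos hx, fld_pull, sub_self]

include h3 ha hm in
/-- **THE RESIDUAL FOR THE PAIRINGS WITH `D^{η*}_ν`**: `ρ′ = H̃((G_TD^{T*}_νf′)∘π) − D^{ℤ*}_ν((f′∘π)·1_{Near S})` vanishes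
on the copies of index `≤ S − 1` (`1 ≤ S`, `S + 1 ≤ R`). [cite: Balaban1983RegularityDecay, (1.3)/(1.6) p.572 «periodic conditions», (2.30) p.580 «D^{η*}_{A,ν}»] -/
theorem fld_residualT_eq_zero {S : ℕ} (hS : 1 ≤ S) (hSR : S + 1 ≤ R) (ν : Fin (d + 1))
    (f' : ↥(fineDom n ΩT) × ι → ℝ) (x : ↥(fineDom n (liftLabels P R ΩT))) (hx : Near n P (S - 1) x.1) :
    fld (regionOp F e hn a m2 (liftLabels P R ΩT) (perField n P Ac)
        *ᵥ pull hn hP hΩ R ((torusOp F e hn a m2 P ΩT Ac)⁻¹ *ᵥ ((torusDeriv F e n P ΩT Ac ν)ᵀ *ᵥ f'))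
      - (regionDeriv F e n (liftLabels P R ΩT) (perField n P Ac) ν)ᵀ *ᵥ cutNear n P S (pull hn hP hΩ R f')) x = 0 := by
  have hint : IsInt n P R x.1 := hx.isInt (by omega)
  have hxS : Near n P S x.1 := hx.mono (by omega)
  rw [fld_sub, fld_regionOp_pull F hn hP h3 hΩ R e a m2 Ac _ x hint,
    torusOp_mulVec_inv_mulVec F hn hΩ e ha hm Ac, ← fld_regionDeriv_transpose_pull F hn hP h3 hΩ R e Ac ν f' x hint,
    regionDeriv, fld_covDeriv_transpose_mulVec, fld_covDeriv_transpose_mulVec, fld_cutNear, if_pos hxS]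
  have hback : ∀ h : x.1 - e1 ν ∈ fineDom n (liftLabels P R ΩT),
      fld (cutNear n P S (pull hn hP hΩ R f')) ⟨x.1 - e1 ν, h⟩ = fld (pull hn hP hΩ R f') ⟨x.1 - e1 ν, h⟩ := by
    intro h
    have hnb : x.1 - e1 ν ∈ nbrs x.1 := mem_nbrs.2 ⟨ν, Or.inr rfl⟩
    have hnear : Near n P S (x.1 - e1 ν) := by
      have := hx.of_nbrs hn hP hnb
      exact this.mono (by omega)
    rw [fld_cutNear, if_pos hnear]
  by_cases h : x.1 - e1 ν ∈ fineDom n (liftLabels P R ΩT)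
  · rw [dif_pos h, dif_pos h, hback h, sub_self]
  · rw [dif_neg h, dif_neg h, sub_self]

include hn ha hm in
/-- **THE SUP SIZE OF THE RESIDUALS**: `‖H̃(u∘π) − N‖_∞ ≤ (4(d+1)n² + m² + a)‖u‖_∞ + ‖N‖_∞`.
[cite: Balaban1983RegularityDecay, (1.3)–(1.6) p.572, dictionary] -/
theorem supN_residual_le (u : ↥(fineDom n ΩT) × ι → ℝ) (N : ↥(fineDom n (liftLabels P R ΩT)) × ι → ℝ) :
    supN (regionOp F e hn a m2 (liftLabels P R ΩT) (perField n P Ac) *ᵥ pull hn hP hΩ R u - N)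
      ≤ (4 * ((d : ℝ) + 1) * (n : ℝ) ^ 2 + m2 + a) * supN u + supN N := by
  have hC : 0 ≤ 4 * ((d : ℝ) + 1) * (n : ℝ) ^ 2 + m2 + a := by positivity
  refine supN_le (by have := supN_nonneg u; have := supN_nonneg N; positivity) fun z => ?_
  rw [fld_sub]
  refine (siteNorm_sub_le _ _).trans (add_le_add ?_ (le_supN N z))
  exact (siteNorm_fld_regionOp_le hn F e ha.le hm _ _ _ z).trans
    (mul_le_mul_of_nonneg_left (supN_pull_le hn hP hΩ R u) hC)

end Residual

/-! ## §5. On an instance: the four torus pairings lifted and split into copy pieces plus a far residual -/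

namespace Lift

open LiftData TorusPairInst

variable {ℓ : ℕ} {amin aplus m2plus : ℝ} (i : TorusPairInst d ℓ amin aplus m2plus) (F : OrthFlow ι)

/-- `n = L^k ≥ 1`. [cite: Balaban1983RegularityDecay, p.572 «η = L^{−k}», dictionary] -/
private theorem hn1 : 1 ≤ (ℓ + 1) ^ i.k := Nat.one_le_pow i.k (ℓ + 1) (Nat.succ_pos ℓ)

/-- `X_0 f = Gf` on the torus. [cite: Balaban1983RegularityDecay, (2.30) p.580, dictionary] -/
theorem opXT_zero (μ ν : Fin (d + 1)) (f : ↥(fineDom ((ℓ + 1) ^ i.k) i.ΩT) × ι → ℝ) :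
    i.opXT F 0 μ ν f = i.GT F *ᵥ f := by
  unfold TorusPairInst.opXT; rw [if_pos rfl]

/-- `X_1 f = D_μGf` on the torus. [cite: Balaban1983RegularityDecay, (2.30) p.580, dictionary] -/
theorem opXT_one (μ ν : Fin (d + 1)) (f : ↥(fineDom ((ℓ + 1) ^ i.k) i.ΩT) × ι → ℝ) :
    i.opXT F 1 μ ν f = i.DT F μ *ᵥ (i.GT F *ᵥ f) := by
  unfold TorusPairInst.opXT; rw [if_neg (by decide), if_pos rfl]

/-- `X_2 f = GD_ν^*f` on the torus. [cite: Balaban1983RegularityDecay, (2.30) p.580, dictionary] -/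
theorem opXT_two (μ ν : Fin (d + 1)) (f : ↥(fineDom ((ℓ + 1) ^ i.k) i.ΩT) × ι → ℝ) :
    i.opXT F 2 μ ν f = i.GT F *ᵥ ((i.DT F ν)ᵀ *ᵥ f) := by
  unfold TorusPairInst.opXT
  rw [if_neg (by decide), if_neg (by decide), if_pos rfl]; simp only [← Matrix.mulVec_mulVec]

/-- `X_3 f = D_μGD_ν^*f` on the torus. [cite: Balaban1983RegularityDecay, (2.30) p.580, dictionary] -/
theorem opXT_three (μ ν : Fin (d + 1)) (f : ↥(fineDom ((ℓ + 1) ^ i.k) i.ΩT) × ι → ℝ) :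
    i.opXT F 3 μ ν f = i.DT F μ *ᵥ (i.GT F *ᵥ ((i.DT F ν)ᵀ *ᵥ f)) := by
  unfold TorusPairInst.opXT
  rw [if_neg (by decide), if_neg (by decide), if_neg (by decide)]; simp only [← Matrix.mulVec_mulVec]

/-- `X^{Ω₀}_0 g = G₀g` on the torus. [cite: Balaban1983RegularityDecay, (2.30) p.580, (1.11) p.573, dictionary] -/
theorem opX₀T_zero (μ ν : Fin (d + 1)) (g : ↥(fineDom ((ℓ + 1) ^ i.k) i.Ω₀T) × ι → ℝ) :
    i.opX₀T F 0 μ ν g = i.G₀T F *ᵥ g := by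
  unfold TorusPairInst.opX₀T; rw [if_pos rfl]

/-- `X^{Ω₀}_1 g = D_μG₀g` on the torus. [cite: Balaban1983RegularityDecay, (2.30) p.580, (1.11) p.573, dictionary] -/
theorem opX₀T_one (μ ν : Fin (d + 1)) (g : ↥(fineDom ((ℓ + 1) ^ i.k) i.Ω₀T) × ι → ℝ) :
    i.opX₀T F 1 μ ν g = i.D₀T F μ *ᵥ (i.G₀T F *ᵥ g) := by
  unfold TorusPairInst.opX₀T; rw [if_neg (by decide), if_pos rfl]

/-- `X^{Ω₀}_2 g = G₀D_ν^*g` on the torus. [cite: Balaban1983RegularityDecay, (2.30) p.580, (1.11) p.573, dictionary] -/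
theorem opX₀T_two (μ ν : Fin (d + 1)) (g : ↥(fineDom ((ℓ + 1) ^ i.k) i.Ω₀T) × ι → ℝ) :
    i.opX₀T F 2 μ ν g = i.G₀T F *ᵥ ((i.D₀T F ν)ᵀ *ᵥ g) := by
  unfold TorusPairInst.opX₀T
  rw [if_neg (by decide), if_neg (by decide), if_pos rfl]; simp only [← Matrix.mulVec_mulVec]

/-- `X^{Ω₀}_3 g = D_μG₀D_ν^*g` on the torus. [cite: Balaban1983RegularityDecay, (2.30) p.580, (1.11) p.573, dictionary] -/
theorem opX₀T_three (μ ν : Fin (d + 1)) (g : ↥(fineDom ((ℓ + 1) ^ i.k) i.Ω₀T) × ι → ℝ) :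
    i.opX₀T F 3 μ ν g = i.D₀T F μ *ᵥ (i.G₀T F *ᵥ ((i.D₀T F ν)ᵀ *ᵥ g)) := by
  unfold TorusPairInst.opX₀T
  rw [if_neg (by decide), if_neg (by decide), if_neg (by decide)]; simp only [← Matrix.mulVec_mulVec]

/-- the `Ω₀`-versions of the four operators at the lifted instance are those of the instance `Ω̃₀ ⊂ Ω̃₀`.
[cite: Balaban1983RegularityDecay, (1.11) p.573, dictionary] -/
theorem opX₀_liftInst (R : ℕ) (m : Fin 4) (μ ν : Fin (d + 1))
    (g : ↥(fineDom ((ℓ + 1) ^ i.k) (liftLabels i.P R i.Ω₀T)) × ι → ℝ) :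
    (i.liftInst R).opX₀ F m μ ν g = (i.liftInst₀ R).opX F m μ ν g := rfl

omit [Fintype ι] [DecidableEq ι] in
/-- **EXTENSION BY ZERO OF A COPY PIECE OF `f′∘π` IS THE COPY PIECE OF `(Ef′)∘π`**. [cite: Balaban1983RegularityDecay, (1.11) p.573 «periodic conditions», dictionary] -/
theorem extR_piece_pull (R : ℕ) (t : Fin (d + 1) → ℤ) (f' : ↥(fineDom ((ℓ + 1) ^ i.k) i.ΩT) × ι → ℝ) :
    (i.liftInst R).extR (fun p => if cidx i.P (blk ((ℓ + 1) ^ i.k) p.1.1) = t then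
        pull (hn1 i) i.hP i.hboxΩ R f' p else 0)
      = fun p => if cidx i.P (blk ((ℓ + 1) ^ i.k) p.1.1) = t then
        pull (hn1 i) i.hP i.hbox R (i.extT f') p else 0 := by
  funext p
  obtain ⟨⟨y, hy⟩, jj⟩ := p
  have hyL : y ∈ fineDom ((ℓ + 1) ^ i.k) (liftLabels i.P R i.Ω₀T) := hy
  rw [extR_liftInst_apply]
  have hiff : blk ((ℓ + 1) ^ i.k) y ∈ liftLabels i.P R i.ΩT
      ↔ blk ((ℓ + 1) ^ i.k) (twrap ((ℓ + 1) ^ i.k) i.P y) ∈ i.ΩT := by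
    rw [mem_liftLabels_iff i.hP i.hboxΩ, blk_twrap (hn1 i)]
    exact ⟨fun h => h.1, fun h => ⟨h, ((mem_liftLabels_iff i.hP i.hbox).1 ((mem_fineDom (hn1 i)).1 hyL)).2⟩⟩
  by_cases ht : cidx i.P (blk ((ℓ + 1) ^ i.k) y) = t
  · by_cases hq : blk ((ℓ + 1) ^ i.k) (twrap ((ℓ + 1) ^ i.k) i.P y) ∈ i.ΩT
    · rw [dif_pos (hiff.2 hq)]
      simp only [ht, if_true]
      show f' (proj (hn1 i) i.hP i.hboxΩ R ⟨y, _⟩, jj) = i.extT f' (proj (hn1 i) i.hP i.hbox R ⟨y, hyL⟩, jj)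
      rw [i.extT_of_mem f' _ (by exact hq)]
      exact congrArg (fun z => f' z) (Prod.ext (Subtype.ext rfl) rfl)
    · rw [dif_neg (fun h => hq (hiff.1 h))]
      simp only [ht, if_true]
      show (0 : ℝ) = i.extT f' (proj (hn1 i) i.hP i.hbox R ⟨y, hyL⟩, jj)
      rw [i.extT_of_not_mem f' _ (by exact hq)]
  · simp only [ht, if_false]
    split_ifs <;> rfl

/-- **A TORUS PAIRING LIFTED**: for an evaluation operator `M` intertwined with `M̃` on the lift, and any split
`H̃((G_Tψ)∘π) = N + (H̃((G_Tψ)∘π) − N)`: `⟨f, MG_Tψ⟩_Ω = ⟨f̃₀, M̃G̃N⟩ + ⟨f̃₀, M̃G̃(H̃((G_Tψ)∘π) − N)⟩`, `f̃₀ = (f∘π)·1_{copy 0}`.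
[cite: Balaban1983RegularityDecay, (1.6) p.572 «periodic conditions», Cor. 2.3 (2.30) p.580] -/
theorem pair_lift (ha : 0 < amin) (hℓ : 1 ≤ ℓ) {R : ℕ} (hR : 1 ≤ R)
    (MT : Matrix (↥(fineDom ((ℓ + 1) ^ i.k) i.ΩT) × ι) (↥(fineDom ((ℓ + 1) ^ i.k) i.ΩT) × ι) ℝ)
    (ML : Matrix (↥(fineDom ((ℓ + 1) ^ i.k) (liftLabels i.P R i.ΩT)) × ι)
      (↥(fineDom ((ℓ + 1) ^ i.k) (liftLabels i.P R i.ΩT)) × ι) ℝ)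
    (hM : ∀ (u : ↥(fineDom ((ℓ + 1) ^ i.k) i.ΩT) × ι → ℝ)
      (xL : ↥(fineDom ((ℓ + 1) ^ i.k) (liftLabels i.P R i.ΩT))), IsInt ((ℓ + 1) ^ i.k) i.P R xL.1 →
      fld (ML *ᵥ pull (hn1 i) i.hP i.hboxΩ R u) xL = fld (MT *ᵥ u) (proj (hn1 i) i.hP i.hboxΩ R xL))
    (ψ : ↥(fineDom ((ℓ + 1) ^ i.k) i.ΩT) × ι → ℝ)
    (N : ↥(fineDom ((ℓ + 1) ^ i.k) (liftLabels i.P R i.ΩT)) × ι → ℝ)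
    (f : ↥(fineDom ((ℓ + 1) ^ i.k) i.ΩT) × ι → ℝ) :
    f ⬝ᵥ (MT *ᵥ (i.GT F *ᵥ ψ))
      = cutNear ((ℓ + 1) ^ i.k) i.P 0 (pull (hn1 i) i.hP i.hboxΩ R f) ⬝ᵥ (ML *ᵥ ((HL i F R)⁻¹ *ᵥ N))
        + cutNear ((ℓ + 1) ^ i.k) i.P 0 (pull (hn1 i) i.hP i.hboxΩ R f)
          ⬝ᵥ (ML *ᵥ ((HL i F R)⁻¹ *ᵥ (HL i F R *ᵥ pull (hn1 i) i.hP i.hboxΩ R (i.GT F *ᵥ ψ) - N))) := by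
  rw [← dotProduct_add, ← Matrix.mulVec_add, ← Matrix.mulVec_add, add_sub_cancel,
    ← pull_eq i F ha hℓ R (i.GT F *ᵥ ψ)]
  exact (cutNear_pull_dot (hn1 i) i.hP i.hboxΩ R f _ _ fun x hx => hM _ x (hx.isInt (by omega))).symm

omit [Fintype ι] [DecidableEq ι] in
/-- restriction to `Ω̃` at a site. [cite: Balaban1983RegularityDecay, (1.11) p.573, dictionary] -/
theorem fld_resR_lift (R : ℕ) (g : ↥(fineDom ((ℓ + 1) ^ i.k) (liftLabels i.P R i.Ω₀T)) × ι → ℝ)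
    (x : ↥(fineDom ((ℓ + 1) ^ i.k) (liftLabels i.P R i.ΩT))) :
    fld (X := ↥(fineDom ((ℓ + 1) ^ i.k) (liftLabels i.P R i.ΩT))) ((i.liftInst R).resR g) x
      = fld g (incl (hn1 i) (i.liftInst R).hsub x) := rfl

omit [Fintype ι] [DecidableEq ι] in
/-- restriction to `Ω̃` is additive. [cite: Balaban1983RegularityDecay, (1.11) p.573, dictionary] -/
theorem resR_add_lift (R : ℕ) (g g' : ↥(fineDom ((ℓ + 1) ^ i.k) (liftLabels i.P R i.Ω₀T)) × ι → ℝ) :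
    (i.liftInst R).resR (g + g') = (i.liftInst R).resR g + (i.liftInst R).resR g' := rfl

/-- **THE `Ω₀`-PART OF A `δG` PAIRING LIFTED**: `⟨f, (M₀G₀ψ₀)|_Ω⟩_Ω = ⟨f̃₀, (M̃₀G̃₀N₀)|_{Ω̃}⟩ + ⟨f̃₀, (M̃₀G̃₀(H̃₀((G₀ψ₀)∘π) − N₀))|_{Ω̃}⟩`.
[cite: Balaban1983RegularityDecay, (1.6) p.572 «periodic conditions», (1.11) p.573, Cor. 2.3 p.581 (δG clause)] -/
theorem pair_lift₀ (ha : 0 < amin) (hℓ : 1 ≤ ℓ) {R : ℕ} (hR : 1 ≤ R)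
    (M₀T : Matrix (↥(fineDom ((ℓ + 1) ^ i.k) i.Ω₀T) × ι) (↥(fineDom ((ℓ + 1) ^ i.k) i.Ω₀T) × ι) ℝ)
    (M₀L : Matrix (↥(fineDom ((ℓ + 1) ^ i.k) (liftLabels i.P R i.Ω₀T)) × ι)
      (↥(fineDom ((ℓ + 1) ^ i.k) (liftLabels i.P R i.Ω₀T)) × ι) ℝ)
    (hM₀ : ∀ (u₀ : ↥(fineDom ((ℓ + 1) ^ i.k) i.Ω₀T) × ι → ℝ)
      (yL : ↥(fineDom ((ℓ + 1) ^ i.k) (liftLabels i.P R i.Ω₀T))), IsInt ((ℓ + 1) ^ i.k) i.P R yL.1 →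
      fld (M₀L *ᵥ pull (hn1 i) i.hP i.hbox R u₀) yL = fld (M₀T *ᵥ u₀) (proj (hn1 i) i.hP i.hbox R yL))
    (ψ₀ : ↥(fineDom ((ℓ + 1) ^ i.k) i.Ω₀T) × ι → ℝ)
    (N₀ : ↥(fineDom ((ℓ + 1) ^ i.k) (liftLabels i.P R i.Ω₀T)) × ι → ℝ)
    (f : ↥(fineDom ((ℓ + 1) ^ i.k) i.ΩT) × ι → ℝ) :
    f ⬝ᵥ i.resT (M₀T *ᵥ (i.G₀T F *ᵥ ψ₀))
      = cutNear ((ℓ + 1) ^ i.k) i.P 0 (pull (hn1 i) i.hP i.hboxΩ R f)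
          ⬝ᵥ (i.liftInst R).resR
            ((M₀L *ᵥ ((H₀L i F R)⁻¹ *ᵥ N₀) : ↥(fineDom ((ℓ + 1) ^ i.k) (liftLabels i.P R i.Ω₀T)) × ι → ℝ))
        + cutNear ((ℓ + 1) ^ i.k) i.P 0 (pull (hn1 i) i.hP i.hboxΩ R f)
          ⬝ᵥ (i.liftInst R).resR ((M₀L *ᵥ ((H₀L i F R)⁻¹
            *ᵥ (H₀L i F R *ᵥ pull (hn1 i) i.hP i.hbox R (i.G₀T F *ᵥ ψ₀) - N₀))
              : ↥(fineDom ((ℓ + 1) ^ i.k) (liftLabels i.P R i.Ω₀T)) × ι → ℝ)) := by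
  have key : cutNear ((ℓ + 1) ^ i.k) i.P 0 (pull (hn1 i) i.hP i.hboxΩ R f)
      ⬝ᵥ (i.liftInst R).resR ((M₀L *ᵥ pull (hn1 i) i.hP i.hbox R (i.G₀T F *ᵥ ψ₀))
        : ↥(fineDom ((ℓ + 1) ^ i.k) (liftLabels i.P R i.Ω₀T)) × ι → ℝ)
      = f ⬝ᵥ i.resT (M₀T *ᵥ (i.G₀T F *ᵥ ψ₀)) :=
    cutNear_pull_dot (hn1 i) i.hP i.hboxΩ R f _ _ fun x hx => by
      have hint : IsInt ((ℓ + 1) ^ i.k) i.P R (incl (hn1 i) (i.liftInst R).hsub x).1 := hx.isInt (by omega)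
      rw [fld_resR_lift, i.fld_resT, hM₀ _ (incl (hn1 i) (i.liftInst R).hsub x) hint]
      rfl
  have hsplit : M₀L *ᵥ pull (hn1 i) i.hP i.hbox R (i.G₀T F *ᵥ ψ₀)
      = M₀L *ᵥ ((H₀L i F R)⁻¹ *ᵥ N₀)
        + M₀L *ᵥ ((H₀L i F R)⁻¹ *ᵥ (H₀L i F R *ᵥ pull (hn1 i) i.hP i.hbox R (i.G₀T F *ᵥ ψ₀) - N₀)) := by
    rw [← Matrix.mulVec_add, ← Matrix.mulVec_add, add_sub_cancel, ← pull₀_eq i F ha hℓ R (i.G₀T F *ᵥ ψ₀)]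
  rw [← key, hsplit, resR_add_lift]
  exact dotProduct_add _ _ _

/-- the identity evaluation operator intertwines. [cite: Balaban1983RegularityDecay, p.572 «periodic conditions», dictionary] -/
theorem intertwine_one (R : ℕ) {ΩT : Finset (Fin (d + 1) → ℤ)} (hΩ : ΩT ⊆ boxDom i.P)
    (u : ↥(fineDom ((ℓ + 1) ^ i.k) ΩT) × ι → ℝ) (xL : ↥(fineDom ((ℓ + 1) ^ i.k) (liftLabels i.P R ΩT)))
    (_hint : IsInt ((ℓ + 1) ^ i.k) i.P R xL.1) :
    fld ((1 : Matrix (↥(fineDom ((ℓ + 1) ^ i.k) (liftLabels i.P R ΩT)) × ι)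
        (↥(fineDom ((ℓ + 1) ^ i.k) (liftLabels i.P R ΩT)) × ι) ℝ) *ᵥ pull (hn1 i) i.hP hΩ R u) xL
      = fld ((1 : Matrix (↥(fineDom ((ℓ + 1) ^ i.k) ΩT) × ι) (↥(fineDom ((ℓ + 1) ^ i.k) ΩT) × ι) ℝ) *ᵥ u)
        (proj (hn1 i) i.hP hΩ R xL) := by
  rw [Matrix.one_mulVec, Matrix.one_mulVec, fld_pull]

/-- the derivative `D_μ` intertwines (g9). [cite: Balaban1983RegularityDecay, (1.3) p.572 «periodic conditions»] -/
theorem intertwine_D (R : ℕ) (μ : Fin (d + 1)) (u : ↥(fineDom ((ℓ + 1) ^ i.k) i.ΩT) × ι → ℝ)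
    (xL : ↥(fineDom ((ℓ + 1) ^ i.k) (liftLabels i.P R i.ΩT))) (hint : IsInt ((ℓ + 1) ^ i.k) i.P R xL.1) :
    fld (DL i F R μ *ᵥ pull (hn1 i) i.hP i.hboxΩ R u) xL = fld (i.DT F μ *ᵥ u) (proj (hn1 i) i.hP i.hboxΩ R xL) :=
  fld_regionDeriv_pull F (hn1 i) i.hP i.h3 i.hboxΩ R i.e i.Ac μ u xL hint

/-- the derivative `D_μ` on `Ω₀` intertwines (g9). [cite: Balaban1983RegularityDecay, (1.3) p.572 «periodic conditions»] -/
theorem intertwine_D₀ (R : ℕ) (μ : Fin (d + 1)) (u₀ : ↥(fineDom ((ℓ + 1) ^ i.k) i.Ω₀T) × ι → ℝ)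
    (yL : ↥(fineDom ((ℓ + 1) ^ i.k) (liftLabels i.P R i.Ω₀T))) (hint : IsInt ((ℓ + 1) ^ i.k) i.P R yL.1) :
    fld (D₀L i F R μ *ᵥ pull (hn1 i) i.hP i.hbox R u₀) yL = fld (i.D₀T F μ *ᵥ u₀) (proj (hn1 i) i.hP i.hbox R yL) :=
  fld_regionDeriv_pull F (hn1 i) i.hP i.h3 i.hbox R i.e i.Ac μ u₀ yL hint

end Lift

/-! ## §6. On an instance: supports, distances and norms of the copy pieces and of the residuals -/

namespace Lift

open LiftData TorusPairInst

variable {ℓ : ℕ} {amin aplus m2plus : ℝ} (i : TorusPairInst d ℓ amin aplus m2plus) (F : OrthFlow ι)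

/-- `n > 0` as a real number. [cite: Balaban1983RegularityDecay, p.572 «η = L^{−k}», dictionary] -/
private theorem hn0 : (0 : ℝ) < (((ℓ + 1) ^ i.k : ℕ) : ℝ) := by exact_mod_cast hn1 i

omit [DecidableEq ι] in
/-- a uniform lower bound on the distances between the supports bounds `dist(supp g, supp g′)` from below.
[cite: Balaban1983RegularityDecay, Cor. 2.3 p.581 «dist(supp f, supp f′)», dictionary] -/
theorem le_ssdist_of_forall (j : RegionPairInst d ℓ amin aplus m2plus)
    (g g' : ↥(fineDom ((ℓ + 1) ^ j.k) j.Ωc) × ι → ℝ) {D : ℝ} (hne : (j.supp g).Nonempty)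
    (hne' : (j.supp g').Nonempty)
    (h : ∀ z ∈ j.supp g, ∀ z' ∈ j.supp g', D * (((ℓ + 1) ^ j.k : ℕ) : ℝ) ≤ supNorm (z.1 - z'.1)) :
    D ≤ j.ssdist g g' := by
  have hnr : (0 : ℝ) < (((ℓ + 1) ^ j.k : ℕ) : ℝ) := by exact_mod_cast Nat.one_le_pow j.k (ℓ + 1) (Nat.succ_pos ℓ)
  have hpr : (j.supp g ×ˢ j.supp g').Nonempty := hne.product hne'
  unfold RegionPairInst.ssdist
  rw [dif_pos hpr]
  exact Finset.le_inf' _ _ fun q hq => by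
    rw [le_div_iff₀ hnr]
    exact h q.1 (Finset.mem_product.1 hq).1 q.2 (Finset.mem_product.1 hq).2

omit [DecidableEq ι] in
/-- `dist_T(supp f, supp f′) ≤ |z − z′|_T/n` for `z ∈ supp f`, `z′ ∈ supp f′`. [cite: Balaban1983RegularityDecay, Cor. 2.3 p.581 «dist(supp f, supp f′)», dictionary] -/
theorem tssdist_le {n : ℕ} (P : Fin (d + 1) → ℕ) {ΩT : Finset (Fin (d + 1) → ℤ)}
    (f f' : ↥(fineDom n ΩT) × ι → ℝ) {z z' : ↥(fineDom n ΩT)} (hz : z ∈ tsupp f) (hz' : z' ∈ tsupp f') :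
    tssdist P f f' ≤ tnorm n P (z.1 - z'.1) / (n : ℝ) := by
  have hm : (z, z') ∈ tsupp f ×ˢ tsupp f' := Finset.mem_product.2 ⟨hz, hz'⟩
  unfold tssdist
  rw [dif_pos ⟨(z, z'), hm⟩]
  exact Finset.inf'_le (f := fun q : ↥(fineDom n ΩT) × ↥(fineDom n ΩT) => tnorm n P (q.1.1 - q.2.1) / (n : ℝ)) hm

omit [DecidableEq ι] in
/-- `dist_T(supp f, supp f′) ≥ 0`. [cite: Balaban1983RegularityDecay, Cor. 2.3 p.581, dictionary] -/
theorem tssdist_nonneg {n : ℕ} (P : Fin (d + 1) → ℕ) {ΩT : Finset (Fin (d + 1) → ℤ)}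
    (f f' : ↥(fineDom n ΩT) × ι → ℝ) : 0 ≤ tssdist P f f' := by
  unfold tssdist
  split_ifs with h
  · exact Finset.le_inf' _ _ fun q _ => div_nonneg (tnorm_nonneg _ _ _) (Nat.cast_nonneg _)
  · exact le_rfl

omit [DecidableEq ι] in
/-- a site in the support of a copy piece of `f′∘π` is in that copy and lies over the support of `f′`.
[cite: Balaban1983RegularityDecay, (2.30) p.580 «supp f′», p.572 «periodic conditions», dictionary] -/
theorem supp_piece_pull (R : ℕ) (t : Fin (d + 1) → ℤ) (f' : ↥(fineDom ((ℓ + 1) ^ i.k) i.ΩT) × ι → ℝ)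
    (z : ↥(fineDom ((ℓ + 1) ^ i.k) (liftLabels i.P R i.ΩT)))
    (hz : z ∈ (i.liftInst R).supp (fun p => if cidx i.P (blk ((ℓ + 1) ^ i.k) p.1.1) = t then
      pull (hn1 i) i.hP i.hboxΩ R f' p else 0)) :
    cidx i.P (blk ((ℓ + 1) ^ i.k) z.1) = t ∧ proj (hn1 i) i.hP i.hboxΩ R z ∈ tsupp f' := by
  obtain ⟨jj, hjj⟩ := (lat_mem_supp (i.liftInst R)).1 hz
  by_cases ht : cidx i.P (blk ((ℓ + 1) ^ i.k) z.1) = t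
  · simp only [ht, if_true] at hjj
    exact ⟨ht, mem_tsupp_of_ne f' hjj⟩
  · simp only [ht, if_false, ne_eq, not_true_eq_false] at hjj

omit [Fintype ι] [DecidableEq ι] in
/-- **COPY SEPARATION**: a site of copy `0` and a site of copy `t` are at sup-distance `≥ n(|t|_∞ − 1)`.
[cite: Balaban1983RegularityDecay, p.572 «periodic conditions», dictionary] -/
theorem copy_sep {n : ℕ} (hn : 1 ≤ n) {P : Fin (d + 1) → ℕ} (hP : ∀ ν, 1 ≤ P ν) {x z : Fin (d + 1) → ℤ}
    (hx : Near n P 0 x) {t : Fin (d + 1) → ℤ} (hz : cidx P (blk n z) = t) :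
    (supNorm t - 1) * n ≤ supNorm (x - z) := by
  obtain ⟨ν, hν⟩ := exists_supNorm_eq t
  have hn0 : (0 : ℝ) ≤ n := by positivity
  by_cases h0 : t ν = 0
  · rw [hν, h0]; simp only [abs_zero, Int.cast_zero, zero_sub]
    exact le_trans (by nlinarith) (supNorm_nonneg _)
  · set S : ℕ := (t ν).natAbs - 1 with hS
    have hS1 : 1 ≤ (t ν).natAbs := Int.natAbs_pos.2 h0
    have hSr : (S : ℝ) = supNorm t - 1 := by
      rw [hν, hS, Nat.cast_sub hS1, Nat.cast_one, Nat.cast_natAbs]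
    have hfar : ¬ ∀ μ, |cidx P (blk n z) μ| ≤ S := by
      intro h
      have := h ν
      rw [hz] at this
      have e : ((t ν).natAbs : ℤ) = |t ν| := Int.natCast_natAbs (t ν)
      omega
    have := far_dist hn hP (t := 0) (S := S) (x := x) (z := z) (fun μ => hx μ) hfar
    rw [hSr, Nat.cast_zero, sub_zero] at this
    exact this

omit [DecidableEq ι] in
/-- **THE DISTANCE BETWEEN THE TEST SOURCE AND A COPY PIECE**: for `x̃ ∈ supp f̃₀`, `z̃ ∈ supp P_t`,
`n·½(dist_T(supp f, supp f′) + |t|_∞ − 1) ≤ |x̃ − z̃|_∞`. [cite: Balaban1983RegularityDecay, Cor. 2.3 p.581 «dist(supp f, supp f′)», p.572 «periodic conditions»] -/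
theorem dist_piece (R : ℕ) (t : Fin (d + 1) → ℤ) (f f' : ↥(fineDom ((ℓ + 1) ^ i.k) i.ΩT) × ι → ℝ)
    (x : ↥(fineDom ((ℓ + 1) ^ i.k) (liftLabels i.P R i.ΩT)))
    (hx : x ∈ (i.liftInst R).supp (cutNear ((ℓ + 1) ^ i.k) i.P 0 (pull (hn1 i) i.hP i.hboxΩ R f)))
    (z : ↥(fineDom ((ℓ + 1) ^ i.k) (liftLabels i.P R i.ΩT)))
    (hz : z ∈ (i.liftInst R).supp (fun p => if cidx i.P (blk ((ℓ + 1) ^ i.k) p.1.1) = t then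
      pull (hn1 i) i.hP i.hboxΩ R f' p else 0)) :
    (tssdist i.P f f' + supNorm t - 1) / 2 * (((ℓ + 1) ^ i.k : ℕ) : ℝ) ≤ supNorm (x.1 - z.1) := by
  obtain ⟨hx0, hxf⟩ := supp_cutNear_pull i R 0 f x hx
  obtain ⟨hzt, hzf⟩ := supp_piece_pull i R t f' z hz
  have h1 : tssdist i.P f f' * (((ℓ + 1) ^ i.k : ℕ) : ℝ) ≤ supNorm (x.1 - z.1) := by
    have := tssdist_le i.P f f' hxf hzf
    rw [proj_val, proj_val, tnorm_twrap_sub_twrap, le_div_iff₀ (hn0 i)] at this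
    exact this.trans (tnorm_le_supNorm (hn1 i) i.hP _)
  have h2 := copy_sep (hn1 i) i.hP hx0 hzt
  have h3 : (tssdist i.P f f' + supNorm t - 1) / 2 * (((ℓ + 1) ^ i.k : ℕ) : ℝ)
      = (tssdist i.P f f' * (((ℓ + 1) ^ i.k : ℕ) : ℝ) + (supNorm t - 1) * (((ℓ + 1) ^ i.k : ℕ) : ℝ)) / 2 := by
    ring
  rw [h3]
  linarith

omit [DecidableEq ι] in
/-- **THE EXPONENTIAL FACTOR OF A COPY PIECE**: `e^{−δ₀dist(supp f̃₀, supp P_t)} ≤ e^{−(δ₀/2)dist_T(supp f,supp f′)}·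
e^{δ₀/2}·e^{−(δ₀/2)|t|_∞}` (both supports non-empty). [cite: Balaban1983RegularityDecay, Cor. 2.3 (2.30) p.580, p.572 «periodic conditions»] -/
theorem exp_piece_le {δ₀ : ℝ} (hδ : 0 ≤ δ₀) (R : ℕ) (t : Fin (d + 1) → ℤ)
    (f f' : ↥(fineDom ((ℓ + 1) ^ i.k) i.ΩT) × ι → ℝ)
    (hne : ((i.liftInst R).supp (cutNear ((ℓ + 1) ^ i.k) i.P 0 (pull (hn1 i) i.hP i.hboxΩ R f))).Nonempty)
    (hne' : ((i.liftInst R).supp (fun p => if cidx i.P (blk ((ℓ + 1) ^ i.k) p.1.1) = t then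
      pull (hn1 i) i.hP i.hboxΩ R f' p else 0)).Nonempty) :
    Real.exp (-(δ₀ * (i.liftInst R).ssdist (cutNear ((ℓ + 1) ^ i.k) i.P 0 (pull (hn1 i) i.hP i.hboxΩ R f))
        (fun p => if cidx i.P (blk ((ℓ + 1) ^ i.k) p.1.1) = t then pull (hn1 i) i.hP i.hboxΩ R f' p else 0)))
      ≤ Real.exp (-(δ₀ / 2 * tssdist i.P f f')) * (Real.exp (δ₀ / 2) * Real.exp (-(δ₀ / 2 * supNorm t))) := by
  have hD := le_ssdist_of_forall (i.liftInst R) _ _ hne hne' fun x hx z hz => dist_piece i R t f f' x hx z hz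
  rw [← Real.exp_add, ← Real.exp_add]
  exact Real.exp_le_exp.2 (by nlinarith)

omit [DecidableEq ι] in
/-- **`‖f̃₀‖₂ ≤ ‖f‖₂`**. [cite: Balaban1983RegularityDecay, (2.30) p.580 «‖f‖₂», dictionary] -/
theorem norm_cut0_le (R : ℕ) (f : ↥(fineDom ((ℓ + 1) ^ i.k) i.ΩT) × ι → ℝ) :
    Real.sqrt (∑ p, cutNear ((ℓ + 1) ^ i.k) i.P 0 (pull (hn1 i) i.hP i.hboxΩ R f) p ^ 2)
      ≤ Real.sqrt (∑ q, f q ^ 2) := by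
  refine Real.sqrt_le_sqrt ?_
  rw [← piece_zero_eq_cutNear]
  exact sum_sq_piece_pull_le (hn1 i) i.hP i.hboxΩ R 0 f

omit [DecidableEq ι] in
/-- **`‖P_t‖₂ ≤ ‖f′‖₂`**. [cite: Balaban1983RegularityDecay, (2.30) p.580 «‖f′‖₂», dictionary] -/
theorem norm_piece_le (R : ℕ) (t : Fin (d + 1) → ℤ) (f' : ↥(fineDom ((ℓ + 1) ^ i.k) i.ΩT) × ι → ℝ) :
    Real.sqrt (∑ p : ↥(fineDom ((ℓ + 1) ^ i.k) (liftLabels i.P R i.ΩT)) × ι,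
        (if cidx i.P (blk ((ℓ + 1) ^ i.k) p.1.1) = t then pull (hn1 i) i.hP i.hboxΩ R f' p else 0) ^ 2)
      ≤ Real.sqrt (∑ q, f' q ^ 2) :=
  Real.sqrt_le_sqrt (sum_sq_piece_pull_le (hn1 i) i.hP i.hboxΩ R t f')

omit [DecidableEq ι] in
/-- a source vanishing everywhere has norm zero. [cite: Balaban1983RegularityDecay, (2.30) p.580, dictionary] -/
theorem sqrt_sum_sq_eq_zero {X : Type} [Fintype X] {g : X × ι → ℝ} (h : ∀ p, g p = 0) :
    Real.sqrt (∑ p, g p ^ 2) = 0 := by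
  simp [h]

omit [DecidableEq ι] in
/-- `‖f̃₀‖₂ = 0` when `supp f̃₀ = ∅`. [cite: Balaban1983RegularityDecay, (2.30) p.580, dictionary] -/
theorem norm_cut0_eq_zero (R : ℕ) (f : ↥(fineDom ((ℓ + 1) ^ i.k) i.ΩT) × ι → ℝ)
    (h : ¬ ((i.liftInst R).supp (cutNear ((ℓ + 1) ^ i.k) i.P 0 (pull (hn1 i) i.hP i.hboxΩ R f))).Nonempty) :
    Real.sqrt (∑ p, cutNear ((ℓ + 1) ^ i.k) i.P 0 (pull (hn1 i) i.hP i.hboxΩ R f) p ^ 2) = 0 :=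
  sqrt_sum_sq_eq_zero fun p => by
    have := congrFun (lat_eq_zero_of_supp (i.liftInst R) h) p; exact this

omit [DecidableEq ι] in
/-- `‖P_t‖₂ = 0` when `supp P_t = ∅`. [cite: Balaban1983RegularityDecay, (2.30) p.580, dictionary] -/
theorem norm_piece_eq_zero (R : ℕ) (t : Fin (d + 1) → ℤ) (f' : ↥(fineDom ((ℓ + 1) ^ i.k) i.ΩT) × ι → ℝ)
    (h : ¬ ((i.liftInst R).supp (fun p => if cidx i.P (blk ((ℓ + 1) ^ i.k) p.1.1) = t then
      pull (hn1 i) i.hP i.hboxΩ R f' p else 0)).Nonempty) :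
    Real.sqrt (∑ p : ↥(fineDom ((ℓ + 1) ^ i.k) (liftLabels i.P R i.ΩT)) × ι,
        (if cidx i.P (blk ((ℓ + 1) ^ i.k) p.1.1) = t then pull (hn1 i) i.hP i.hboxΩ R f' p else 0) ^ 2) = 0 :=
  sqrt_sum_sq_eq_zero (g := fun p : ↥(fineDom ((ℓ + 1) ^ i.k) (liftLabels i.P R i.ΩT)) × ι =>
    if cidx i.P (blk ((ℓ + 1) ^ i.k) p.1.1) = t then pull (hn1 i) i.hP i.hboxΩ R f' p else 0) fun p => by
    have := congrFun (lat_eq_zero_of_supp (i.liftInst R) h) p; exact this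

omit [DecidableEq ι] in
/-- **THE BOUND OF ONE COPY PIECE, `G` CLAUSE**: a lattice bound `p ≤ c₀e^{−δ₀dist(supp f̃₀,supp P_t)}‖f̃₀‖₂‖P_t‖₂`
gives `p ≤ c₀e^{δ₀/2}e^{−(δ₀/2)|t|_∞}·e^{−(δ₀/2)dist_T(supp f,supp f′)}‖f‖₂‖f′‖₂`. [cite: Balaban1983RegularityDecay, Cor. 2.3 (2.30) p.580] -/
theorem piece_bound {c₀ δ₀ : ℝ} (hc : 0 ≤ c₀) (hδ : 0 ≤ δ₀) (R : ℕ) (t : Fin (d + 1) → ℤ)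
    (f f' : ↥(fineDom ((ℓ + 1) ^ i.k) i.ΩT) × ι → ℝ) {p : ℝ}
    (hp : p ≤ c₀ * Real.exp (-(δ₀ * (i.liftInst R).ssdist
        (cutNear ((ℓ + 1) ^ i.k) i.P 0 (pull (hn1 i) i.hP i.hboxΩ R f))
        (fun p => if cidx i.P (blk ((ℓ + 1) ^ i.k) p.1.1) = t then pull (hn1 i) i.hP i.hboxΩ R f' p else 0)))
      * Real.sqrt (∑ p, cutNear ((ℓ + 1) ^ i.k) i.P 0 (pull (hn1 i) i.hP i.hboxΩ R f) p ^ 2)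
      * Real.sqrt (∑ p : ↥(fineDom ((ℓ + 1) ^ i.k) (liftLabels i.P R i.ΩT)) × ι,
          (if cidx i.P (blk ((ℓ + 1) ^ i.k) p.1.1) = t then pull (hn1 i) i.hP i.hboxΩ R f' p else 0) ^ 2)) :
    p ≤ c₀ * (Real.exp (δ₀ / 2) * Real.exp (-(δ₀ / 2 * supNorm t)))
      * (Real.exp (-(δ₀ / 2 * tssdist i.P f f')) * Real.sqrt (∑ q, f q ^ 2) * Real.sqrt (∑ q, f' q ^ 2)) := by
  have hF := norm_cut0_le i R f
  have hF' := norm_piece_le i R t f'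
  have hRHS : 0 ≤ c₀ * (Real.exp (δ₀ / 2) * Real.exp (-(δ₀ / 2 * supNorm t)))
      * (Real.exp (-(δ₀ / 2 * tssdist i.P f f')) * Real.sqrt (∑ q, f q ^ 2) * Real.sqrt (∑ q, f' q ^ 2)) := by
    positivity
  by_cases hne : ((i.liftInst R).supp (cutNear ((ℓ + 1) ^ i.k) i.P 0 (pull (hn1 i) i.hP i.hboxΩ R f))).Nonempty
  · by_cases hne' : ((i.liftInst R).supp (fun p => if cidx i.P (blk ((ℓ + 1) ^ i.k) p.1.1) = t then
        pull (hn1 i) i.hP i.hboxΩ R f' p else 0)).Nonempty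
    · have hE := exp_piece_le i hδ R t f f' hne hne'
      calc p ≤ _ := hp
        _ ≤ c₀ * (Real.exp (-(δ₀ / 2 * tssdist i.P f f')) * (Real.exp (δ₀ / 2) * Real.exp (-(δ₀ / 2 * supNorm t))))
            * Real.sqrt (∑ q, f q ^ 2) * Real.sqrt (∑ q, f' q ^ 2) := by
            refine mul_le_mul (mul_le_mul (mul_le_mul_of_nonneg_left hE hc) hF (Real.sqrt_nonneg _)
              (mul_nonneg hc (by positivity))) hF' (Real.sqrt_nonneg _)
              (mul_nonneg (mul_nonneg hc (by positivity)) (Real.sqrt_nonneg _))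
        _ = _ := by ring
    · rw [norm_piece_eq_zero i R t f' hne', mul_zero] at hp
      exact hp.trans hRHS
  · rw [norm_cut0_eq_zero i R f hne, mul_zero, zero_mul] at hp
    exact hp.trans hRHS

omit [DecidableEq ι] in
/-- **`dist_T(supp f, Ω^c) ≤ dist(supp f̃₀, Ω̃^c)`** when `dist_T(supp f, Ω^c) ≤ R`. [cite: Balaban1983RegularityDecay, (1.12) p.573, p.572 «periodic conditions», dictionary] -/
theorem tbdistS_le_bdistS_cut0 (R : ℕ) (f : ↥(fineDom ((ℓ + 1) ^ i.k) i.ΩT) × ι → ℝ)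
    (hne : ((i.liftInst R).supp (cutNear ((ℓ + 1) ^ i.k) i.P 0 (pull (hn1 i) i.hP i.hboxΩ R f))).Nonempty)
    (hR : tbdistS i.P f ≤ R) :
    tbdistS i.P f ≤ (i.liftInst R).bdistS (cutNear ((ℓ + 1) ^ i.k) i.P 0 (pull (hn1 i) i.hP i.hboxΩ R f)) :=
  lat_le_bdistS (i.liftInst R) _ hne fun z hz => by
    obtain ⟨hz0, hzf⟩ := supp_cutNear_pull i R 0 f z hz
    exact le_cdist_lift i R z hz0 (Or.inr (tbdistS_le i.P f hzf)) (by simpa using hR)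

omit [DecidableEq ι] in
/-- **`dist_T(supp f′, Ω^c) ≤ dist(supp P_t, Ω̃^c)`** for `|t|_∞ ≤ S` when `dist_T(supp f′, Ω^c) ≤ R − S`.
[cite: Balaban1983RegularityDecay, (1.12) p.573, p.572 «periodic conditions», dictionary] -/
theorem tbdistS_le_bdistS_piece (R S : ℕ) {t : Fin (d + 1) → ℤ}
    (ht : t ∈ Fintype.piFinset (fun _ : Fin (d + 1) => Finset.Icc (-(S : ℤ)) S))
    (f' : ↥(fineDom ((ℓ + 1) ^ i.k) i.ΩT) × ι → ℝ)
    (hne : ((i.liftInst R).supp (fun p => if cidx i.P (blk ((ℓ + 1) ^ i.k) p.1.1) = t then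
      pull (hn1 i) i.hP i.hboxΩ R f' p else 0)).Nonempty)
    (hR : tbdistS i.P f' ≤ (R : ℝ) - S) :
    tbdistS i.P f' ≤ (i.liftInst R).bdistS (fun p => if cidx i.P (blk ((ℓ + 1) ^ i.k) p.1.1) = t then
      pull (hn1 i) i.hP i.hboxΩ R f' p else 0) :=
  lat_le_bdistS (i.liftInst R) _ hne fun z hz => by
    obtain ⟨hzt, hzf⟩ := supp_piece_pull i R t f' z hz
    have hzS : Near ((ℓ + 1) ^ i.k) i.P S z.1 := near_iff_cidx_mem.2 (hzt ▸ ht)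
    exact le_cdist_lift i R z hzS (Or.inr (tbdistS_le i.P f' hzf)) hR

omit [DecidableEq ι] in
/-- **THE BOUND OF ONE COPY PIECE, `δG` CLAUSE**. [cite: Balaban1983RegularityDecay, Cor. 2.3 p.581 (δG clause)] -/
theorem dpiece_bound {c₀ δ₀ : ℝ} (hc : 0 ≤ c₀) (hδ : 0 ≤ δ₀) (R S : ℕ) {t : Fin (d + 1) → ℤ}
    (ht : t ∈ Fintype.piFinset (fun _ : Fin (d + 1) => Finset.Icc (-(S : ℤ)) S))
    (f f' : ↥(fineDom ((ℓ + 1) ^ i.k) i.ΩT) × ι → ℝ) (hRf : tbdistS i.P f ≤ R)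
    (hRf' : tbdistS i.P f' ≤ (R : ℝ) - S) {p : ℝ}
    (hp : p ≤ c₀ * Real.exp (-(δ₀ * (i.liftInst R).ssdist
        (cutNear ((ℓ + 1) ^ i.k) i.P 0 (pull (hn1 i) i.hP i.hboxΩ R f))
        (fun p => if cidx i.P (blk ((ℓ + 1) ^ i.k) p.1.1) = t then pull (hn1 i) i.hP i.hboxΩ R f' p else 0)))
      * Real.exp (-(δ₀ * ((i.liftInst R).bdistS (cutNear ((ℓ + 1) ^ i.k) i.P 0 (pull (hn1 i) i.hP i.hboxΩ R f))
        + (i.liftInst R).bdistS (fun p => if cidx i.P (blk ((ℓ + 1) ^ i.k) p.1.1) = t then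
          pull (hn1 i) i.hP i.hboxΩ R f' p else 0))))
      * Real.sqrt (∑ p, cutNear ((ℓ + 1) ^ i.k) i.P 0 (pull (hn1 i) i.hP i.hboxΩ R f) p ^ 2)
      * Real.sqrt (∑ p : ↥(fineDom ((ℓ + 1) ^ i.k) (liftLabels i.P R i.ΩT)) × ι,
          (if cidx i.P (blk ((ℓ + 1) ^ i.k) p.1.1) = t then pull (hn1 i) i.hP i.hboxΩ R f' p else 0) ^ 2)) :
    p ≤ c₀ * (Real.exp (δ₀ / 2) * Real.exp (-(δ₀ / 2 * supNorm t)))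
      * (Real.exp (-(δ₀ / 2 * tssdist i.P f f')) * Real.exp (-(δ₀ * (tbdistS i.P f + tbdistS i.P f')))
        * Real.sqrt (∑ q, f q ^ 2) * Real.sqrt (∑ q, f' q ^ 2)) := by
  have hF := norm_cut0_le i R f
  have hF' := norm_piece_le i R t f'
  have hRHS : 0 ≤ c₀ * (Real.exp (δ₀ / 2) * Real.exp (-(δ₀ / 2 * supNorm t)))
      * (Real.exp (-(δ₀ / 2 * tssdist i.P f f')) * Real.exp (-(δ₀ * (tbdistS i.P f + tbdistS i.P f')))
        * Real.sqrt (∑ q, f q ^ 2) * Real.sqrt (∑ q, f' q ^ 2)) := by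
    positivity
  by_cases hne : ((i.liftInst R).supp (cutNear ((ℓ + 1) ^ i.k) i.P 0 (pull (hn1 i) i.hP i.hboxΩ R f))).Nonempty
  · by_cases hne' : ((i.liftInst R).supp (fun p => if cidx i.P (blk ((ℓ + 1) ^ i.k) p.1.1) = t then
        pull (hn1 i) i.hP i.hboxΩ R f' p else 0)).Nonempty
    · have hE := exp_piece_le i hδ R t f f' hne hne'
      have hB : Real.exp (-(δ₀ * ((i.liftInst R).bdistS (cutNear ((ℓ + 1) ^ i.k) i.P 0 (pull (hn1 i) i.hP i.hboxΩ R f))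
          + (i.liftInst R).bdistS (fun p => if cidx i.P (blk ((ℓ + 1) ^ i.k) p.1.1) = t then
            pull (hn1 i) i.hP i.hboxΩ R f' p else 0))))
          ≤ Real.exp (-(δ₀ * (tbdistS i.P f + tbdistS i.P f'))) := by
        have h1 := tbdistS_le_bdistS_cut0 i R f hne hRf
        have h2 := tbdistS_le_bdistS_piece i R S ht f' hne' hRf'
        exact Real.exp_le_exp.2 (by nlinarith)
      calc p ≤ _ := hp
        _ ≤ c₀ * (Real.exp (-(δ₀ / 2 * tssdist i.P f f')) * (Real.exp (δ₀ / 2) * Real.exp (-(δ₀ / 2 * supNorm t))))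
            * Real.exp (-(δ₀ * (tbdistS i.P f + tbdistS i.P f')))
            * Real.sqrt (∑ q, f q ^ 2) * Real.sqrt (∑ q, f' q ^ 2) := by
            refine mul_le_mul (mul_le_mul (mul_le_mul (mul_le_mul_of_nonneg_left hE hc) hB
              (Real.exp_pos _).le (mul_nonneg hc (by positivity))) hF (Real.sqrt_nonneg _)
              (mul_nonneg (mul_nonneg hc (by positivity)) (Real.exp_pos _).le)) hF' (Real.sqrt_nonneg _)
              (mul_nonneg (mul_nonneg (mul_nonneg hc (by positivity)) (Real.exp_pos _).le) (Real.sqrt_nonneg _))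
        _ = _ := by ring
    · rw [norm_piece_eq_zero i R t f' hne', mul_zero] at hp
      exact hp.trans hRHS
  · rw [norm_cut0_eq_zero i R f hne, mul_zero, zero_mul] at hp
    exact hp.trans hRHS

omit [DecidableEq ι] in
/-- **THE BOUND OF A RESIDUAL PAIRING ON THE LIFT OF `Ω`**: a lattice bound `p ≤ c₀e^{−δ₀dist(supp f̃₀,supp ρ)}‖f̃₀‖₂‖ρ‖₂`
for a residual `ρ` vanishing on the copies of index `≤ S − 1` and with `‖ρ‖_∞ ≤ B` gives
`p ≤ c₀e^{−δ₀(S−1)}‖f‖₂·(#Ω̃_R·B)`. [cite: Balaban1983RegularityDecay, Cor. 2.3 (2.30) p.580, p.572 «periodic conditions»] -/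
theorem tail_bound {c₀ δ₀ : ℝ} (hc : 0 ≤ c₀) (hδ : 0 ≤ δ₀) (R S : ℕ)
    (f : ↥(fineDom ((ℓ + 1) ^ i.k) i.ΩT) × ι → ℝ)
    (ρ : ↥(fineDom ((ℓ + 1) ^ i.k) (liftLabels i.P R i.ΩT)) × ι → ℝ)
    (hρ : ∀ x : ↥(fineDom ((ℓ + 1) ^ i.k) (liftLabels i.P R i.ΩT)), Near ((ℓ + 1) ^ i.k) i.P (S - 1) x.1 →
      fld ρ x = 0)
    {B : ℝ} (hB : supN ρ ≤ B) {p : ℝ}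
    (hp : p ≤ c₀ * Real.exp (-(δ₀ * (i.liftInst R).ssdist
        (cutNear ((ℓ + 1) ^ i.k) i.P 0 (pull (hn1 i) i.hP i.hboxΩ R f)) ρ))
      * Real.sqrt (∑ p, cutNear ((ℓ + 1) ^ i.k) i.P 0 (pull (hn1 i) i.hP i.hboxΩ R f) p ^ 2)
      * Real.sqrt (∑ p, ρ p ^ 2)) :
    p ≤ c₀ * Real.exp (-(δ₀ * ((S : ℝ) - 1))) * Real.sqrt (∑ q, f q ^ 2)
      * ((Fintype.card ↥(fineDom ((ℓ + 1) ^ i.k) (liftLabels i.P R i.ΩT)) : ℝ) * B) := by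
  have hF := norm_cut0_le i R f
  have hB0 : 0 ≤ B := (supN_nonneg ρ).trans hB
  have hρn : Real.sqrt (∑ p, ρ p ^ 2)
      ≤ (Fintype.card ↥(fineDom ((ℓ + 1) ^ i.k) (liftLabels i.P R i.ΩT)) : ℝ) * B := by
    rw [B4Cor23RegionPairFam.l2_eq_bl2n]
    exact (bl2n_le_card_mul_supN ρ).trans (mul_le_mul_of_nonneg_left hB (Nat.cast_nonneg _))
  have hRHS : 0 ≤ c₀ * Real.exp (-(δ₀ * ((S : ℝ) - 1))) * Real.sqrt (∑ q, f q ^ 2)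
      * ((Fintype.card ↥(fineDom ((ℓ + 1) ^ i.k) (liftLabels i.P R i.ΩT)) : ℝ) * B) :=
    mul_nonneg (mul_nonneg (mul_nonneg hc (Real.exp_pos _).le) (Real.sqrt_nonneg _))
      (mul_nonneg (Nat.cast_nonneg _) hB0)
  by_cases hne : ((i.liftInst R).supp (cutNear ((ℓ + 1) ^ i.k) i.P 0 (pull (hn1 i) i.hP i.hboxΩ R f))).Nonempty
  · by_cases hne' : ((i.liftInst R).supp ρ).Nonempty
    · have hD : ((S - 1 : ℕ) : ℝ) ≤ (i.liftInst R).ssdist (cutNear ((ℓ + 1) ^ i.k) i.P 0 (pull (hn1 i) i.hP i.hboxΩ R f)) ρ := by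
        refine le_ssdist_of_forall (i.liftInst R) _ _ hne hne' fun x hx z hz => ?_
        obtain ⟨hx0, -⟩ := supp_cutNear_pull i R 0 f x hx
        obtain ⟨jj, hjj⟩ := (lat_mem_supp (i.liftInst R)).1 hz
        have hfar : ¬ Near ((ℓ + 1) ^ i.k) i.P (S - 1) z.1 := fun h => hjj (by
          have := congrFun (hρ z h) jj; exact this)
        have := far_dist (hn1 i) i.hP (t := 0) (S := S - 1) (fun μ => hx0 μ) hfar
        rw [Nat.cast_zero, sub_zero] at this
        exact this
      have hD' : (S : ℝ) - 1 ≤ (i.liftInst R).ssdist (cutNear ((ℓ + 1) ^ i.k) i.P 0 (pull (hn1 i) i.hP i.hboxΩ R f)) ρ := by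
        refine le_trans ?_ hD
        rcases Nat.eq_zero_or_pos S with h | h
        · subst h; simp
        · rw [Nat.cast_sub h]; simp
      have hE : Real.exp (-(δ₀ * (i.liftInst R).ssdist (cutNear ((ℓ + 1) ^ i.k) i.P 0 (pull (hn1 i) i.hP i.hboxΩ R f)) ρ))
          ≤ Real.exp (-(δ₀ * ((S : ℝ) - 1))) := Real.exp_le_exp.2 (by nlinarith)
      calc p ≤ _ := hp
        _ ≤ _ := mul_le_mul (mul_le_mul (mul_le_mul_of_nonneg_left hE hc) hF (Real.sqrt_nonneg _)
            (mul_nonneg hc (Real.exp_pos _).le)) hρn (Real.sqrt_nonneg _)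
            (mul_nonneg (mul_nonneg hc (Real.exp_pos _).le) (Real.sqrt_nonneg _))
    · have h0 : Real.sqrt (∑ p, ρ p ^ 2) = 0 := sqrt_sum_sq_eq_zero fun p => by
        have := congrFun (lat_eq_zero_of_supp (i.liftInst R) hne') p; exact this
      rw [h0, mul_zero] at hp
      exact hp.trans hRHS
  · rw [norm_cut0_eq_zero i R f hne, mul_zero, zero_mul] at hp
    exact hp.trans hRHS

omit [DecidableEq ι] in
/-- the support of `Ef̃₀` on the lift of `Ω₀` lies in copy `0`. [cite: Balaban1983RegularityDecay, (1.11) p.573, p.572 «periodic conditions», dictionary] -/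
theorem near_of_supp_extR_cut0 (R : ℕ) (f : ↥(fineDom ((ℓ + 1) ^ i.k) i.ΩT) × ι → ℝ)
    (y : ↥(fineDom ((ℓ + 1) ^ i.k) (liftLabels i.P R i.Ω₀T)))
    (hy : y ∈ (i.liftInst₀ R).supp ((i.liftInst R).extR
      (cutNear ((ℓ + 1) ^ i.k) i.P 0 (pull (hn1 i) i.hP i.hboxΩ R f)))) :
    Near ((ℓ + 1) ^ i.k) i.P 0 y.1 := by
  obtain ⟨jj, hjj⟩ := (lat_mem_supp (i.liftInst₀ R)).1 hy
  have h := extR_liftInst_apply i R (cutNear ((ℓ + 1) ^ i.k) i.P 0 (pull (hn1 i) i.hP i.hboxΩ R f)) y.1 y.2 jj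
  by_cases hb : blk ((ℓ + 1) ^ i.k) y.1 ∈ liftLabels i.P R i.ΩT
  · rw [dif_pos hb] at h
    have hne : cutNear ((ℓ + 1) ^ i.k) i.P 0 (pull (hn1 i) i.hP i.hboxΩ R f)
        (⟨y.1, (mem_fineDom (hn1 i)).2 hb⟩, jj) ≠ 0 := by rw [← h]; exact hjj
    exact (near_of_cutNear_ne _ hne).1
  · rw [dif_neg hb] at h
    exact absurd h hjj

omit [DecidableEq ι] in
/-- **THE BOUND OF A RESIDUAL PAIRING ON THE LIFT OF `Ω₀`**: the same for `⟨Ef̃₀, X^{Ω̃₀}ρ₀⟩` with `ρ₀` vanishing on the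
copies of index `≤ S − 1` of the lift of `Ω₀`. [cite: Balaban1983RegularityDecay, Cor. 2.3 p.581 (δG clause), p.572 «periodic conditions»] -/
theorem tail_bound₀ {c₀ δ₀ : ℝ} (hc : 0 ≤ c₀) (hδ : 0 ≤ δ₀) (R S : ℕ)
    (f : ↥(fineDom ((ℓ + 1) ^ i.k) i.ΩT) × ι → ℝ)
    (ρ₀ : ↥(fineDom ((ℓ + 1) ^ i.k) (liftLabels i.P R i.Ω₀T)) × ι → ℝ)
    (hρ₀ : ∀ y : ↥(fineDom ((ℓ + 1) ^ i.k) (liftLabels i.P R i.Ω₀T)), Near ((ℓ + 1) ^ i.k) i.P (S - 1) y.1 →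
      fld ρ₀ y = 0)
    {B : ℝ} (hB : supN ρ₀ ≤ B) {p : ℝ}
    (hp : p ≤ c₀ * Real.exp (-(δ₀ * (i.liftInst₀ R).ssdist
        ((i.liftInst R).extR (cutNear ((ℓ + 1) ^ i.k) i.P 0 (pull (hn1 i) i.hP i.hboxΩ R f))) ρ₀))
      * Real.sqrt (∑ p, (i.liftInst R).extR (cutNear ((ℓ + 1) ^ i.k) i.P 0 (pull (hn1 i) i.hP i.hboxΩ R f)) p ^ 2)
      * Real.sqrt (∑ p, ρ₀ p ^ 2)) :
    p ≤ c₀ * Real.exp (-(δ₀ * ((S : ℝ) - 1))) * Real.sqrt (∑ q, f q ^ 2)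
      * ((Fintype.card ↥(fineDom ((ℓ + 1) ^ i.k) (liftLabels i.P R i.Ω₀T)) : ℝ) * B) := by
  have hF : Real.sqrt (∑ p, (i.liftInst R).extR (cutNear ((ℓ + 1) ^ i.k) i.P 0 (pull (hn1 i) i.hP i.hboxΩ R f)) p ^ 2)
      ≤ Real.sqrt (∑ q, f q ^ 2) := by
    refine le_trans (le_of_eq ?_) (norm_cut0_le i R f)
    rw [B4Cor23RegionPairFam.l2_eq_bl2n, B4Cor23RegionPairFam.l2_eq_bl2n, B4Cor23RegionPairFam.extR_eq_extV]
    exact B4Cor23RegionPairFam.bl2n_extV (B4Cor23RegionPairFam.hfine (i.liftInst R)) _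
  have hB0 : 0 ≤ B := (supN_nonneg ρ₀).trans hB
  have hρn : Real.sqrt (∑ p, ρ₀ p ^ 2)
      ≤ (Fintype.card ↥(fineDom ((ℓ + 1) ^ i.k) (liftLabels i.P R i.Ω₀T)) : ℝ) * B := by
    rw [B4Cor23RegionPairFam.l2_eq_bl2n]
    exact (bl2n_le_card_mul_supN ρ₀).trans (mul_le_mul_of_nonneg_left hB (Nat.cast_nonneg _))
  have hRHS : 0 ≤ c₀ * Real.exp (-(δ₀ * ((S : ℝ) - 1))) * Real.sqrt (∑ q, f q ^ 2)
      * ((Fintype.card ↥(fineDom ((ℓ + 1) ^ i.k) (liftLabels i.P R i.Ω₀T)) : ℝ) * B) :=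
    mul_nonneg (mul_nonneg (mul_nonneg hc (Real.exp_pos _).le) (Real.sqrt_nonneg _))
      (mul_nonneg (Nat.cast_nonneg _) hB0)
  by_cases hne : ((i.liftInst₀ R).supp ((i.liftInst R).extR
      (cutNear ((ℓ + 1) ^ i.k) i.P 0 (pull (hn1 i) i.hP i.hboxΩ R f)))).Nonempty
  · by_cases hne' : ((i.liftInst₀ R).supp ρ₀).Nonempty
    · have hD : ((S - 1 : ℕ) : ℝ) ≤ (i.liftInst₀ R).ssdist ((i.liftInst R).extR
          (cutNear ((ℓ + 1) ^ i.k) i.P 0 (pull (hn1 i) i.hP i.hboxΩ R f))) ρ₀ := by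
        refine le_ssdist_of_forall (i.liftInst₀ R) _ _ hne hne' fun x hx z hz => ?_
        have hx0 := near_of_supp_extR_cut0 i R f x hx
        obtain ⟨jj, hjj⟩ := (lat_mem_supp (i.liftInst₀ R)).1 hz
        have hfar : ¬ Near ((ℓ + 1) ^ i.k) i.P (S - 1) z.1 := fun h => hjj (by
          have := congrFun (hρ₀ z h) jj; exact this)
        have := far_dist (hn1 i) i.hP (t := 0) (S := S - 1) (fun μ => hx0 μ) hfar
        rw [Nat.cast_zero, sub_zero] at this
        exact this
      have hD' : (S : ℝ) - 1 ≤ (i.liftInst₀ R).ssdist ((i.liftInst R).extR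
          (cutNear ((ℓ + 1) ^ i.k) i.P 0 (pull (hn1 i) i.hP i.hboxΩ R f))) ρ₀ := by
        refine le_trans ?_ hD
        rcases Nat.eq_zero_or_pos S with h | h
        · subst h; simp
        · rw [Nat.cast_sub h]; simp
      have hE : Real.exp (-(δ₀ * (i.liftInst₀ R).ssdist ((i.liftInst R).extR
          (cutNear ((ℓ + 1) ^ i.k) i.P 0 (pull (hn1 i) i.hP i.hboxΩ R f))) ρ₀))
          ≤ Real.exp (-(δ₀ * ((S : ℝ) - 1))) := Real.exp_le_exp.2 (by nlinarith)
      calc p ≤ _ := hp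
        _ ≤ _ := mul_le_mul (mul_le_mul (mul_le_mul_of_nonneg_left hE hc) hF (Real.sqrt_nonneg _)
            (mul_nonneg hc (Real.exp_pos _).le)) hρn (Real.sqrt_nonneg _)
            (mul_nonneg (mul_nonneg hc (Real.exp_pos _).le) (Real.sqrt_nonneg _))
    · have h0 : Real.sqrt (∑ p, ρ₀ p ^ 2) = 0 := sqrt_sum_sq_eq_zero fun p => by
        have := congrFun (lat_eq_zero_of_supp (i.liftInst₀ R) hne') p; exact this
      rw [h0, mul_zero] at hp
      exact hp.trans hRHS
  · have h0 : Real.sqrt (∑ p, (i.liftInst R).extR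
        (cutNear ((ℓ + 1) ^ i.k) i.P 0 (pull (hn1 i) i.hP i.hboxΩ R f)) p ^ 2) = 0 :=
      sqrt_sum_sq_eq_zero fun p => by
        have := congrFun (lat_eq_zero_of_supp (i.liftInst₀ R) hne) p; exact this
    rw [h0, mul_zero, zero_mul] at hp
    exact hp.trans hRHS

end Lift

/-! ## §7. One step of the limit: the near sum and the far residuals at lift radius `R` -/

namespace Lift

open LiftData TorusPairInst

variable {ℓ : ℕ} {amin aplus m2plus : ℝ} (i : TorusPairInst d ℓ amin aplus m2plus) (F : OrthFlow ι)

omit [Fintype ι] [DecidableEq ι] in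
/-- restriction to `Ω̃` commutes with finite sums. [cite: Balaban1983RegularityDecay, (1.11) p.573, dictionary] -/
theorem resR_sum_lift (R : ℕ) (s : Finset (Fin (d + 1) → ℤ))
    (v : (Fin (d + 1) → ℤ) → ↥(fineDom ((ℓ + 1) ^ i.k) (liftLabels i.P R i.Ω₀T)) × ι → ℝ) :
    (i.liftInst R).resR ((∑ t ∈ s, v t : ↥(fineDom ((ℓ + 1) ^ i.k) (liftLabels i.P R i.Ω₀T)) × ι → ℝ))
      = ∑ t ∈ s, (i.liftInst R).resR (v t) := by
  classical
  induction s using Finset.induction_on with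
  | empty => rfl
  | insert a s ha ih => rw [Finset.sum_insert ha, Finset.sum_insert ha, resR_add_lift, ih]

/-- **THE NEAR SUM**: `Σ_{|t|_∞ ≤ S} c₀(e^{δ₀/2}e^{−(δ₀/2)|t|_∞})·K ≤ c₀e^{δ₀/2}(2 + 4(d+1)/δ₀)^{d+1}·K`.
[cite: Balaban1983RegularityDecay, Cor. 2.3 (2.30) p.580, p.572 «periodic conditions», constants] -/
theorem near_sum_le {c₀ δ₀ K : ℝ} (hc : 0 ≤ c₀) (hδ : 0 < δ₀) (hK : 0 ≤ K) (S : ℕ) :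
    ∑ t ∈ Fintype.piFinset (fun _ : Fin (d + 1) => Finset.Icc (-(S : ℤ)) S),
        c₀ * (Real.exp (δ₀ / 2) * Real.exp (-(δ₀ / 2 * supNorm t))) * K
      ≤ c₀ * (Real.exp (δ₀ / 2) * (2 + 2 * ((d : ℝ) + 1) / (δ₀ / 2)) ^ (d + 1)) * K := by
  rw [← Finset.sum_mul, ← Finset.mul_sum, ← Finset.mul_sum]
  have hsum := sum_box_exp_neg_supNorm_le (d := d) (half_pos hδ) S
  exact mul_le_mul_of_nonneg_right (mul_le_mul_of_nonneg_left
    (mul_le_mul_of_nonneg_left hsum (Real.exp_pos _).le) hc) hK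

/-- **ONE STEP, `G` CLAUSE** (generic evaluation operator `M`, generic near-source map `T̃`): at lift radius `R` and near
radius `S`, `|⟨f, MG_Tψ⟩| ≤ c₀e^{δ₀/2}(2 + 4(d+1)/δ₀)^{d+1}·e^{−(δ₀/2)dist_T(supp f,supp f′)}‖f‖₂‖f′‖₂ +
c₀e^{−δ₀(S−1)}‖f‖₂·#Ω̃_R·B`, given the lattice Corollary on the copy pieces and on the residual (`‖residual‖_∞ ≤ B`).
[cite: Balaban1983RegularityDecay, Cor. 2.3 (2.30) p.580, p.572 «operators on subsets of a torus T_η»] -/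
theorem step (ha : 0 < amin) (hℓ : 1 ≤ ℓ) {c₀ δ₀ : ℝ} (hc : 0 ≤ c₀) (hδ : 0 < δ₀) {R S : ℕ} (hR : 1 ≤ R)
    (MT : Matrix (↥(fineDom ((ℓ + 1) ^ i.k) i.ΩT) × ι) (↥(fineDom ((ℓ + 1) ^ i.k) i.ΩT) × ι) ℝ)
    (ML : Matrix (↥(fineDom ((ℓ + 1) ^ i.k) (liftLabels i.P R i.ΩT)) × ι)
      (↥(fineDom ((ℓ + 1) ^ i.k) (liftLabels i.P R i.ΩT)) × ι) ℝ)
    (hM : ∀ (u : ↥(fineDom ((ℓ + 1) ^ i.k) i.ΩT) × ι → ℝ)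
      (xL : ↥(fineDom ((ℓ + 1) ^ i.k) (liftLabels i.P R i.ΩT))), IsInt ((ℓ + 1) ^ i.k) i.P R xL.1 →
      fld (ML *ᵥ pull (hn1 i) i.hP i.hboxΩ R u) xL = fld (MT *ᵥ u) (proj (hn1 i) i.hP i.hboxΩ R xL))
    (ψ : ↥(fineDom ((ℓ + 1) ^ i.k) i.ΩT) × ι → ℝ)
    (TL : (↥(fineDom ((ℓ + 1) ^ i.k) (liftLabels i.P R i.ΩT)) × ι → ℝ)
      → ↥(fineDom ((ℓ + 1) ^ i.k) (liftLabels i.P R i.ΩT)) × ι → ℝ)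
    (hTL : ∀ (s : Finset (Fin (d + 1) → ℤ))
      (v : (Fin (d + 1) → ℤ) → ↥(fineDom ((ℓ + 1) ^ i.k) (liftLabels i.P R i.ΩT)) × ι → ℝ),
      TL (∑ t ∈ s, v t) = ∑ t ∈ s, TL (v t))
    (f f' : ↥(fineDom ((ℓ + 1) ^ i.k) i.ΩT) × ι → ℝ) {B : ℝ}
    (hρ : ∀ x : ↥(fineDom ((ℓ + 1) ^ i.k) (liftLabels i.P R i.ΩT)), Near ((ℓ + 1) ^ i.k) i.P (S - 1) x.1 →
      fld (HL i F R *ᵥ pull (hn1 i) i.hP i.hboxΩ R (i.GT F *ᵥ ψ)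
        - TL (cutNear ((ℓ + 1) ^ i.k) i.P S (pull (hn1 i) i.hP i.hboxΩ R f'))) x = 0)
    (hB : supN (HL i F R *ᵥ pull (hn1 i) i.hP i.hboxΩ R (i.GT F *ᵥ ψ)
        - TL (cutNear ((ℓ + 1) ^ i.k) i.P S (pull (hn1 i) i.hP i.hboxΩ R f'))) ≤ B)
    (hmain : ∀ t ∈ Fintype.piFinset (fun _ : Fin (d + 1) => Finset.Icc (-(S : ℤ)) S),
      |cutNear ((ℓ + 1) ^ i.k) i.P 0 (pull (hn1 i) i.hP i.hboxΩ R f)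
          ⬝ᵥ (ML *ᵥ ((HL i F R)⁻¹ *ᵥ TL (fun p => if cidx i.P (blk ((ℓ + 1) ^ i.k) p.1.1) = t then
            pull (hn1 i) i.hP i.hboxΩ R f' p else 0)))|
        ≤ c₀ * Real.exp (-(δ₀ * (i.liftInst R).ssdist
            (cutNear ((ℓ + 1) ^ i.k) i.P 0 (pull (hn1 i) i.hP i.hboxΩ R f))
            (fun p => if cidx i.P (blk ((ℓ + 1) ^ i.k) p.1.1) = t then pull (hn1 i) i.hP i.hboxΩ R f' p else 0)))
          * Real.sqrt (∑ p, cutNear ((ℓ + 1) ^ i.k) i.P 0 (pull (hn1 i) i.hP i.hboxΩ R f) p ^ 2)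
          * Real.sqrt (∑ p : ↥(fineDom ((ℓ + 1) ^ i.k) (liftLabels i.P R i.ΩT)) × ι,
              (if cidx i.P (blk ((ℓ + 1) ^ i.k) p.1.1) = t then pull (hn1 i) i.hP i.hboxΩ R f' p else 0) ^ 2))
    (htail : |cutNear ((ℓ + 1) ^ i.k) i.P 0 (pull (hn1 i) i.hP i.hboxΩ R f)
          ⬝ᵥ (ML *ᵥ ((HL i F R)⁻¹ *ᵥ (HL i F R *ᵥ pull (hn1 i) i.hP i.hboxΩ R (i.GT F *ᵥ ψ)
            - TL (cutNear ((ℓ + 1) ^ i.k) i.P S (pull (hn1 i) i.hP i.hboxΩ R f')))))|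
        ≤ c₀ * Real.exp (-(δ₀ * (i.liftInst R).ssdist
            (cutNear ((ℓ + 1) ^ i.k) i.P 0 (pull (hn1 i) i.hP i.hboxΩ R f))
            (HL i F R *ᵥ pull (hn1 i) i.hP i.hboxΩ R (i.GT F *ᵥ ψ)
              - TL (cutNear ((ℓ + 1) ^ i.k) i.P S (pull (hn1 i) i.hP i.hboxΩ R f')))))
          * Real.sqrt (∑ p, cutNear ((ℓ + 1) ^ i.k) i.P 0 (pull (hn1 i) i.hP i.hboxΩ R f) p ^ 2)
          * Real.sqrt (∑ p, (HL i F R *ᵥ pull (hn1 i) i.hP i.hboxΩ R (i.GT F *ᵥ ψ)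
              - TL (cutNear ((ℓ + 1) ^ i.k) i.P S (pull (hn1 i) i.hP i.hboxΩ R f'))) p ^ 2)) :
    |f ⬝ᵥ (MT *ᵥ (i.GT F *ᵥ ψ))|
      ≤ c₀ * (Real.exp (δ₀ / 2) * (2 + 2 * ((d : ℝ) + 1) / (δ₀ / 2)) ^ (d + 1))
          * (Real.exp (-(δ₀ / 2 * tssdist i.P f f')) * Real.sqrt (∑ q, f q ^ 2) * Real.sqrt (∑ q, f' q ^ 2))
        + c₀ * Real.exp (-(δ₀ * ((S : ℝ) - 1))) * Real.sqrt (∑ q, f q ^ 2)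
          * ((Fintype.card ↥(fineDom ((ℓ + 1) ^ i.k) (liftLabels i.P R i.ΩT)) : ℝ) * B) := by
  rw [pair_lift i F ha hℓ hR MT ML hM ψ (TL (cutNear ((ℓ + 1) ^ i.k) i.P S (pull (hn1 i) i.hP i.hboxΩ R f'))) f]
  have hA : cutNear ((ℓ + 1) ^ i.k) i.P 0 (pull (hn1 i) i.hP i.hboxΩ R f)
      ⬝ᵥ (ML *ᵥ ((HL i F R)⁻¹ *ᵥ TL (cutNear ((ℓ + 1) ^ i.k) i.P S (pull (hn1 i) i.hP i.hboxΩ R f'))))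
      = ∑ t ∈ Fintype.piFinset (fun _ : Fin (d + 1) => Finset.Icc (-(S : ℤ)) S),
        cutNear ((ℓ + 1) ^ i.k) i.P 0 (pull (hn1 i) i.hP i.hboxΩ R f)
          ⬝ᵥ (ML *ᵥ ((HL i F R)⁻¹ *ᵥ TL (fun p => if cidx i.P (blk ((ℓ + 1) ^ i.k) p.1.1) = t then
            pull (hn1 i) i.hP i.hboxΩ R f' p else 0))) := by
    rw [cutNear_eq_sum_piece S (pull (hn1 i) i.hP i.hboxΩ R f'), hTL, Matrix.mulVec_sum, Matrix.mulVec_sum,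
      dotProduct_sum]
  rw [hA]
  have hK : 0 ≤ Real.exp (-(δ₀ / 2 * tssdist i.P f f')) * Real.sqrt (∑ q, f q ^ 2) * Real.sqrt (∑ q, f' q ^ 2) := by
    positivity
  refine (abs_add_le _ _).trans (add_le_add ?_ (tail_bound i hc hδ.le R S f _ hρ hB htail))
  refine (Finset.abs_sum_le_sum_abs _ _).trans ?_
  refine (Finset.sum_le_sum fun t ht => piece_bound i hc hδ.le R t f f' (hmain t ht)).trans ?_
  exact near_sum_le hc hδ hK S

/-- **ONE STEP, `δG` CLAUSE**: `|⟨f, MG_Tψ − (M₀G₀ψ₀)|_Ω⟩| ≤ c₀e^{δ₀/2}(2 + 4(d+1)/δ₀)^{d+1}e^{−(δ₀/2)dist_T(supp f,supp f′)}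
e^{−δ₀(dist_T(supp f,Ω^c)+dist_T(supp f′,Ω^c))}‖f‖₂‖f′‖₂ + (two residual tails)`, given the lattice `δG` clause on the
copy pieces and the lattice `G` clause on the two residuals. [cite: Balaban1983RegularityDecay, Cor. 2.3 p.581 (δG clause), p.572 «operators on subsets of a torus T_η»] -/
theorem dstep (ha : 0 < amin) (hℓ : 1 ≤ ℓ) {c₀ δ₀ : ℝ} (hc : 0 ≤ c₀) (hδ : 0 < δ₀) {R S : ℕ} (hR : 1 ≤ R)
    (MT : Matrix (↥(fineDom ((ℓ + 1) ^ i.k) i.ΩT) × ι) (↥(fineDom ((ℓ + 1) ^ i.k) i.ΩT) × ι) ℝ)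
    (ML : Matrix (↥(fineDom ((ℓ + 1) ^ i.k) (liftLabels i.P R i.ΩT)) × ι)
      (↥(fineDom ((ℓ + 1) ^ i.k) (liftLabels i.P R i.ΩT)) × ι) ℝ)
    (hM : ∀ (u : ↥(fineDom ((ℓ + 1) ^ i.k) i.ΩT) × ι → ℝ)
      (xL : ↥(fineDom ((ℓ + 1) ^ i.k) (liftLabels i.P R i.ΩT))), IsInt ((ℓ + 1) ^ i.k) i.P R xL.1 →
      fld (ML *ᵥ pull (hn1 i) i.hP i.hboxΩ R u) xL = fld (MT *ᵥ u) (proj (hn1 i) i.hP i.hboxΩ R xL))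
    (M₀T : Matrix (↥(fineDom ((ℓ + 1) ^ i.k) i.Ω₀T) × ι) (↥(fineDom ((ℓ + 1) ^ i.k) i.Ω₀T) × ι) ℝ)
    (M₀L : Matrix (↥(fineDom ((ℓ + 1) ^ i.k) (liftLabels i.P R i.Ω₀T)) × ι)
      (↥(fineDom ((ℓ + 1) ^ i.k) (liftLabels i.P R i.Ω₀T)) × ι) ℝ)
    (hM₀ : ∀ (u₀ : ↥(fineDom ((ℓ + 1) ^ i.k) i.Ω₀T) × ι → ℝ)
      (yL : ↥(fineDom ((ℓ + 1) ^ i.k) (liftLabels i.P R i.Ω₀T))), IsInt ((ℓ + 1) ^ i.k) i.P R yL.1 →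
      fld (M₀L *ᵥ pull (hn1 i) i.hP i.hbox R u₀) yL = fld (M₀T *ᵥ u₀) (proj (hn1 i) i.hP i.hbox R yL))
    (ψ : ↥(fineDom ((ℓ + 1) ^ i.k) i.ΩT) × ι → ℝ) (ψ₀ : ↥(fineDom ((ℓ + 1) ^ i.k) i.Ω₀T) × ι → ℝ)
    (TL : (↥(fineDom ((ℓ + 1) ^ i.k) (liftLabels i.P R i.ΩT)) × ι → ℝ)
      → ↥(fineDom ((ℓ + 1) ^ i.k) (liftLabels i.P R i.ΩT)) × ι → ℝ)
    (hTL : ∀ (s : Finset (Fin (d + 1) → ℤ))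
      (v : (Fin (d + 1) → ℤ) → ↥(fineDom ((ℓ + 1) ^ i.k) (liftLabels i.P R i.ΩT)) × ι → ℝ),
      TL (∑ t ∈ s, v t) = ∑ t ∈ s, TL (v t))
    (TL₀ : (↥(fineDom ((ℓ + 1) ^ i.k) (liftLabels i.P R i.Ω₀T)) × ι → ℝ)
      → ↥(fineDom ((ℓ + 1) ^ i.k) (liftLabels i.P R i.Ω₀T)) × ι → ℝ)
    (hTL₀ : ∀ (s : Finset (Fin (d + 1) → ℤ))
      (v : (Fin (d + 1) → ℤ) → ↥(fineDom ((ℓ + 1) ^ i.k) (liftLabels i.P R i.Ω₀T)) × ι → ℝ),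
      TL₀ (∑ t ∈ s, v t) = ∑ t ∈ s, TL₀ (v t))
    (f f' : ↥(fineDom ((ℓ + 1) ^ i.k) i.ΩT) × ι → ℝ) (hRf : tbdistS i.P f ≤ R)
    (hRf' : tbdistS i.P f' ≤ (R : ℝ) - S) {B B₀ : ℝ}
    (hρ : ∀ x : ↥(fineDom ((ℓ + 1) ^ i.k) (liftLabels i.P R i.ΩT)), Near ((ℓ + 1) ^ i.k) i.P (S - 1) x.1 →
      fld (HL i F R *ᵥ pull (hn1 i) i.hP i.hboxΩ R (i.GT F *ᵥ ψ)
        - TL (cutNear ((ℓ + 1) ^ i.k) i.P S (pull (hn1 i) i.hP i.hboxΩ R f'))) x = 0)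
    (hB : supN (HL i F R *ᵥ pull (hn1 i) i.hP i.hboxΩ R (i.GT F *ᵥ ψ)
        - TL (cutNear ((ℓ + 1) ^ i.k) i.P S (pull (hn1 i) i.hP i.hboxΩ R f'))) ≤ B)
    (hρ₀ : ∀ y : ↥(fineDom ((ℓ + 1) ^ i.k) (liftLabels i.P R i.Ω₀T)), Near ((ℓ + 1) ^ i.k) i.P (S - 1) y.1 →
      fld (H₀L i F R *ᵥ pull (hn1 i) i.hP i.hbox R (i.G₀T F *ᵥ ψ₀)
        - TL₀ (cutNear ((ℓ + 1) ^ i.k) i.P S (pull (hn1 i) i.hP i.hbox R (i.extT f')))) y = 0)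
    (hB₀ : supN (H₀L i F R *ᵥ pull (hn1 i) i.hP i.hbox R (i.G₀T F *ᵥ ψ₀)
        - TL₀ (cutNear ((ℓ + 1) ^ i.k) i.P S (pull (hn1 i) i.hP i.hbox R (i.extT f')))) ≤ B₀)
    (hdmain : ∀ t ∈ Fintype.piFinset (fun _ : Fin (d + 1) => Finset.Icc (-(S : ℤ)) S),
      |cutNear ((ℓ + 1) ^ i.k) i.P 0 (pull (hn1 i) i.hP i.hboxΩ R f)
          ⬝ᵥ (ML *ᵥ ((HL i F R)⁻¹ *ᵥ TL (fun p => if cidx i.P (blk ((ℓ + 1) ^ i.k) p.1.1) = t then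
            pull (hn1 i) i.hP i.hboxΩ R f' p else 0)))
        - cutNear ((ℓ + 1) ^ i.k) i.P 0 (pull (hn1 i) i.hP i.hboxΩ R f)
          ⬝ᵥ (i.liftInst R).resR ((M₀L *ᵥ ((H₀L i F R)⁻¹ *ᵥ TL₀ (fun p =>
            if cidx i.P (blk ((ℓ + 1) ^ i.k) p.1.1) = t then pull (hn1 i) i.hP i.hbox R (i.extT f') p else 0)))
              : ↥(fineDom ((ℓ + 1) ^ i.k) (liftLabels i.P R i.Ω₀T)) × ι → ℝ)|
        ≤ c₀ * Real.exp (-(δ₀ * (i.liftInst R).ssdist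
            (cutNear ((ℓ + 1) ^ i.k) i.P 0 (pull (hn1 i) i.hP i.hboxΩ R f))
            (fun p => if cidx i.P (blk ((ℓ + 1) ^ i.k) p.1.1) = t then pull (hn1 i) i.hP i.hboxΩ R f' p else 0)))
          * Real.exp (-(δ₀ * ((i.liftInst R).bdistS (cutNear ((ℓ + 1) ^ i.k) i.P 0 (pull (hn1 i) i.hP i.hboxΩ R f))
            + (i.liftInst R).bdistS (fun p => if cidx i.P (blk ((ℓ + 1) ^ i.k) p.1.1) = t then
              pull (hn1 i) i.hP i.hboxΩ R f' p else 0))))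
          * Real.sqrt (∑ p, cutNear ((ℓ + 1) ^ i.k) i.P 0 (pull (hn1 i) i.hP i.hboxΩ R f) p ^ 2)
          * Real.sqrt (∑ p : ↥(fineDom ((ℓ + 1) ^ i.k) (liftLabels i.P R i.ΩT)) × ι,
              (if cidx i.P (blk ((ℓ + 1) ^ i.k) p.1.1) = t then pull (hn1 i) i.hP i.hboxΩ R f' p else 0) ^ 2))
    (htail : |cutNear ((ℓ + 1) ^ i.k) i.P 0 (pull (hn1 i) i.hP i.hboxΩ R f)
          ⬝ᵥ (ML *ᵥ ((HL i F R)⁻¹ *ᵥ (HL i F R *ᵥ pull (hn1 i) i.hP i.hboxΩ R (i.GT F *ᵥ ψ)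
            - TL (cutNear ((ℓ + 1) ^ i.k) i.P S (pull (hn1 i) i.hP i.hboxΩ R f')))))|
        ≤ c₀ * Real.exp (-(δ₀ * (i.liftInst R).ssdist
            (cutNear ((ℓ + 1) ^ i.k) i.P 0 (pull (hn1 i) i.hP i.hboxΩ R f))
            (HL i F R *ᵥ pull (hn1 i) i.hP i.hboxΩ R (i.GT F *ᵥ ψ)
              - TL (cutNear ((ℓ + 1) ^ i.k) i.P S (pull (hn1 i) i.hP i.hboxΩ R f')))))
          * Real.sqrt (∑ p, cutNear ((ℓ + 1) ^ i.k) i.P 0 (pull (hn1 i) i.hP i.hboxΩ R f) p ^ 2)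
          * Real.sqrt (∑ p, (HL i F R *ᵥ pull (hn1 i) i.hP i.hboxΩ R (i.GT F *ᵥ ψ)
              - TL (cutNear ((ℓ + 1) ^ i.k) i.P S (pull (hn1 i) i.hP i.hboxΩ R f'))) p ^ 2))
    (htail₀ : |cutNear ((ℓ + 1) ^ i.k) i.P 0 (pull (hn1 i) i.hP i.hboxΩ R f)
          ⬝ᵥ (i.liftInst R).resR ((M₀L *ᵥ ((H₀L i F R)⁻¹
            *ᵥ (H₀L i F R *ᵥ pull (hn1 i) i.hP i.hbox R (i.G₀T F *ᵥ ψ₀)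
              - TL₀ (cutNear ((ℓ + 1) ^ i.k) i.P S (pull (hn1 i) i.hP i.hbox R (i.extT f'))))))
              : ↥(fineDom ((ℓ + 1) ^ i.k) (liftLabels i.P R i.Ω₀T)) × ι → ℝ)|
        ≤ c₀ * Real.exp (-(δ₀ * (i.liftInst₀ R).ssdist
            ((i.liftInst R).extR (cutNear ((ℓ + 1) ^ i.k) i.P 0 (pull (hn1 i) i.hP i.hboxΩ R f)))
            (H₀L i F R *ᵥ pull (hn1 i) i.hP i.hbox R (i.G₀T F *ᵥ ψ₀)
              - TL₀ (cutNear ((ℓ + 1) ^ i.k) i.P S (pull (hn1 i) i.hP i.hbox R (i.extT f'))))))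
          * Real.sqrt (∑ p, (i.liftInst R).extR
              (cutNear ((ℓ + 1) ^ i.k) i.P 0 (pull (hn1 i) i.hP i.hboxΩ R f)) p ^ 2)
          * Real.sqrt (∑ p, (H₀L i F R *ᵥ pull (hn1 i) i.hP i.hbox R (i.G₀T F *ᵥ ψ₀)
              - TL₀ (cutNear ((ℓ + 1) ^ i.k) i.P S (pull (hn1 i) i.hP i.hbox R (i.extT f')))) p ^ 2)) :
    |f ⬝ᵥ (MT *ᵥ (i.GT F *ᵥ ψ) - i.resT (M₀T *ᵥ (i.G₀T F *ᵥ ψ₀)))|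
      ≤ c₀ * (Real.exp (δ₀ / 2) * (2 + 2 * ((d : ℝ) + 1) / (δ₀ / 2)) ^ (d + 1))
          * (Real.exp (-(δ₀ / 2 * tssdist i.P f f')) * Real.exp (-(δ₀ * (tbdistS i.P f + tbdistS i.P f')))
            * Real.sqrt (∑ q, f q ^ 2) * Real.sqrt (∑ q, f' q ^ 2))
        + c₀ * Real.exp (-(δ₀ * ((S : ℝ) - 1))) * Real.sqrt (∑ q, f q ^ 2)
          * ((Fintype.card ↥(fineDom ((ℓ + 1) ^ i.k) (liftLabels i.P R i.ΩT)) : ℝ) * B)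
        + c₀ * Real.exp (-(δ₀ * ((S : ℝ) - 1))) * Real.sqrt (∑ q, f q ^ 2)
          * ((Fintype.card ↥(fineDom ((ℓ + 1) ^ i.k) (liftLabels i.P R i.Ω₀T)) : ℝ) * B₀) := by
  rw [dotProduct_sub,
    pair_lift i F ha hℓ hR MT ML hM ψ (TL (cutNear ((ℓ + 1) ^ i.k) i.P S (pull (hn1 i) i.hP i.hboxΩ R f'))) f,
    pair_lift₀ i F ha hℓ hR M₀T M₀L hM₀ ψ₀
      (TL₀ (cutNear ((ℓ + 1) ^ i.k) i.P S (pull (hn1 i) i.hP i.hbox R (i.extT f')))) f]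
  have hA : cutNear ((ℓ + 1) ^ i.k) i.P 0 (pull (hn1 i) i.hP i.hboxΩ R f)
      ⬝ᵥ (ML *ᵥ ((HL i F R)⁻¹ *ᵥ TL (cutNear ((ℓ + 1) ^ i.k) i.P S (pull (hn1 i) i.hP i.hboxΩ R f'))))
      = ∑ t ∈ Fintype.piFinset (fun _ : Fin (d + 1) => Finset.Icc (-(S : ℤ)) S),
        cutNear ((ℓ + 1) ^ i.k) i.P 0 (pull (hn1 i) i.hP i.hboxΩ R f)
          ⬝ᵥ (ML *ᵥ ((HL i F R)⁻¹ *ᵥ TL (fun p => if cidx i.P (blk ((ℓ + 1) ^ i.k) p.1.1) = t then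
            pull (hn1 i) i.hP i.hboxΩ R f' p else 0))) := by
    rw [cutNear_eq_sum_piece S (pull (hn1 i) i.hP i.hboxΩ R f'), hTL, Matrix.mulVec_sum, Matrix.mulVec_sum,
      dotProduct_sum]
  have hA₀ : cutNear ((ℓ + 1) ^ i.k) i.P 0 (pull (hn1 i) i.hP i.hboxΩ R f)
      ⬝ᵥ (i.liftInst R).resR ((M₀L *ᵥ ((H₀L i F R)⁻¹
        *ᵥ TL₀ (cutNear ((ℓ + 1) ^ i.k) i.P S (pull (hn1 i) i.hP i.hbox R (i.extT f')))))
          : ↥(fineDom ((ℓ + 1) ^ i.k) (liftLabels i.P R i.Ω₀T)) × ι → ℝ)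
      = ∑ t ∈ Fintype.piFinset (fun _ : Fin (d + 1) => Finset.Icc (-(S : ℤ)) S),
        cutNear ((ℓ + 1) ^ i.k) i.P 0 (pull (hn1 i) i.hP i.hboxΩ R f)
          ⬝ᵥ (i.liftInst R).resR ((M₀L *ᵥ ((H₀L i F R)⁻¹ *ᵥ TL₀ (fun p =>
            if cidx i.P (blk ((ℓ + 1) ^ i.k) p.1.1) = t then pull (hn1 i) i.hP i.hbox R (i.extT f') p else 0)))
              : ↥(fineDom ((ℓ + 1) ^ i.k) (liftLabels i.P R i.Ω₀T)) × ι → ℝ) := by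
    rw [cutNear_eq_sum_piece S (pull (hn1 i) i.hP i.hbox R (i.extT f')), hTL₀, Matrix.mulVec_sum,
      Matrix.mulVec_sum, resR_sum_lift]
    exact dotProduct_sum _ _ _
  rw [hA, hA₀]
  have hK : 0 ≤ Real.exp (-(δ₀ / 2 * tssdist i.P f f')) * Real.exp (-(δ₀ * (tbdistS i.P f + tbdistS i.P f')))
      * Real.sqrt (∑ q, f q ^ 2) * Real.sqrt (∑ q, f' q ^ 2) := by
    positivity
  have e3 : ∀ a b c e : ℝ, a + b - (c + e) = (a - c) + b - e := fun a b c e => by ring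
  rw [e3, ← Finset.sum_sub_distrib]
  refine (abs_sub _ _).trans (add_le_add ((abs_add_le _ _).trans (add_le_add ?_
    (tail_bound i hc hδ.le R S f _ hρ hB htail))) (tail_bound₀ i hc hδ.le R S f _ hρ₀ hB₀ htail₀))
  refine (Finset.abs_sum_le_sum_abs _ _).trans ?_
  refine (Finset.sum_le_sum fun t ht => ?_).trans (near_sum_le hc hδ hK S)
  exact dpiece_bound i hc hδ.le R S ht f f' hRf hRf' (hdmain t ht)

omit [Fintype ι] [DecidableEq ι] in
/-- **THE LIFT AT RADIUS `R = 2S + 2` HAS `O((S+1)^{d+1})` SITES**: `#(sites of Ω̃′_R) ≤ #Ω′·n^{d+1}·5^{d+1}·(S+1)^{d+1}`.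
[cite: Balaban1983RegularityDecay, p.572 «periodic conditions», dictionary] -/
theorem card_lift_le {n : ℕ} (P : Fin (d + 1) → ℕ) (Ω' : Finset (Fin (d + 1) → ℤ)) (S : ℕ) :
    (Fintype.card ↥(fineDom n (liftLabels P (2 * S + 2) Ω')) : ℝ)
      ≤ (Ω'.card : ℝ) * (n : ℝ) ^ (d + 1) * 5 ^ (d + 1) * ((S : ℝ) + 1) ^ (d + 1) := by
  rw [Fintype.card_coe]
  have h1 := card_fineDom_le (n := n) (liftLabels P (2 * S + 2) Ω')
  have h2 := card_liftLabels_le (P := P) (2 * S + 2) Ω'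
  have h3 : (fineDom n (liftLabels P (2 * S + 2) Ω')).card ≤ Ω'.card * (2 * (2 * S + 2) + 1) ^ (d + 1) * n ^ (d + 1) :=
    h1.trans (Nat.mul_le_mul_right _ h2)
  have h4 : ((fineDom n (liftLabels P (2 * S + 2) Ω')).card : ℝ)
      ≤ (Ω'.card : ℝ) * (2 * (2 * (S : ℝ) + 2) + 1) ^ (d + 1) * (n : ℝ) ^ (d + 1) := by exact_mod_cast h3
  refine h4.trans ?_
  have h5 : (2 * (2 * (S : ℝ) + 2) + 1) ^ (d + 1) ≤ (5 * ((S : ℝ) + 1)) ^ (d + 1) :=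
    pow_le_pow_left₀ (by positivity) (by linarith) _
  rw [mul_pow] at h5
  have hc : (0 : ℝ) ≤ Ω'.card := Nat.cast_nonneg _
  have hn : (0 : ℝ) ≤ (n : ℝ) ^ (d + 1) := by positivity
  nlinarith [mul_nonneg hc hn]

end Lift

/-! ## §8. The lattice inputs in the lifted form; the sup sizes of the residuals; the tail algebra -/

namespace Lift

open LiftData TorusPairInst

variable {ℓ : ℕ} {amin aplus m2plus : ℝ} (i : TorusPairInst d ℓ amin aplus m2plus) (F : OrthFlow ι)
  {c₀ δ₀ : ℝ}

/-- **THE SUP SIZE OF A RESIDUAL** `‖H̃(u∘π) − N‖_∞ ≤ (4(d+1)n² + m² + a_k)U + 2n‖g‖_∞` for `‖u‖_∞ ≤ U`, `‖N‖_∞ ≤ 2n‖g‖_∞`.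
[cite: Balaban1983RegularityDecay, (1.3)–(1.6) p.572, dictionary] -/
theorem supN_res_le (ha : 0 < amin) (hℓ : 1 ≤ ℓ) (R : ℕ) {Ω' : Finset (Fin (d + 1) → ℤ)}
    (hΩ' : Ω' ⊆ boxDom i.P) (u g : ↥(fineDom ((ℓ + 1) ^ i.k) Ω') × ι → ℝ)
    (N : ↥(fineDom ((ℓ + 1) ^ i.k) (liftLabels i.P R Ω')) × ι → ℝ) {U : ℝ} (hu : supN u ≤ U)
    (hN : supN N ≤ 2 * (((ℓ + 1) ^ i.k : ℕ) : ℝ) * supN g) :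
    supN (regionOp F i.e (hn1 i) i.aK i.m2 (liftLabels i.P R Ω') (perField ((ℓ + 1) ^ i.k) i.P i.Ac)
        *ᵥ pull (hn1 i) i.hP hΩ' R u - N)
      ≤ (4 * ((d : ℝ) + 1) * (((ℓ + 1) ^ i.k : ℕ) : ℝ) ^ 2 + i.m2 + i.aK) * U
        + 2 * (((ℓ + 1) ^ i.k : ℕ) : ℝ) * supN g := by
  have h := supN_residual_le F (hn1 i) i.hP hΩ' R i.e (aK_pos i ha hℓ) i.hm1 i.Ac u N
  have hC : 0 ≤ 4 * ((d : ℝ) + 1) * (((ℓ + 1) ^ i.k : ℕ) : ℝ) ^ 2 + i.m2 + i.aK := by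
    have := i.hm1; have := aK_nonneg i ha hℓ; positivity
  exact h.trans (add_le_add (mul_le_mul_of_nonneg_left hu hC) hN)

omit [DecidableEq ι] in
/-- `‖(g∘π)·1_{Near S}‖_∞ ≤ 2n‖g‖_∞`. [cite: Balaban1983RegularityDecay, (1.9) p.573 «‖f‖_∞», dictionary] -/
theorem supN_cut_le (R S : ℕ) {Ω' : Finset (Fin (d + 1) → ℤ)} (hΩ' : Ω' ⊆ boxDom i.P)
    (g : ↥(fineDom ((ℓ + 1) ^ i.k) Ω') × ι → ℝ) :
    supN (cutNear ((ℓ + 1) ^ i.k) i.P S (pull (hn1 i) i.hP hΩ' R g)) ≤ 2 * (((ℓ + 1) ^ i.k : ℕ) : ℝ) * supN g := by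
  have h1 : supN (cutNear ((ℓ + 1) ^ i.k) i.P S (pull (hn1 i) i.hP hΩ' R g)) ≤ supN g :=
    (supN_cutNear_le _).trans (supN_pull_le (hn1 i) i.hP hΩ' R g)
  have h2 : (1 : ℝ) ≤ 2 * (((ℓ + 1) ^ i.k : ℕ) : ℝ) := by
    have : (1 : ℝ) ≤ (((ℓ + 1) ^ i.k : ℕ) : ℝ) := by exact_mod_cast hn1 i
    linarith
  have h3 := supN_nonneg g
  nlinarith

/-- `‖D^{η*}_ν((g∘π)·1_{Near S})‖_∞ ≤ 2n‖g‖_∞`. [cite: Balaban1983RegularityDecay, (1.3) p.572, (2.30) p.580, dictionary] -/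
theorem supN_DTcut_le (R S : ℕ) {Ω' : Finset (Fin (d + 1) → ℤ)} (hΩ' : Ω' ⊆ boxDom i.P) (ν : Fin (d + 1))
    (g : ↥(fineDom ((ℓ + 1) ^ i.k) Ω') × ι → ℝ) :
    supN ((regionDeriv F i.e ((ℓ + 1) ^ i.k) (liftLabels i.P R Ω') (perField ((ℓ + 1) ^ i.k) i.P i.Ac) ν)ᵀ
        *ᵥ cutNear ((ℓ + 1) ^ i.k) i.P S (pull (hn1 i) i.hP hΩ' R g))
      ≤ 2 * (((ℓ + 1) ^ i.k : ℕ) : ℝ) * supN g := by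
  refine (supN_regionDeriv_transpose_le F i.e _ _ _ ν _).trans ?_
  have h1 : supN (cutNear ((ℓ + 1) ^ i.k) i.P S (pull (hn1 i) i.hP hΩ' R g)) ≤ supN g :=
    (supN_cutNear_le _).trans (supN_pull_le (hn1 i) i.hP hΩ' R g)
  exact mul_le_mul_of_nonneg_left h1 (by positivity)

omit [Fintype ι] [DecidableEq ι] in
/-- **THE TAIL IS POLYNOMIAL TIMES EXPONENTIAL**: `c₀e^{−δ₀(S−1)}F·(#·B) ≤ (c₀e^{δ₀}F·K·B)(S+1)^{d+1}e^{−δ₀S}` when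
`# ≤ K(S+1)^{d+1}`. [cite: Balaban1983RegularityDecay, (2.30) p.580, constants] -/
theorem tail_poly {c₀ δ₀ Fn card K B : ℝ} (hc : 0 ≤ c₀) (hF : 0 ≤ Fn) (hB : 0 ≤ B) (S : ℕ)
    (hcard : card ≤ K * ((S : ℝ) + 1) ^ (d + 1)) :
    c₀ * Real.exp (-(δ₀ * ((S : ℝ) - 1))) * Fn * (card * B)
      ≤ c₀ * Real.exp δ₀ * Fn * K * B * ((S : ℝ) + 1) ^ (d + 1) * Real.exp (-(δ₀ * S)) := by
  have he : Real.exp (-(δ₀ * ((S : ℝ) - 1))) = Real.exp δ₀ * Real.exp (-(δ₀ * S)) := by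
    rw [← Real.exp_add]; ring_nf
  have h1 : card * B ≤ K * ((S : ℝ) + 1) ^ (d + 1) * B := mul_le_mul_of_nonneg_right hcard hB
  have h0 : 0 ≤ c₀ * Real.exp δ₀ * Fn * Real.exp (-(δ₀ * S)) := by positivity
  calc c₀ * Real.exp (-(δ₀ * ((S : ℝ) - 1))) * Fn * (card * B)
      = (c₀ * Real.exp δ₀ * Fn * Real.exp (-(δ₀ * S))) * (card * B) := by rw [he]; ring
    _ ≤ (c₀ * Real.exp δ₀ * Fn * Real.exp (-(δ₀ * S))) * (K * ((S : ℝ) + 1) ^ (d + 1) * B) :=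
        mul_le_mul_of_nonneg_left h1 h0
    _ = _ := by ring

omit [Fintype ι] [DecidableEq ι] in
/-- the four cases `m = 0, 1, 2, 3`. [folklore] -/
private theorem fin4_cases (m : Fin 4) : m = 0 ∨ m = 1 ∨ m = 2 ∨ m = 3 := by
  fin_cases m <;> simp

/-- the lattice Corollary's `G`-pairing bound at a lift, read for `X_0 = G` in the lift's own terms.
[cite: Balaban1983RegularityDecay, Cor. 2.3 (2.30) p.580] -/
theorem latG_zero (R : ℕ)
    (HLR : ∀ (m : Fin 4) (μ ν : Fin (d + 1))
      (g g' : ↥(fineDom ((ℓ + 1) ^ (i.liftInst R).k) (i.liftInst R).Ωc) × ι → ℝ),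
      |g ⬝ᵥ (i.liftInst R).opX F m μ ν g'| ≤ c₀ * Real.exp (-(δ₀ * (i.liftInst R).ssdist g g'))
        * Real.sqrt (∑ p, g p ^ 2) * Real.sqrt (∑ p, g' p ^ 2))
    (μ ν : Fin (d + 1)) (g g' : ↥(fineDom ((ℓ + 1) ^ i.k) (liftLabels i.P R i.ΩT)) × ι → ℝ) :
    |g ⬝ᵥ ((1 : Matrix (↥(fineDom ((ℓ + 1) ^ i.k) (liftLabels i.P R i.ΩT)) × ι)
        (↥(fineDom ((ℓ + 1) ^ i.k) (liftLabels i.P R i.ΩT)) × ι) ℝ) *ᵥ ((HL i F R)⁻¹ *ᵥ g'))|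
      ≤ c₀ * Real.exp (-(δ₀ * (i.liftInst R).ssdist g g')) * Real.sqrt (∑ p, g p ^ 2)
        * Real.sqrt (∑ p, g' p ^ 2) := by
  rw [Matrix.one_mulVec]
  have h := HLR 0 μ ν g g'
  rw [B4Cor23RegionPairFam.opX_zero] at h
  exact h

/-- the same for `X_1 = D_μG`. [cite: Balaban1983RegularityDecay, Cor. 2.3 (2.30) p.580] -/
theorem latG_one (R : ℕ)
    (HLR : ∀ (m : Fin 4) (μ ν : Fin (d + 1))
      (g g' : ↥(fineDom ((ℓ + 1) ^ (i.liftInst R).k) (i.liftInst R).Ωc) × ι → ℝ),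
      |g ⬝ᵥ (i.liftInst R).opX F m μ ν g'| ≤ c₀ * Real.exp (-(δ₀ * (i.liftInst R).ssdist g g'))
        * Real.sqrt (∑ p, g p ^ 2) * Real.sqrt (∑ p, g' p ^ 2))
    (μ ν : Fin (d + 1)) (g g' : ↥(fineDom ((ℓ + 1) ^ i.k) (liftLabels i.P R i.ΩT)) × ι → ℝ) :
    |g ⬝ᵥ (DL i F R μ *ᵥ ((HL i F R)⁻¹ *ᵥ g'))|
      ≤ c₀ * Real.exp (-(δ₀ * (i.liftInst R).ssdist g g')) * Real.sqrt (∑ p, g p ^ 2)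
        * Real.sqrt (∑ p, g' p ^ 2) := by
  have h := HLR 1 μ ν g g'
  rw [B4Cor23RegionPairFam.opX_one] at h
  exact h

/-- the same for `X_2 = GD_ν^*`. [cite: Balaban1983RegularityDecay, Cor. 2.3 (2.30) p.580] -/
theorem latG_two (R : ℕ)
    (HLR : ∀ (m : Fin 4) (μ ν : Fin (d + 1))
      (g g' : ↥(fineDom ((ℓ + 1) ^ (i.liftInst R).k) (i.liftInst R).Ωc) × ι → ℝ),
      |g ⬝ᵥ (i.liftInst R).opX F m μ ν g'| ≤ c₀ * Real.exp (-(δ₀ * (i.liftInst R).ssdist g g'))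
        * Real.sqrt (∑ p, g p ^ 2) * Real.sqrt (∑ p, g' p ^ 2))
    (μ ν : Fin (d + 1)) (g g' : ↥(fineDom ((ℓ + 1) ^ i.k) (liftLabels i.P R i.ΩT)) × ι → ℝ) :
    |g ⬝ᵥ ((1 : Matrix (↥(fineDom ((ℓ + 1) ^ i.k) (liftLabels i.P R i.ΩT)) × ι)
        (↥(fineDom ((ℓ + 1) ^ i.k) (liftLabels i.P R i.ΩT)) × ι) ℝ)
        *ᵥ ((HL i F R)⁻¹ *ᵥ ((DL i F R ν)ᵀ *ᵥ g')))|
      ≤ c₀ * Real.exp (-(δ₀ * (i.liftInst R).ssdist g g')) * Real.sqrt (∑ p, g p ^ 2)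
        * Real.sqrt (∑ p, g' p ^ 2) := by
  rw [Matrix.one_mulVec]
  have h := HLR 2 μ ν g g'
  rw [B4Cor23RegionPairFam.opX_two] at h
  exact h

/-- the same for `X_3 = D_μGD_ν^*`. [cite: Balaban1983RegularityDecay, Cor. 2.3 (2.30) p.580] -/
theorem latG_three (R : ℕ)
    (HLR : ∀ (m : Fin 4) (μ ν : Fin (d + 1))
      (g g' : ↥(fineDom ((ℓ + 1) ^ (i.liftInst R).k) (i.liftInst R).Ωc) × ι → ℝ),
      |g ⬝ᵥ (i.liftInst R).opX F m μ ν g'| ≤ c₀ * Real.exp (-(δ₀ * (i.liftInst R).ssdist g g'))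
        * Real.sqrt (∑ p, g p ^ 2) * Real.sqrt (∑ p, g' p ^ 2))
    (μ ν : Fin (d + 1)) (g g' : ↥(fineDom ((ℓ + 1) ^ i.k) (liftLabels i.P R i.ΩT)) × ι → ℝ) :
    |g ⬝ᵥ (DL i F R μ *ᵥ ((HL i F R)⁻¹ *ᵥ ((DL i F R ν)ᵀ *ᵥ g')))|
      ≤ c₀ * Real.exp (-(δ₀ * (i.liftInst R).ssdist g g')) * Real.sqrt (∑ p, g p ^ 2)
        * Real.sqrt (∑ p, g' p ^ 2) := by
  have h := HLR 3 μ ν g g'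
  rw [B4Cor23RegionPairFam.opX_three] at h
  exact h

/-! ## §9. Corollary 2.3 on the torus region-pair family -/

/-- **(2.30) ON A TORUS REGION PAIR, ALL FOUR PAIRINGS** (one instance, given the lattice Corollary (2.30) on every
lift): `|⟨f, X_m f′⟩| ≤ c₀e^{δ₀/2}(2 + 4(d+1)/δ₀)^{d+1}·e^{−(δ₀/2)dist_T(supp f,supp f′)}‖f‖₂‖f′‖₂`.
[cite: Balaban1983RegularityDecay, Cor. 2.3 (2.30) p.580, p.572 «operators on subsets of a torus T_η»] -/
theorem pair_final (ha : 0 < amin) (hℓ : 1 ≤ ℓ) (hc : 0 < c₀) (hδ : 0 < δ₀)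
    (Hlat : ∀ (R : ℕ) (m : Fin 4) (μ ν : Fin (d + 1))
      (g g' : ↥(fineDom ((ℓ + 1) ^ (i.liftInst R).k) (i.liftInst R).Ωc) × ι → ℝ),
      |g ⬝ᵥ (i.liftInst R).opX F m μ ν g'| ≤ c₀ * Real.exp (-(δ₀ * (i.liftInst R).ssdist g g'))
        * Real.sqrt (∑ p, g p ^ 2) * Real.sqrt (∑ p, g' p ^ 2))
    (m : Fin 4) (μ ν : Fin (d + 1)) (f f' : ↥(fineDom ((ℓ + 1) ^ i.k) i.ΩT) × ι → ℝ) :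
    |f ⬝ᵥ i.opXT F m μ ν f'| ≤ c₀ * (Real.exp (δ₀ / 2) * (2 + 2 * ((d : ℝ) + 1) / (δ₀ / 2)) ^ (d + 1))
      * Real.exp (-(δ₀ / 2 * tssdist i.P f f')) * Real.sqrt (∑ q, f q ^ 2) * Real.sqrt (∑ q, f' q ^ 2) := by
  have hnR : (0 : ℝ) ≤ (((ℓ + 1) ^ i.k : ℕ) : ℝ) := Nat.cast_nonneg _
  have hU1 : supN (i.GT F *ᵥ f') ≤ supN (i.GT F *ᵥ f') + supN (i.GT F *ᵥ ((i.DT F ν)ᵀ *ᵥ f')) :=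
    le_add_of_nonneg_right (supN_nonneg _)
  have hU2 : supN (i.GT F *ᵥ ((i.DT F ν)ᵀ *ᵥ f'))
      ≤ supN (i.GT F *ᵥ f') + supN (i.GT F *ᵥ ((i.DT F ν)ᵀ *ᵥ f')) := le_add_of_nonneg_left (supN_nonneg _)
  have hA0 : 0 ≤ 4 * ((d : ℝ) + 1) * (((ℓ + 1) ^ i.k : ℕ) : ℝ) ^ 2 + i.m2 + i.aK := by
    have := i.hm1; have := aK_nonneg i ha hℓ; positivity
  have hn2 : (0 : ℝ) ≤ 2 * (((ℓ + 1) ^ i.k : ℕ) : ℝ) := by positivity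
  have hB0 : 0 ≤ (4 * ((d : ℝ) + 1) * (((ℓ + 1) ^ i.k : ℕ) : ℝ) ^ 2 + i.m2 + i.aK)
      * (supN (i.GT F *ᵥ f') + supN (i.GT F *ᵥ ((i.DT F ν)ᵀ *ᵥ f'))) + 2 * (((ℓ + 1) ^ i.k : ℕ) : ℝ) * supN f' :=
    add_nonneg (mul_nonneg hA0 (add_nonneg (supN_nonneg _) (supN_nonneg _))) (mul_nonneg hn2 (supN_nonneg _))
  -- one step at every near radius `S ≥ 1`, lift radius `2S + 2`
  have main : ∀ S : ℕ, 1 ≤ S → |f ⬝ᵥ i.opXT F m μ ν f'|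
      ≤ c₀ * (Real.exp (δ₀ / 2) * (2 + 2 * ((d : ℝ) + 1) / (δ₀ / 2)) ^ (d + 1))
          * (Real.exp (-(δ₀ / 2 * tssdist i.P f f')) * Real.sqrt (∑ q, f q ^ 2) * Real.sqrt (∑ q, f' q ^ 2))
        + c₀ * Real.exp (-(δ₀ * ((S : ℝ) - 1))) * Real.sqrt (∑ q, f q ^ 2)
          * ((Fintype.card ↥(fineDom ((ℓ + 1) ^ i.k) (liftLabels i.P (2 * S + 2) i.ΩT)) : ℝ)
            * ((4 * ((d : ℝ) + 1) * (((ℓ + 1) ^ i.k : ℕ) : ℝ) ^ 2 + i.m2 + i.aK)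
              * (supN (i.GT F *ᵥ f') + supN (i.GT F *ᵥ ((i.DT F ν)ᵀ *ᵥ f')))
              + 2 * (((ℓ + 1) ^ i.k : ℕ) : ℝ) * supN f')) := by
    intro S hS
    have hρA : ∀ x : ↥(fineDom ((ℓ + 1) ^ i.k) (liftLabels i.P (2 * S + 2) i.ΩT)),
        Near ((ℓ + 1) ^ i.k) i.P (S - 1) x.1 →
        fld (HL i F (2 * S + 2) *ᵥ pull (hn1 i) i.hP i.hboxΩ (2 * S + 2) (i.GT F *ᵥ f')
          - (fun g => g) (cutNear ((ℓ + 1) ^ i.k) i.P S (pull (hn1 i) i.hP i.hboxΩ (2 * S + 2) f'))) x = 0 :=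
      fun x hx => fld_residual_eq_zero F (hn1 i) i.hP i.h3 i.hboxΩ (2 * S + 2) i.e (aK_pos i ha hℓ) i.hm1
        i.Ac (S := S) (by omega) f' x (hx.mono (Nat.sub_le S 1))
    have hρB : ∀ x : ↥(fineDom ((ℓ + 1) ^ i.k) (liftLabels i.P (2 * S + 2) i.ΩT)),
        Near ((ℓ + 1) ^ i.k) i.P (S - 1) x.1 →
        fld (HL i F (2 * S + 2) *ᵥ pull (hn1 i) i.hP i.hboxΩ (2 * S + 2) (i.GT F *ᵥ ((i.DT F ν)ᵀ *ᵥ f'))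
          - (fun g => (DL i F (2 * S + 2) ν)ᵀ *ᵥ g)
            (cutNear ((ℓ + 1) ^ i.k) i.P S (pull (hn1 i) i.hP i.hboxΩ (2 * S + 2) f'))) x = 0 :=
      fun x hx => fld_residualT_eq_zero F (hn1 i) i.hP i.h3 i.hboxΩ (2 * S + 2) i.e (aK_pos i ha hℓ) i.hm1
        i.Ac hS (by omega) ν f' x hx
    have hBA := supN_res_le i F ha hℓ (2 * S + 2) i.hboxΩ (i.GT F *ᵥ f') f'
      (cutNear ((ℓ + 1) ^ i.k) i.P S (pull (hn1 i) i.hP i.hboxΩ (2 * S + 2) f')) hU1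
      (supN_cut_le i (2 * S + 2) S i.hboxΩ f')
    have hBB := supN_res_le i F ha hℓ (2 * S + 2) i.hboxΩ (i.GT F *ᵥ ((i.DT F ν)ᵀ *ᵥ f')) f'
      ((DL i F (2 * S + 2) ν)ᵀ *ᵥ cutNear ((ℓ + 1) ^ i.k) i.P S (pull (hn1 i) i.hP i.hboxΩ (2 * S + 2) f')) hU2
      (supN_DTcut_le i F (2 * S + 2) S i.hboxΩ ν f')
    have hTid : ∀ (s : Finset (Fin (d + 1) → ℤ))
        (v : (Fin (d + 1) → ℤ) → ↥(fineDom ((ℓ + 1) ^ i.k) (liftLabels i.P (2 * S + 2) i.ΩT)) × ι → ℝ),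
        (fun g => g) (∑ t ∈ s, v t) = ∑ t ∈ s, (fun g => g) (v t) := fun _ _ => rfl
    have hTD : ∀ (s : Finset (Fin (d + 1) → ℤ))
        (v : (Fin (d + 1) → ℤ) → ↥(fineDom ((ℓ + 1) ^ i.k) (liftLabels i.P (2 * S + 2) i.ΩT)) × ι → ℝ),
        (fun g => (DL i F (2 * S + 2) ν)ᵀ *ᵥ g) (∑ t ∈ s, v t)
          = ∑ t ∈ s, (fun g => (DL i F (2 * S + 2) ν)ᵀ *ᵥ g) (v t) := fun _ _ => Matrix.mulVec_sum _ _ _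
    rcases fin4_cases m with rfl | rfl | rfl | rfl
    · rw [opXT_zero]
      have h := step i F ha hℓ hc.le hδ (S := S) (by omega) 1 1 (intertwine_one i (2 * S + 2) i.hboxΩ) f'
        (fun g => g) hTid f f' hρA hBA (fun t _ => latG_zero i F (2 * S + 2) (Hlat (2 * S + 2)) μ ν _ _)
        (latG_zero i F (2 * S + 2) (Hlat (2 * S + 2)) μ ν _ _)
      rw [Matrix.one_mulVec] at h
      exact h
    · rw [opXT_one]
      exact step i F ha hℓ hc.le hδ (S := S) (by omega) (i.DT F μ) (DL i F (2 * S + 2) μ)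
        (intertwine_D i F (2 * S + 2) μ) f' (fun g => g) hTid f f' hρA hBA
        (fun t _ => latG_one i F (2 * S + 2) (Hlat (2 * S + 2)) μ ν _ _)
        (latG_one i F (2 * S + 2) (Hlat (2 * S + 2)) μ ν _ _)
    · rw [opXT_two]
      have h := step i F ha hℓ hc.le hδ (S := S) (by omega) 1 1 (intertwine_one i (2 * S + 2) i.hboxΩ)
        ((i.DT F ν)ᵀ *ᵥ f') (fun g => (DL i F (2 * S + 2) ν)ᵀ *ᵥ g) hTD f f' hρB hBB
        (fun t _ => latG_two i F (2 * S + 2) (Hlat (2 * S + 2)) μ ν _ _)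
        (latG_zero i F (2 * S + 2) (Hlat (2 * S + 2)) μ ν _ _)
      rw [Matrix.one_mulVec] at h
      exact h
    · rw [opXT_three]
      exact step i F ha hℓ hc.le hδ (S := S) (by omega) (i.DT F μ) (DL i F (2 * S + 2) μ)
        (intertwine_D i F (2 * S + 2) μ) ((i.DT F ν)ᵀ *ᵥ f') (fun g => (DL i F (2 * S + 2) ν)ᵀ *ᵥ g) hTD f f'
        hρB hBB (fun t _ => latG_three i F (2 * S + 2) (Hlat (2 * S + 2)) μ ν _ _)
        (latG_one i F (2 * S + 2) (Hlat (2 * S + 2)) μ ν _ _)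
  -- the limit `S → ∞`
  refine le_of_forall_poly_exp_tail
    (c := c₀ * Real.exp δ₀ * Real.sqrt (∑ q, f q ^ 2)
      * ((i.ΩT.card : ℝ) * (((ℓ + 1) ^ i.k : ℕ) : ℝ) ^ (d + 1) * 5 ^ (d + 1))
      * ((4 * ((d : ℝ) + 1) * (((ℓ + 1) ^ i.k : ℕ) : ℝ) ^ 2 + i.m2 + i.aK)
        * (supN (i.GT F *ᵥ f') + supN (i.GT F *ᵥ ((i.DT F ν)ᵀ *ᵥ f'))) + 2 * (((ℓ + 1) ^ i.k : ℕ) : ℝ) * supN f'))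
    (d + 1) hδ 1 fun S hS => (main S hS).trans ?_
  have ht := tail_poly (d := d) (δ₀ := δ₀) hc.le (Real.sqrt_nonneg (∑ q, f q ^ 2)) hB0 S
    (card_lift_le (n := (ℓ + 1) ^ i.k) i.P i.ΩT S)
  have e1 : c₀ * (Real.exp (δ₀ / 2) * (2 + 2 * ((d : ℝ) + 1) / (δ₀ / 2)) ^ (d + 1))
      * (Real.exp (-(δ₀ / 2 * tssdist i.P f f')) * Real.sqrt (∑ q, f q ^ 2) * Real.sqrt (∑ q, f' q ^ 2))
      = c₀ * (Real.exp (δ₀ / 2) * (2 + 2 * ((d : ℝ) + 1) / (δ₀ / 2)) ^ (d + 1))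
        * Real.exp (-(δ₀ / 2 * tssdist i.P f f')) * Real.sqrt (∑ q, f q ^ 2) * Real.sqrt (∑ q, f' q ^ 2) := by
    ring
  rw [e1]
  exact add_le_add le_rfl ht

end Lift

namespace Lift

open LiftData TorusPairInst

variable {ℓ : ℕ} {amin aplus m2plus : ℝ} (i : TorusPairInst d ℓ amin aplus m2plus) (F : OrthFlow ι)
  {c₀ δ₀ : ℝ}

/-- the lattice Corollary's `δG`-pairing bound at a lift on a copy piece, read for `m = 0` in the lift's own terms.
[cite: Balaban1983RegularityDecay, Cor. 2.3 p.581 (δG clause)] -/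
theorem latD_zero (R : ℕ)
    (HLD : ∀ (m : Fin 4) (μ ν : Fin (d + 1))
      (g g' : ↥(fineDom ((ℓ + 1) ^ (i.liftInst R).k) (i.liftInst R).Ωc) × ι → ℝ),
      |g ⬝ᵥ ((i.liftInst R).opX F m μ ν g' - (i.liftInst R).resR ((i.liftInst R).opX₀ F m μ ν ((i.liftInst R).extR g')))|
        ≤ c₀ * Real.exp (-(δ₀ * (i.liftInst R).ssdist g g'))
          * Real.exp (-(δ₀ * ((i.liftInst R).bdistS g + (i.liftInst R).bdistS g')))
          * Real.sqrt (∑ p, g p ^ 2) * Real.sqrt (∑ p, g' p ^ 2))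
    (μ ν : Fin (d + 1)) (g : ↥(fineDom ((ℓ + 1) ^ i.k) (liftLabels i.P R i.ΩT)) × ι → ℝ)
    (t : Fin (d + 1) → ℤ) (f' : ↥(fineDom ((ℓ + 1) ^ i.k) i.ΩT) × ι → ℝ) :
    |g ⬝ᵥ ((1 : Matrix (↥(fineDom ((ℓ + 1) ^ i.k) (liftLabels i.P R i.ΩT)) × ι)
          (↥(fineDom ((ℓ + 1) ^ i.k) (liftLabels i.P R i.ΩT)) × ι) ℝ) *ᵥ ((HL i F R)⁻¹
          *ᵥ (fun p => if cidx i.P (blk ((ℓ + 1) ^ i.k) p.1.1) = t then pull (hn1 i) i.hP i.hboxΩ R f' p else 0)))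
      - g ⬝ᵥ (i.liftInst R).resR (((1 : Matrix (↥(fineDom ((ℓ + 1) ^ i.k) (liftLabels i.P R i.Ω₀T)) × ι)
          (↥(fineDom ((ℓ + 1) ^ i.k) (liftLabels i.P R i.Ω₀T)) × ι) ℝ) *ᵥ ((H₀L i F R)⁻¹
          *ᵥ (fun p => if cidx i.P (blk ((ℓ + 1) ^ i.k) p.1.1) = t then
            pull (hn1 i) i.hP i.hbox R (i.extT f') p else 0))
            : ↥(fineDom ((ℓ + 1) ^ i.k) (liftLabels i.P R i.Ω₀T)) × ι → ℝ))|
      ≤ c₀ * Real.exp (-(δ₀ * (i.liftInst R).ssdist g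
            (fun p => if cidx i.P (blk ((ℓ + 1) ^ i.k) p.1.1) = t then pull (hn1 i) i.hP i.hboxΩ R f' p else 0)))
        * Real.exp (-(δ₀ * ((i.liftInst R).bdistS g + (i.liftInst R).bdistS
            (fun p => if cidx i.P (blk ((ℓ + 1) ^ i.k) p.1.1) = t then pull (hn1 i) i.hP i.hboxΩ R f' p else 0))))
        * Real.sqrt (∑ p, g p ^ 2)
        * Real.sqrt (∑ p : ↥(fineDom ((ℓ + 1) ^ i.k) (liftLabels i.P R i.ΩT)) × ι,
            (if cidx i.P (blk ((ℓ + 1) ^ i.k) p.1.1) = t then pull (hn1 i) i.hP i.hboxΩ R f' p else 0) ^ 2) := by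
  rw [Matrix.one_mulVec, Matrix.one_mulVec]
  have h := HLD 0 μ ν g (fun p => if cidx i.P (blk ((ℓ + 1) ^ i.k) p.1.1) = t then
    pull (hn1 i) i.hP i.hboxΩ R f' p else 0)
  rw [dotProduct_sub, B4Cor23RegionPairFam.opX_zero, B4Cor23RegionPairFam.opX₀_zero, extR_piece_pull] at h
  exact h

/-- the same for `m = 1`. [cite: Balaban1983RegularityDecay, Cor. 2.3 p.581 (δG clause)] -/
theorem latD_one (R : ℕ)
    (HLD : ∀ (m : Fin 4) (μ ν : Fin (d + 1))
      (g g' : ↥(fineDom ((ℓ + 1) ^ (i.liftInst R).k) (i.liftInst R).Ωc) × ι → ℝ),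
      |g ⬝ᵥ ((i.liftInst R).opX F m μ ν g' - (i.liftInst R).resR ((i.liftInst R).opX₀ F m μ ν ((i.liftInst R).extR g')))|
        ≤ c₀ * Real.exp (-(δ₀ * (i.liftInst R).ssdist g g'))
          * Real.exp (-(δ₀ * ((i.liftInst R).bdistS g + (i.liftInst R).bdistS g')))
          * Real.sqrt (∑ p, g p ^ 2) * Real.sqrt (∑ p, g' p ^ 2))
    (μ ν : Fin (d + 1)) (g : ↥(fineDom ((ℓ + 1) ^ i.k) (liftLabels i.P R i.ΩT)) × ι → ℝ)
    (t : Fin (d + 1) → ℤ) (f' : ↥(fineDom ((ℓ + 1) ^ i.k) i.ΩT) × ι → ℝ) :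
    |g ⬝ᵥ (DL i F R μ *ᵥ ((HL i F R)⁻¹
          *ᵥ (fun p => if cidx i.P (blk ((ℓ + 1) ^ i.k) p.1.1) = t then pull (hn1 i) i.hP i.hboxΩ R f' p else 0)))
      - g ⬝ᵥ (i.liftInst R).resR ((D₀L i F R μ *ᵥ ((H₀L i F R)⁻¹
          *ᵥ (fun p => if cidx i.P (blk ((ℓ + 1) ^ i.k) p.1.1) = t then
            pull (hn1 i) i.hP i.hbox R (i.extT f') p else 0))
            : ↥(fineDom ((ℓ + 1) ^ i.k) (liftLabels i.P R i.Ω₀T)) × ι → ℝ))|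
      ≤ c₀ * Real.exp (-(δ₀ * (i.liftInst R).ssdist g
            (fun p => if cidx i.P (blk ((ℓ + 1) ^ i.k) p.1.1) = t then pull (hn1 i) i.hP i.hboxΩ R f' p else 0)))
        * Real.exp (-(δ₀ * ((i.liftInst R).bdistS g + (i.liftInst R).bdistS
            (fun p => if cidx i.P (blk ((ℓ + 1) ^ i.k) p.1.1) = t then pull (hn1 i) i.hP i.hboxΩ R f' p else 0))))
        * Real.sqrt (∑ p, g p ^ 2)
        * Real.sqrt (∑ p : ↥(fineDom ((ℓ + 1) ^ i.k) (liftLabels i.P R i.ΩT)) × ι,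
            (if cidx i.P (blk ((ℓ + 1) ^ i.k) p.1.1) = t then pull (hn1 i) i.hP i.hboxΩ R f' p else 0) ^ 2) := by
  have h := HLD 1 μ ν g (fun p => if cidx i.P (blk ((ℓ + 1) ^ i.k) p.1.1) = t then
    pull (hn1 i) i.hP i.hboxΩ R f' p else 0)
  rw [dotProduct_sub, B4Cor23RegionPairFam.opX_one, B4Cor23RegionPairFam.opX₀_one, extR_piece_pull] at h
  exact h

/-- the same for `m = 2`. [cite: Balaban1983RegularityDecay, Cor. 2.3 p.581 (δG clause)] -/
theorem latD_two (R : ℕ)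
    (HLD : ∀ (m : Fin 4) (μ ν : Fin (d + 1))
      (g g' : ↥(fineDom ((ℓ + 1) ^ (i.liftInst R).k) (i.liftInst R).Ωc) × ι → ℝ),
      |g ⬝ᵥ ((i.liftInst R).opX F m μ ν g' - (i.liftInst R).resR ((i.liftInst R).opX₀ F m μ ν ((i.liftInst R).extR g')))|
        ≤ c₀ * Real.exp (-(δ₀ * (i.liftInst R).ssdist g g'))
          * Real.exp (-(δ₀ * ((i.liftInst R).bdistS g + (i.liftInst R).bdistS g')))
          * Real.sqrt (∑ p, g p ^ 2) * Real.sqrt (∑ p, g' p ^ 2))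
    (μ ν : Fin (d + 1)) (g : ↥(fineDom ((ℓ + 1) ^ i.k) (liftLabels i.P R i.ΩT)) × ι → ℝ)
    (t : Fin (d + 1) → ℤ) (f' : ↥(fineDom ((ℓ + 1) ^ i.k) i.ΩT) × ι → ℝ) :
    |g ⬝ᵥ ((1 : Matrix (↥(fineDom ((ℓ + 1) ^ i.k) (liftLabels i.P R i.ΩT)) × ι)
          (↥(fineDom ((ℓ + 1) ^ i.k) (liftLabels i.P R i.ΩT)) × ι) ℝ) *ᵥ ((HL i F R)⁻¹ *ᵥ ((DL i F R ν)ᵀ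
          *ᵥ (fun p => if cidx i.P (blk ((ℓ + 1) ^ i.k) p.1.1) = t then pull (hn1 i) i.hP i.hboxΩ R f' p else 0))))
      - g ⬝ᵥ (i.liftInst R).resR (((1 : Matrix (↥(fineDom ((ℓ + 1) ^ i.k) (liftLabels i.P R i.Ω₀T)) × ι)
          (↥(fineDom ((ℓ + 1) ^ i.k) (liftLabels i.P R i.Ω₀T)) × ι) ℝ) *ᵥ ((H₀L i F R)⁻¹ *ᵥ ((D₀L i F R ν)ᵀ
          *ᵥ (fun p => if cidx i.P (blk ((ℓ + 1) ^ i.k) p.1.1) = t then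
            pull (hn1 i) i.hP i.hbox R (i.extT f') p else 0)))
            : ↥(fineDom ((ℓ + 1) ^ i.k) (liftLabels i.P R i.Ω₀T)) × ι → ℝ))|
      ≤ c₀ * Real.exp (-(δ₀ * (i.liftInst R).ssdist g
            (fun p => if cidx i.P (blk ((ℓ + 1) ^ i.k) p.1.1) = t then pull (hn1 i) i.hP i.hboxΩ R f' p else 0)))
        * Real.exp (-(δ₀ * ((i.liftInst R).bdistS g + (i.liftInst R).bdistS
            (fun p => if cidx i.P (blk ((ℓ + 1) ^ i.k) p.1.1) = t then pull (hn1 i) i.hP i.hboxΩ R f' p else 0))))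
        * Real.sqrt (∑ p, g p ^ 2)
        * Real.sqrt (∑ p : ↥(fineDom ((ℓ + 1) ^ i.k) (liftLabels i.P R i.ΩT)) × ι,
            (if cidx i.P (blk ((ℓ + 1) ^ i.k) p.1.1) = t then pull (hn1 i) i.hP i.hboxΩ R f' p else 0) ^ 2) := by
  rw [Matrix.one_mulVec, Matrix.one_mulVec]
  have h := HLD 2 μ ν g (fun p => if cidx i.P (blk ((ℓ + 1) ^ i.k) p.1.1) = t then
    pull (hn1 i) i.hP i.hboxΩ R f' p else 0)
  rw [dotProduct_sub, B4Cor23RegionPairFam.opX_two, B4Cor23RegionPairFam.opX₀_two, extR_piece_pull] at h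
  exact h

/-- the same for `m = 3`. [cite: Balaban1983RegularityDecay, Cor. 2.3 p.581 (δG clause)] -/
theorem latD_three (R : ℕ)
    (HLD : ∀ (m : Fin 4) (μ ν : Fin (d + 1))
      (g g' : ↥(fineDom ((ℓ + 1) ^ (i.liftInst R).k) (i.liftInst R).Ωc) × ι → ℝ),
      |g ⬝ᵥ ((i.liftInst R).opX F m μ ν g' - (i.liftInst R).resR ((i.liftInst R).opX₀ F m μ ν ((i.liftInst R).extR g')))|
        ≤ c₀ * Real.exp (-(δ₀ * (i.liftInst R).ssdist g g'))
          * Real.exp (-(δ₀ * ((i.liftInst R).bdistS g + (i.liftInst R).bdistS g')))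
          * Real.sqrt (∑ p, g p ^ 2) * Real.sqrt (∑ p, g' p ^ 2))
    (μ ν : Fin (d + 1)) (g : ↥(fineDom ((ℓ + 1) ^ i.k) (liftLabels i.P R i.ΩT)) × ι → ℝ)
    (t : Fin (d + 1) → ℤ) (f' : ↥(fineDom ((ℓ + 1) ^ i.k) i.ΩT) × ι → ℝ) :
    |g ⬝ᵥ (DL i F R μ *ᵥ ((HL i F R)⁻¹ *ᵥ ((DL i F R ν)ᵀ
          *ᵥ (fun p => if cidx i.P (blk ((ℓ + 1) ^ i.k) p.1.1) = t then pull (hn1 i) i.hP i.hboxΩ R f' p else 0))))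
      - g ⬝ᵥ (i.liftInst R).resR ((D₀L i F R μ *ᵥ ((H₀L i F R)⁻¹ *ᵥ ((D₀L i F R ν)ᵀ
          *ᵥ (fun p => if cidx i.P (blk ((ℓ + 1) ^ i.k) p.1.1) = t then
            pull (hn1 i) i.hP i.hbox R (i.extT f') p else 0)))
            : ↥(fineDom ((ℓ + 1) ^ i.k) (liftLabels i.P R i.Ω₀T)) × ι → ℝ))|
      ≤ c₀ * Real.exp (-(δ₀ * (i.liftInst R).ssdist g
            (fun p => if cidx i.P (blk ((ℓ + 1) ^ i.k) p.1.1) = t then pull (hn1 i) i.hP i.hboxΩ R f' p else 0)))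
        * Real.exp (-(δ₀ * ((i.liftInst R).bdistS g + (i.liftInst R).bdistS
            (fun p => if cidx i.P (blk ((ℓ + 1) ^ i.k) p.1.1) = t then pull (hn1 i) i.hP i.hboxΩ R f' p else 0))))
        * Real.sqrt (∑ p, g p ^ 2)
        * Real.sqrt (∑ p : ↥(fineDom ((ℓ + 1) ^ i.k) (liftLabels i.P R i.ΩT)) × ι,
            (if cidx i.P (blk ((ℓ + 1) ^ i.k) p.1.1) = t then pull (hn1 i) i.hP i.hboxΩ R f' p else 0) ^ 2) := by
  have h := HLD 3 μ ν g (fun p => if cidx i.P (blk ((ℓ + 1) ^ i.k) p.1.1) = t then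
    pull (hn1 i) i.hP i.hboxΩ R f' p else 0)
  rw [dotProduct_sub, B4Cor23RegionPairFam.opX_three, B4Cor23RegionPairFam.opX₀_three, extR_piece_pull] at h
  exact h

omit [DecidableEq ι] in
/-- `⟨f̃₀, V|_{Ω̃}⟩ = ⟨Ef̃₀, V⟩` on the lift. [cite: Balaban1983RegularityDecay, (1.11) p.573, dictionary] -/
theorem dot_resR_eq (R : ℕ) (g : ↥(fineDom ((ℓ + 1) ^ i.k) (liftLabels i.P R i.ΩT)) × ι → ℝ)
    (V : ↥(fineDom ((ℓ + 1) ^ i.k) (liftLabels i.P R i.Ω₀T)) × ι → ℝ) :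
    g ⬝ᵥ (i.liftInst R).resR V = (i.liftInst R).extR g ⬝ᵥ V := by
  rw [B4Cor23RegionPairFam.resR_eq_resV, B4Cor23RegionPairFam.extR_eq_extV]
  exact (B4Cor23RegionDeltaAlg.extV_dotProduct _ _ _).symm

/-- the lattice Corollary's `G`-pairing bound at the lift of `Ω₀`, for `X_0 = G₀`, read against a source of `Ω̃`
restricted back. [cite: Balaban1983RegularityDecay, Cor. 2.3 (2.30) p.580, (1.11) p.573] -/
theorem lat₀_zero (R : ℕ)
    (HL₀ : ∀ (m : Fin 4) (μ ν : Fin (d + 1))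
      (g g' : ↥(fineDom ((ℓ + 1) ^ (i.liftInst₀ R).k) (i.liftInst₀ R).Ωc) × ι → ℝ),
      |g ⬝ᵥ (i.liftInst₀ R).opX F m μ ν g'| ≤ c₀ * Real.exp (-(δ₀ * (i.liftInst₀ R).ssdist g g'))
        * Real.sqrt (∑ p, g p ^ 2) * Real.sqrt (∑ p, g' p ^ 2))
    (μ ν : Fin (d + 1)) (g : ↥(fineDom ((ℓ + 1) ^ i.k) (liftLabels i.P R i.ΩT)) × ι → ℝ)
    (g' : ↥(fineDom ((ℓ + 1) ^ i.k) (liftLabels i.P R i.Ω₀T)) × ι → ℝ) :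
    |g ⬝ᵥ (i.liftInst R).resR (((1 : Matrix (↥(fineDom ((ℓ + 1) ^ i.k) (liftLabels i.P R i.Ω₀T)) × ι)
          (↥(fineDom ((ℓ + 1) ^ i.k) (liftLabels i.P R i.Ω₀T)) × ι) ℝ) *ᵥ ((H₀L i F R)⁻¹ *ᵥ g'))
          : ↥(fineDom ((ℓ + 1) ^ i.k) (liftLabels i.P R i.Ω₀T)) × ι → ℝ)|
      ≤ c₀ * Real.exp (-(δ₀ * (i.liftInst₀ R).ssdist ((i.liftInst R).extR g) g'))
        * Real.sqrt (∑ p, (i.liftInst R).extR g p ^ 2) * Real.sqrt (∑ p, g' p ^ 2) := by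
  rw [Matrix.one_mulVec, dot_resR_eq]
  have h := HL₀ 0 μ ν ((i.liftInst R).extR g) g'
  rw [B4Cor23RegionPairFam.opX_zero] at h
  exact h

/-- the same for `X_1 = D_μG₀`. [cite: Balaban1983RegularityDecay, Cor. 2.3 (2.30) p.580, (1.11) p.573] -/
theorem lat₀_one (R : ℕ)
    (HL₀ : ∀ (m : Fin 4) (μ ν : Fin (d + 1))
      (g g' : ↥(fineDom ((ℓ + 1) ^ (i.liftInst₀ R).k) (i.liftInst₀ R).Ωc) × ι → ℝ),
      |g ⬝ᵥ (i.liftInst₀ R).opX F m μ ν g'| ≤ c₀ * Real.exp (-(δ₀ * (i.liftInst₀ R).ssdist g g'))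
        * Real.sqrt (∑ p, g p ^ 2) * Real.sqrt (∑ p, g' p ^ 2))
    (μ ν : Fin (d + 1)) (g : ↥(fineDom ((ℓ + 1) ^ i.k) (liftLabels i.P R i.ΩT)) × ι → ℝ)
    (g' : ↥(fineDom ((ℓ + 1) ^ i.k) (liftLabels i.P R i.Ω₀T)) × ι → ℝ) :
    |g ⬝ᵥ (i.liftInst R).resR ((D₀L i F R μ *ᵥ ((H₀L i F R)⁻¹ *ᵥ g'))
          : ↥(fineDom ((ℓ + 1) ^ i.k) (liftLabels i.P R i.Ω₀T)) × ι → ℝ)|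
      ≤ c₀ * Real.exp (-(δ₀ * (i.liftInst₀ R).ssdist ((i.liftInst R).extR g) g'))
        * Real.sqrt (∑ p, (i.liftInst R).extR g p ^ 2) * Real.sqrt (∑ p, g' p ^ 2) := by
  rw [dot_resR_eq]
  have h := HL₀ 1 μ ν ((i.liftInst R).extR g) g'
  rw [B4Cor23RegionPairFam.opX_one] at h
  exact h

end Lift

namespace Lift

open LiftData TorusPairInst

variable {ℓ : ℕ} {amin aplus m2plus : ℝ} (i : TorusPairInst d ℓ amin aplus m2plus) (F : OrthFlow ι)
  {c₀ δ₀ : ℝ}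

/-- **THE `δG` CLAUSE ON A TORUS REGION PAIR, ALL FOUR PAIRINGS** (one instance, given the lattice Corollary, both
clauses, on every lift of `Ω ⊂ Ω₀` and the `G` clause on every lift of `Ω₀`):
`|⟨f, X^Ω_m f′ − (X^{Ω₀}_m Ef′)|_Ω⟩| ≤ c₀e^{δ₀/2}(2 + 4(d+1)/δ₀)^{d+1}e^{−(δ₀/2)dist_T(supp f,supp f′)}
e^{−(δ₀/2)(dist_T(supp f,Ω^c) + dist_T(supp f′,Ω^c))}‖f‖₂‖f′‖₂`. [cite: Balaban1983RegularityDecay, Cor. 2.3 p.581 (δG clause), p.572 «operators on subsets of a torus T_η»] -/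
theorem dpair_final (ha : 0 < amin) (hℓ : 1 ≤ ℓ) (hc : 0 < c₀) (hδ : 0 < δ₀)
    (Hlat : ∀ (R : ℕ) (m : Fin 4) (μ ν : Fin (d + 1))
      (g g' : ↥(fineDom ((ℓ + 1) ^ (i.liftInst R).k) (i.liftInst R).Ωc) × ι → ℝ),
      |g ⬝ᵥ (i.liftInst R).opX F m μ ν g'| ≤ c₀ * Real.exp (-(δ₀ * (i.liftInst R).ssdist g g'))
        * Real.sqrt (∑ p, g p ^ 2) * Real.sqrt (∑ p, g' p ^ 2))
    (HlatD : ∀ (R : ℕ) (m : Fin 4) (μ ν : Fin (d + 1))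
      (g g' : ↥(fineDom ((ℓ + 1) ^ (i.liftInst R).k) (i.liftInst R).Ωc) × ι → ℝ),
      |g ⬝ᵥ ((i.liftInst R).opX F m μ ν g' - (i.liftInst R).resR ((i.liftInst R).opX₀ F m μ ν ((i.liftInst R).extR g')))|
        ≤ c₀ * Real.exp (-(δ₀ * (i.liftInst R).ssdist g g'))
          * Real.exp (-(δ₀ * ((i.liftInst R).bdistS g + (i.liftInst R).bdistS g')))
          * Real.sqrt (∑ p, g p ^ 2) * Real.sqrt (∑ p, g' p ^ 2))
    (Hlat₀ : ∀ (R : ℕ) (m : Fin 4) (μ ν : Fin (d + 1))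
      (g g' : ↥(fineDom ((ℓ + 1) ^ (i.liftInst₀ R).k) (i.liftInst₀ R).Ωc) × ι → ℝ),
      |g ⬝ᵥ (i.liftInst₀ R).opX F m μ ν g'| ≤ c₀ * Real.exp (-(δ₀ * (i.liftInst₀ R).ssdist g g'))
        * Real.sqrt (∑ p, g p ^ 2) * Real.sqrt (∑ p, g' p ^ 2))
    (m : Fin 4) (μ ν : Fin (d + 1)) (f f' : ↥(fineDom ((ℓ + 1) ^ i.k) i.ΩT) × ι → ℝ) :
    |f ⬝ᵥ (i.opXT F m μ ν f' - i.resT (i.opX₀T F m μ ν (i.extT f')))|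
      ≤ c₀ * (Real.exp (δ₀ / 2) * (2 + 2 * ((d : ℝ) + 1) / (δ₀ / 2)) ^ (d + 1))
        * Real.exp (-(δ₀ / 2 * tssdist i.P f f'))
        * Real.exp (-(δ₀ / 2 * (tbdistS i.P f + tbdistS i.P f')))
        * Real.sqrt (∑ q, f q ^ 2) * Real.sqrt (∑ q, f' q ^ 2) := by
  have hU1 : supN (i.GT F *ᵥ f') ≤ supN (i.GT F *ᵥ f') + supN (i.GT F *ᵥ ((i.DT F ν)ᵀ *ᵥ f')) :=
    le_add_of_nonneg_right (supN_nonneg _)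
  have hU2 : supN (i.GT F *ᵥ ((i.DT F ν)ᵀ *ᵥ f'))
      ≤ supN (i.GT F *ᵥ f') + supN (i.GT F *ᵥ ((i.DT F ν)ᵀ *ᵥ f')) := le_add_of_nonneg_left (supN_nonneg _)
  have hV1 : supN (i.G₀T F *ᵥ i.extT f')
      ≤ supN (i.G₀T F *ᵥ i.extT f') + supN (i.G₀T F *ᵥ ((i.D₀T F ν)ᵀ *ᵥ i.extT f')) :=
    le_add_of_nonneg_right (supN_nonneg _)
  have hV2 : supN (i.G₀T F *ᵥ ((i.D₀T F ν)ᵀ *ᵥ i.extT f'))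
      ≤ supN (i.G₀T F *ᵥ i.extT f') + supN (i.G₀T F *ᵥ ((i.D₀T F ν)ᵀ *ᵥ i.extT f')) :=
    le_add_of_nonneg_left (supN_nonneg _)
  have hA0 : 0 ≤ 4 * ((d : ℝ) + 1) * (((ℓ + 1) ^ i.k : ℕ) : ℝ) ^ 2 + i.m2 + i.aK := by
    have := i.hm1; have := aK_nonneg i ha hℓ; positivity
  have hn2 : (0 : ℝ) ≤ 2 * (((ℓ + 1) ^ i.k : ℕ) : ℝ) := by positivity
  have hB0 : 0 ≤ (4 * ((d : ℝ) + 1) * (((ℓ + 1) ^ i.k : ℕ) : ℝ) ^ 2 + i.m2 + i.aK)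
      * (supN (i.GT F *ᵥ f') + supN (i.GT F *ᵥ ((i.DT F ν)ᵀ *ᵥ f'))) + 2 * (((ℓ + 1) ^ i.k : ℕ) : ℝ) * supN f' :=
    add_nonneg (mul_nonneg hA0 (add_nonneg (supN_nonneg _) (supN_nonneg _))) (mul_nonneg hn2 (supN_nonneg _))
  have hB0' : 0 ≤ (4 * ((d : ℝ) + 1) * (((ℓ + 1) ^ i.k : ℕ) : ℝ) ^ 2 + i.m2 + i.aK)
      * (supN (i.G₀T F *ᵥ i.extT f') + supN (i.G₀T F *ᵥ ((i.D₀T F ν)ᵀ *ᵥ i.extT f')))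
      + 2 * (((ℓ + 1) ^ i.k : ℕ) : ℝ) * supN (i.extT f') :=
    add_nonneg (mul_nonneg hA0 (add_nonneg (supN_nonneg _) (supN_nonneg _))) (mul_nonneg hn2 (supN_nonneg _))
  -- one step at every near radius `S ≥ S₀`, lift radius `2S + 2`
  have main : ∀ S : ℕ, ⌈tbdistS i.P f⌉₊ + ⌈tbdistS i.P f'⌉₊ + 1 ≤ S →
      |f ⬝ᵥ (i.opXT F m μ ν f' - i.resT (i.opX₀T F m μ ν (i.extT f')))|
      ≤ c₀ * (Real.exp (δ₀ / 2) * (2 + 2 * ((d : ℝ) + 1) / (δ₀ / 2)) ^ (d + 1))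
          * (Real.exp (-(δ₀ / 2 * tssdist i.P f f')) * Real.exp (-(δ₀ * (tbdistS i.P f + tbdistS i.P f')))
            * Real.sqrt (∑ q, f q ^ 2) * Real.sqrt (∑ q, f' q ^ 2))
        + c₀ * Real.exp (-(δ₀ * ((S : ℝ) - 1))) * Real.sqrt (∑ q, f q ^ 2)
          * ((Fintype.card ↥(fineDom ((ℓ + 1) ^ i.k) (liftLabels i.P (2 * S + 2) i.ΩT)) : ℝ)
            * ((4 * ((d : ℝ) + 1) * (((ℓ + 1) ^ i.k : ℕ) : ℝ) ^ 2 + i.m2 + i.aK)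
              * (supN (i.GT F *ᵥ f') + supN (i.GT F *ᵥ ((i.DT F ν)ᵀ *ᵥ f')))
              + 2 * (((ℓ + 1) ^ i.k : ℕ) : ℝ) * supN f'))
        + c₀ * Real.exp (-(δ₀ * ((S : ℝ) - 1))) * Real.sqrt (∑ q, f q ^ 2)
          * ((Fintype.card ↥(fineDom ((ℓ + 1) ^ i.k) (liftLabels i.P (2 * S + 2) i.Ω₀T)) : ℝ)
            * ((4 * ((d : ℝ) + 1) * (((ℓ + 1) ^ i.k : ℕ) : ℝ) ^ 2 + i.m2 + i.aK)
              * (supN (i.G₀T F *ᵥ i.extT f') + supN (i.G₀T F *ᵥ ((i.D₀T F ν)ᵀ *ᵥ i.extT f')))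
              + 2 * (((ℓ + 1) ^ i.k : ℕ) : ℝ) * supN (i.extT f'))) := by
    intro S hS0
    have hS : 1 ≤ S := by omega
    have hRf : tbdistS i.P f ≤ ((2 * S + 2 : ℕ) : ℝ) := by
      have h1 := Nat.le_ceil (tbdistS i.P f)
      have h2 : ((⌈tbdistS i.P f⌉₊ : ℕ) : ℝ) ≤ S := by exact_mod_cast (by omega : ⌈tbdistS i.P f⌉₊ ≤ S)
      push_cast; linarith
    have hRf' : tbdistS i.P f' ≤ ((2 * S + 2 : ℕ) : ℝ) - S := by
      have h1 := Nat.le_ceil (tbdistS i.P f')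
      have h2 : ((⌈tbdistS i.P f'⌉₊ : ℕ) : ℝ) ≤ S := by exact_mod_cast (by omega : ⌈tbdistS i.P f'⌉₊ ≤ S)
      push_cast; linarith
    have hρA : ∀ x : ↥(fineDom ((ℓ + 1) ^ i.k) (liftLabels i.P (2 * S + 2) i.ΩT)),
        Near ((ℓ + 1) ^ i.k) i.P (S - 1) x.1 →
        fld (HL i F (2 * S + 2) *ᵥ pull (hn1 i) i.hP i.hboxΩ (2 * S + 2) (i.GT F *ᵥ f')
          - (fun g => g) (cutNear ((ℓ + 1) ^ i.k) i.P S (pull (hn1 i) i.hP i.hboxΩ (2 * S + 2) f'))) x = 0 :=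
      fun x hx => fld_residual_eq_zero F (hn1 i) i.hP i.h3 i.hboxΩ (2 * S + 2) i.e (aK_pos i ha hℓ) i.hm1
        i.Ac (S := S) (by omega) f' x (hx.mono (Nat.sub_le S 1))
    have hρB : ∀ x : ↥(fineDom ((ℓ + 1) ^ i.k) (liftLabels i.P (2 * S + 2) i.ΩT)),
        Near ((ℓ + 1) ^ i.k) i.P (S - 1) x.1 →
        fld (HL i F (2 * S + 2) *ᵥ pull (hn1 i) i.hP i.hboxΩ (2 * S + 2) (i.GT F *ᵥ ((i.DT F ν)ᵀ *ᵥ f'))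
          - (fun g => (DL i F (2 * S + 2) ν)ᵀ *ᵥ g)
            (cutNear ((ℓ + 1) ^ i.k) i.P S (pull (hn1 i) i.hP i.hboxΩ (2 * S + 2) f'))) x = 0 :=
      fun x hx => fld_residualT_eq_zero F (hn1 i) i.hP i.h3 i.hboxΩ (2 * S + 2) i.e (aK_pos i ha hℓ) i.hm1
        i.Ac hS (by omega) ν f' x hx
    have hρA₀ : ∀ y : ↥(fineDom ((ℓ + 1) ^ i.k) (liftLabels i.P (2 * S + 2) i.Ω₀T)),
        Near ((ℓ + 1) ^ i.k) i.P (S - 1) y.1 →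
        fld (H₀L i F (2 * S + 2) *ᵥ pull (hn1 i) i.hP i.hbox (2 * S + 2) (i.G₀T F *ᵥ i.extT f')
          - (fun g => g) (cutNear ((ℓ + 1) ^ i.k) i.P S (pull (hn1 i) i.hP i.hbox (2 * S + 2) (i.extT f')))) y = 0 :=
      fun y hy => fld_residual_eq_zero F (hn1 i) i.hP i.h3 i.hbox (2 * S + 2) i.e (aK_pos i ha hℓ) i.hm1
        i.Ac (S := S) (by omega) (i.extT f') y (hy.mono (Nat.sub_le S 1))
    have hρB₀ : ∀ y : ↥(fineDom ((ℓ + 1) ^ i.k) (liftLabels i.P (2 * S + 2) i.Ω₀T)),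
        Near ((ℓ + 1) ^ i.k) i.P (S - 1) y.1 →
        fld (H₀L i F (2 * S + 2) *ᵥ pull (hn1 i) i.hP i.hbox (2 * S + 2) (i.G₀T F *ᵥ ((i.D₀T F ν)ᵀ *ᵥ i.extT f'))
          - (fun g => (D₀L i F (2 * S + 2) ν)ᵀ *ᵥ g)
            (cutNear ((ℓ + 1) ^ i.k) i.P S (pull (hn1 i) i.hP i.hbox (2 * S + 2) (i.extT f')))) y = 0 :=
      fun y hy => fld_residualT_eq_zero F (hn1 i) i.hP i.h3 i.hbox (2 * S + 2) i.e (aK_pos i ha hℓ) i.hm1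
        i.Ac hS (by omega) ν (i.extT f') y hy
    have hBA := supN_res_le i F ha hℓ (2 * S + 2) i.hboxΩ (i.GT F *ᵥ f') f'
      (cutNear ((ℓ + 1) ^ i.k) i.P S (pull (hn1 i) i.hP i.hboxΩ (2 * S + 2) f')) hU1
      (supN_cut_le i (2 * S + 2) S i.hboxΩ f')
    have hBB := supN_res_le i F ha hℓ (2 * S + 2) i.hboxΩ (i.GT F *ᵥ ((i.DT F ν)ᵀ *ᵥ f')) f'
      ((DL i F (2 * S + 2) ν)ᵀ *ᵥ cutNear ((ℓ + 1) ^ i.k) i.P S (pull (hn1 i) i.hP i.hboxΩ (2 * S + 2) f')) hU2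
      (supN_DTcut_le i F (2 * S + 2) S i.hboxΩ ν f')
    have hBA₀ := supN_res_le i F ha hℓ (2 * S + 2) i.hbox (i.G₀T F *ᵥ i.extT f') (i.extT f')
      (cutNear ((ℓ + 1) ^ i.k) i.P S (pull (hn1 i) i.hP i.hbox (2 * S + 2) (i.extT f'))) hV1
      (supN_cut_le i (2 * S + 2) S i.hbox (i.extT f'))
    have hBB₀ := supN_res_le i F ha hℓ (2 * S + 2) i.hbox (i.G₀T F *ᵥ ((i.D₀T F ν)ᵀ *ᵥ i.extT f')) (i.extT f')
      ((D₀L i F (2 * S + 2) ν)ᵀ *ᵥ cutNear ((ℓ + 1) ^ i.k) i.P S (pull (hn1 i) i.hP i.hbox (2 * S + 2) (i.extT f')))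
      hV2 (supN_DTcut_le i F (2 * S + 2) S i.hbox ν (i.extT f'))
    have hTid : ∀ (s : Finset (Fin (d + 1) → ℤ))
        (v : (Fin (d + 1) → ℤ) → ↥(fineDom ((ℓ + 1) ^ i.k) (liftLabels i.P (2 * S + 2) i.ΩT)) × ι → ℝ),
        (fun g => g) (∑ t ∈ s, v t) = ∑ t ∈ s, (fun g => g) (v t) := fun _ _ => rfl
    have hTD : ∀ (s : Finset (Fin (d + 1) → ℤ))
        (v : (Fin (d + 1) → ℤ) → ↥(fineDom ((ℓ + 1) ^ i.k) (liftLabels i.P (2 * S + 2) i.ΩT)) × ι → ℝ),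
        (fun g => (DL i F (2 * S + 2) ν)ᵀ *ᵥ g) (∑ t ∈ s, v t)
          = ∑ t ∈ s, (fun g => (DL i F (2 * S + 2) ν)ᵀ *ᵥ g) (v t) := fun _ _ => Matrix.mulVec_sum _ _ _
    have hTid₀ : ∀ (s : Finset (Fin (d + 1) → ℤ))
        (v : (Fin (d + 1) → ℤ) → ↥(fineDom ((ℓ + 1) ^ i.k) (liftLabels i.P (2 * S + 2) i.Ω₀T)) × ι → ℝ),
        (fun g => g) (∑ t ∈ s, v t) = ∑ t ∈ s, (fun g => g) (v t) := fun _ _ => rfl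
    have hTD₀ : ∀ (s : Finset (Fin (d + 1) → ℤ))
        (v : (Fin (d + 1) → ℤ) → ↥(fineDom ((ℓ + 1) ^ i.k) (liftLabels i.P (2 * S + 2) i.Ω₀T)) × ι → ℝ),
        (fun g => (D₀L i F (2 * S + 2) ν)ᵀ *ᵥ g) (∑ t ∈ s, v t)
          = ∑ t ∈ s, (fun g => (D₀L i F (2 * S + 2) ν)ᵀ *ᵥ g) (v t) := fun _ _ => Matrix.mulVec_sum _ _ _
    rcases fin4_cases m with rfl | rfl | rfl | rfl
    · rw [opXT_zero, opX₀T_zero]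
      have h := dstep i F ha hℓ hc.le hδ (S := S) (by omega) 1 1 (intertwine_one i (2 * S + 2) i.hboxΩ)
        1 1 (intertwine_one i (2 * S + 2) i.hbox) f' (i.extT f') (fun g => g) hTid (fun g => g) hTid₀ f f'
        hRf hRf' hρA hBA hρA₀ hBA₀ (fun t _ => latD_zero i F (2 * S + 2) (HlatD (2 * S + 2)) μ ν _ t f')
        (latG_zero i F (2 * S + 2) (Hlat (2 * S + 2)) μ ν _ _)
        (lat₀_zero i F (2 * S + 2) (Hlat₀ (2 * S + 2)) μ ν _ _)
      simp only [Matrix.one_mulVec] at h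
      exact h
    · rw [opXT_one, opX₀T_one]
      exact dstep i F ha hℓ hc.le hδ (S := S) (by omega) (i.DT F μ) (DL i F (2 * S + 2) μ)
        (intertwine_D i F (2 * S + 2) μ) (i.D₀T F μ) (D₀L i F (2 * S + 2) μ) (intertwine_D₀ i F (2 * S + 2) μ)
        f' (i.extT f') (fun g => g) hTid (fun g => g) hTid₀ f f' hRf hRf' hρA hBA hρA₀ hBA₀
        (fun t _ => latD_one i F (2 * S + 2) (HlatD (2 * S + 2)) μ ν _ t f')
        (latG_one i F (2 * S + 2) (Hlat (2 * S + 2)) μ ν _ _)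
        (lat₀_one i F (2 * S + 2) (Hlat₀ (2 * S + 2)) μ ν _ _)
    · rw [opXT_two, opX₀T_two]
      have h := dstep i F ha hℓ hc.le hδ (S := S) (by omega) 1 1 (intertwine_one i (2 * S + 2) i.hboxΩ)
        1 1 (intertwine_one i (2 * S + 2) i.hbox) ((i.DT F ν)ᵀ *ᵥ f') ((i.D₀T F ν)ᵀ *ᵥ i.extT f')
        (fun g => (DL i F (2 * S + 2) ν)ᵀ *ᵥ g) hTD (fun g => (D₀L i F (2 * S + 2) ν)ᵀ *ᵥ g) hTD₀ f f'
        hRf hRf' hρB hBB hρB₀ hBB₀ (fun t _ => latD_two i F (2 * S + 2) (HlatD (2 * S + 2)) μ ν _ t f')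
        (latG_zero i F (2 * S + 2) (Hlat (2 * S + 2)) μ ν _ _)
        (lat₀_zero i F (2 * S + 2) (Hlat₀ (2 * S + 2)) μ ν _ _)
      simp only [Matrix.one_mulVec] at h
      exact h
    · rw [opXT_three, opX₀T_three]
      exact dstep i F ha hℓ hc.le hδ (S := S) (by omega) (i.DT F μ) (DL i F (2 * S + 2) μ)
        (intertwine_D i F (2 * S + 2) μ) (i.D₀T F μ) (D₀L i F (2 * S + 2) μ) (intertwine_D₀ i F (2 * S + 2) μ)
        ((i.DT F ν)ᵀ *ᵥ f') ((i.D₀T F ν)ᵀ *ᵥ i.extT f')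
        (fun g => (DL i F (2 * S + 2) ν)ᵀ *ᵥ g) hTD (fun g => (D₀L i F (2 * S + 2) ν)ᵀ *ᵥ g) hTD₀ f f'
        hRf hRf' hρB hBB hρB₀ hBB₀ (fun t _ => latD_three i F (2 * S + 2) (HlatD (2 * S + 2)) μ ν _ t f')
        (latG_one i F (2 * S + 2) (Hlat (2 * S + 2)) μ ν _ _)
        (lat₀_one i F (2 * S + 2) (Hlat₀ (2 * S + 2)) μ ν _ _)
  -- the limit `S → ∞`
  have hmain_le : c₀ * (Real.exp (δ₀ / 2) * (2 + 2 * ((d : ℝ) + 1) / (δ₀ / 2)) ^ (d + 1))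
      * (Real.exp (-(δ₀ / 2 * tssdist i.P f f')) * Real.exp (-(δ₀ * (tbdistS i.P f + tbdistS i.P f')))
        * Real.sqrt (∑ q, f q ^ 2) * Real.sqrt (∑ q, f' q ^ 2))
      ≤ c₀ * (Real.exp (δ₀ / 2) * (2 + 2 * ((d : ℝ) + 1) / (δ₀ / 2)) ^ (d + 1))
        * Real.exp (-(δ₀ / 2 * tssdist i.P f f'))
        * Real.exp (-(δ₀ / 2 * (tbdistS i.P f + tbdistS i.P f')))
        * Real.sqrt (∑ q, f q ^ 2) * Real.sqrt (∑ q, f' q ^ 2) := by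
    have hb := tbdistS_nonneg i.P f
    have hb' := tbdistS_nonneg i.P f'
    have hE : Real.exp (-(δ₀ * (tbdistS i.P f + tbdistS i.P f')))
        ≤ Real.exp (-(δ₀ / 2 * (tbdistS i.P f + tbdistS i.P f'))) := Real.exp_le_exp.2 (by nlinarith)
    have h0 : 0 ≤ c₀ * (Real.exp (δ₀ / 2) * (2 + 2 * ((d : ℝ) + 1) / (δ₀ / 2)) ^ (d + 1))
        * Real.exp (-(δ₀ / 2 * tssdist i.P f f')) := by positivity
    calc _ = c₀ * (Real.exp (δ₀ / 2) * (2 + 2 * ((d : ℝ) + 1) / (δ₀ / 2)) ^ (d + 1))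
          * Real.exp (-(δ₀ / 2 * tssdist i.P f f')) * Real.exp (-(δ₀ * (tbdistS i.P f + tbdistS i.P f')))
          * Real.sqrt (∑ q, f q ^ 2) * Real.sqrt (∑ q, f' q ^ 2) := by ring
      _ ≤ _ := by
          refine mul_le_mul_of_nonneg_right (mul_le_mul_of_nonneg_right
            (mul_le_mul_of_nonneg_left hE h0) (Real.sqrt_nonneg _)) (Real.sqrt_nonneg _)
  refine le_of_forall_poly_exp_tail
    (c := c₀ * Real.exp δ₀ * Real.sqrt (∑ q, f q ^ 2)
      * ((i.ΩT.card : ℝ) * (((ℓ + 1) ^ i.k : ℕ) : ℝ) ^ (d + 1) * 5 ^ (d + 1))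
      * ((4 * ((d : ℝ) + 1) * (((ℓ + 1) ^ i.k : ℕ) : ℝ) ^ 2 + i.m2 + i.aK)
        * (supN (i.GT F *ᵥ f') + supN (i.GT F *ᵥ ((i.DT F ν)ᵀ *ᵥ f'))) + 2 * (((ℓ + 1) ^ i.k : ℕ) : ℝ) * supN f')
      + c₀ * Real.exp δ₀ * Real.sqrt (∑ q, f q ^ 2)
      * ((i.Ω₀T.card : ℝ) * (((ℓ + 1) ^ i.k : ℕ) : ℝ) ^ (d + 1) * 5 ^ (d + 1))
      * ((4 * ((d : ℝ) + 1) * (((ℓ + 1) ^ i.k : ℕ) : ℝ) ^ 2 + i.m2 + i.aK)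
        * (supN (i.G₀T F *ᵥ i.extT f') + supN (i.G₀T F *ᵥ ((i.D₀T F ν)ᵀ *ᵥ i.extT f')))
        + 2 * (((ℓ + 1) ^ i.k : ℕ) : ℝ) * supN (i.extT f')))
    (d + 1) hδ (⌈tbdistS i.P f⌉₊ + ⌈tbdistS i.P f'⌉₊ + 1) fun S hS => (main S hS).trans ?_
  have ht := tail_poly (d := d) (δ₀ := δ₀) hc.le (Real.sqrt_nonneg (∑ q, f q ^ 2)) hB0 S
    (card_lift_le (n := (ℓ + 1) ^ i.k) i.P i.ΩT S)
  have ht₀ := tail_poly (d := d) (δ₀ := δ₀) hc.le (Real.sqrt_nonneg (∑ q, f q ^ 2)) hB0' S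
    (card_lift_le (n := (ℓ + 1) ^ i.k) i.P i.Ω₀T S)
  exact (add_le_add (add_le_add hmain_le ht) ht₀).trans (le_of_eq (by ring))

end Lift

/-! ## §10. Corollary 2.3 on the family of torus region pairs -/

section Assembly

open Lift LiftData TorusPairInst

/-- **COROLLARY 2.3 (2.30) AND ITS `δG` CLAUSE ON THE FAMILY OF TORUS REGION PAIRS `Ω ⊂ Ω₀ ⊂ T_η` AT A (1.7)-REGULAR
TORUS FIELD, IN THE TYPED FORM `B4.Cor23Printed`.**  For the family `torusPairFam F d ℓ a₋ a₊ m²₊ c β K`: there are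
`c₀, δ₀, e₁ > 0` such that for every instance whose torus field is (1.7)-regular on `Ω₀`, whose `Ω`, `Ω₀`, `T_η` are
unions of `K`-blocks, and whose coupling is `0 < e ≤ e₁`, all four pairings `|⟨f, G_k(Ω,A)f′⟩|`, `|⟨f, D^η_{A,μ}G_kf′⟩|`,
`|⟨f, G_kD^{η*}_{A,ν}f′⟩|`, `|⟨f, D^η_{A,μ}G_kD^{η*}_{A,ν}f′⟩|` are `≤ c₀e^{−δ₀dist_T(supp f,supp f′)}‖f‖₂‖f′‖₂`, and the
four `δG_k(Ω,Ω₀,A)` pairings carry the additional factor `e^{−δ₀(dist_T(supp f,Ω^c) + dist_T(supp f′,Ω^c))}` — with the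
lattice family's `e₁`, `δ₀/2` for the lattice family's `δ₀`, and `c₀e^{δ₀/2}(2 + 4(d+1)/δ₀)^{d+1}` for its `c₀` (the sum
over the copies of the period box).  «Another common case is to consider operators on subsets of a torus T_η … with
periodic conditions.» «Let us notice also that now there are no restrictions on supports of f, f′.»  Non-vacuity of
the hypotheses: g9's `B4ThmTorusPairEta.hypotheses_met` (every `K ≥ 1`, every `e₁ > 0`).
[cite: Balaban1983RegularityDecay, Cor. 2.3 (2.30) pp.580–581, p.572 «operators on subsets of a torus T_η»] -/
theorem cor23Printed_torusPairFam (F : OrthFlow ι) {ℓ₁ : ℝ} (hℓ₁ : 0 ≤ ℓ₁)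
    (hLip : ∀ t (v : ι → ℝ), ((F.U t - 1) *ᵥ v) ⬝ᵥ ((F.U t - 1) *ᵥ v) ≤ (ℓ₁ * t) ^ 2 * (v ⬝ᵥ v))
    (d ℓ : ℕ) (hℓ : 1 ≤ ℓ) (amin aplus m2plus : ℝ) (ha : 0 < amin) (creg β : ℝ) (hcreg : 0 ≤ creg)
    (hβ : 0 < β) (K : ℕ) :
    B4.Cor23Printed (torusPairFam F d ℓ amin aplus m2plus creg β K) := by
  obtain ⟨c₀, δ₀, e₁, hc, hδ, he₁, H⟩ :=
    B4Cor23RegionPairFam.cor23Printed_regionPairFam F hℓ₁ hLip d ℓ hℓ amin aplus m2plus ha creg β hcreg hβ K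
  have hd : (0 : ℝ) ≤ d := Nat.cast_nonneg d
  refine ⟨c₀ * (Real.exp (δ₀ / 2) * (2 + 2 * ((d : ℝ) + 1) / (δ₀ / 2)) ^ (d + 1)), δ₀ / 2, e₁,
    by positivity, half_pos hδ, he₁, ?_⟩
  intro i hreg hbig he hle m μ ν f f'
  have hK1 : 1 ≤ K := by
    have hKP : ∀ ν, K ∣ i.P ν := hbig.2.2
    rcases Nat.eq_zero_or_pos K with h0 | h0
    · exfalso
      have h1 := hKP 0
      rw [h0, zero_dvd_iff] at h1
      have h2 := i.hP 0
      omega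
    · exact h0
  have Hboth : ∀ (R : ℕ) (m : Fin 4) (μ ν : Fin (d + 1))
      (g g' : ↥(fineDom ((ℓ + 1) ^ (i.liftInst R).k) (i.liftInst R).Ωc) × ι → ℝ),
      |g ⬝ᵥ (i.liftInst R).opX F m μ ν g'| ≤ c₀ * Real.exp (-(δ₀ * (i.liftInst R).ssdist g g'))
        * Real.sqrt (∑ p, g p ^ 2) * Real.sqrt (∑ p, g' p ^ 2) ∧
      |g ⬝ᵥ ((i.liftInst R).opX F m μ ν g' - (i.liftInst R).resR ((i.liftInst R).opX₀ F m μ ν ((i.liftInst R).extR g')))|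
        ≤ c₀ * Real.exp (-(δ₀ * (i.liftInst R).ssdist g g'))
          * Real.exp (-(δ₀ * ((i.liftInst R).bdistS g + (i.liftInst R).bdistS g')))
          * Real.sqrt (∑ p, g p ^ 2) * Real.sqrt (∑ p, g' p ^ 2) :=
    fun R m μ ν g g' => H (i.liftInst R) (i.regular_lift F R hreg) (i.bigBlocks_lift F hK1 R hbig) he hle m μ ν g g'
  have H₀ : ∀ (R : ℕ) (m : Fin 4) (μ ν : Fin (d + 1))
      (g g' : ↥(fineDom ((ℓ + 1) ^ (i.liftInst₀ R).k) (i.liftInst₀ R).Ωc) × ι → ℝ),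
      |g ⬝ᵥ (i.liftInst₀ R).opX F m μ ν g'| ≤ c₀ * Real.exp (-(δ₀ * (i.liftInst₀ R).ssdist g g'))
        * Real.sqrt (∑ p, g p ^ 2) * Real.sqrt (∑ p, g' p ^ 2) :=
    fun R m μ ν g g' => (H (i.liftInst₀ R) (i.regular_lift₀ F R hreg) (i.bigBlocks_lift₀ F hK1 R hbig)
      he hle m μ ν g g').1
  exact ⟨pair_final i F ha hℓ hc hδ (fun R m μ ν g g' => (Hboth R m μ ν g g').1) m μ ν f f',
    dpair_final i F ha hℓ hc hδ (fun R m μ ν g g' => (Hboth R m μ ν g g').1) (fun R m μ ν g g' => (Hboth R m μ ν g g').2)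
      H₀ m μ ν f f'⟩

end Assembly

end

end Literature.MathematicalPhysics.QuantumFieldTheory.Balaban1983to89.B4Cor23TorusPairFam
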